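import Literature.MathematicalPhysics.QuantumManyBody.PeriodicBoseGasEq317
import Literature.MathematicalPhysics.QuantumManyBody.PeriodicBoseGasUpperBoundProofs
import Literature.MathematicalPhysics.QuantumManyBody.DiluteBoseGasUpperBoundProofs
import Mathlib.MeasureTheory.Integral.Marginal
import Mathlib.Analysis.SpecialFunctions.SmoothTransition
import Mathlib.Analysis.SpecialFunctions.Trigonometric.Deriv
import HarnessLib

/-!
# Basti–Cenatiempo–Schlein 2021, App. A, Lemma A.1: localising torus states into a Dirichlet box
# (smooth cut-off form) — `E₀^D(N, L + 2ℓ) ≤ (1 + 4/M) E₀^per(N, L) + C N/(M ℓ²)`, `L = 2ℓM`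

Topic `Literature/MathematicalPhysics/QuantumManyBody`, second proofs companion of
`DiluteBoseGasUpperBound.lean` (provefact
`Literature.MathematicalPhysics.QuantumManyBody.BoseGas.BastiCenatiempoSchlein2021_upperBound`),
after `DiluteBoseGasUpperBoundProofs.lean` (the replication machinery of Lemma A.2 / (A.13)).

[BastiCenatiempoSchlein2021, App. A] (arXiv:2101.06222 pp. 25–26): "First, we show how to switch
from periodic boundary conditions to Dirichlet boundary conditions, increasing a bit the size of the
box." Given an `L`-periodic `Ψ_L`, (A.1) sets `Ψ^D_{L+2ℓ,u}(x₁,…,x_n) = Ψ_L(x₁,…,x_n) ∏ᵢ Q_{L,ℓ}(xᵢ - u)`,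
`Q_{L,ℓ}(x) = ∏_{j=1}^3 q_{L,ℓ}(x^{(j)})`, with the cosine cut-off `q_{L,ℓ}` (`cos` ramps of width `2ℓ`
at both ends, `1` in between), and **Lemma A.1** states `‖Ψ^D‖ = 1`,
`⟨Ψ^D, 𝒩ʲΨ^D⟩ = ⟨Ψ_L, 𝒩ʲΨ_L⟩` and, for a suitable shift `ū ∈ Λ_L`,
`⟨Ψ^D_{L+2ℓ,ū}, 𝓗Ψ^D_{L+2ℓ,ū}⟩ ≤ ⟨Ψ_L, 𝓗Ψ_L⟩ + (C/(Lℓ))⟨Ψ_L, 𝒩Ψ_L⟩` (A.2). Its proof rests on the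
identity (A.3) `∫_{-L/2-ℓ}^{L/2+ℓ} |ψ|² q² = ∫_{-L/2}^{L/2} |ψ|²` for `L`-periodic `ψ`
("using that `cos²x + cos²(x - π/2) = 1`"), on `V ≤ V_L` (A.5'), on an integration by parts of the
cross term of `|(qψ)'|²` (A.4)–(A.5), and on averaging over `u ∈ Λ_L`.

This file PROVES the canonical (`N`-particle) statement for the tree's variational objects
(`PeriodicTrialState`/`periodicEnergy`/`periodicGroundStateEnergy = E₀^per` on the torus with the
periodised interaction, `TrialState`/`groundStateEnergy = E₀^D`), in the following form
(`exists_dirichlet_le_periodic`): there is a universal `C` with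
**`E₀^D(N, L + 2ℓ) ≤ (1 + 4/M) E₀^per(N, L) + C N/(M ℓ²)` for `L = 2ℓM`, `ℓ > 0`, `M ≥ 1`,
`v ≥ 0` measurable.** Differences from the printed lemma, all forced by the `C¹` variational
setting and harmless for the thermodynamic limit (where `M, ℓ → ∞`):
* the cosine cut-off is only Lipschitz, so it is replaced by the `C^∞` cut-off
  `q(t) = sin(π/2·S(t/2ℓ)) cos(π/2·S((t-L)/2ℓ))` built on Mathlib's `Real.smoothTransition` `S`, which
  still satisfies the exact two-term partition of unity `∑_m q(t - Lm)² = 1` behind (A.3)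
  (`exists_smooth_cutoff`);
* the cross term is bounded by Cauchy–Schwarz (`|a+b|² ≤ 2|a|² + 2|b|²` on the ramps only) instead of
  being integrated by parts, which costs the factor `1 + 4/M` on the kinetic energy;
* the average over `u ∈ Λ_L` is replaced by the average over the `M³` shifts `u ∈ (2ℓ{0,…,M-1})³`,
  for which the ramp windows tile the torus (`sum_tsum_indicator_ramps_le`), so that no measure of
  the ramps has to be computed.

## Contents (all proved)

* `tsum_pi_fin_int_prod` — Tonelli for the counting measure on `ℤ^k` in `ℝ≥0∞`.
* `lintegral_mul_eq_lintegral_mul_indicator_latSum`, `lintegral_mul_prod_eq_setLIntegral_cellN` —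
  **unfolding the torus against weights**: for `F ≥ 0` invariant under the lattice translations of
  each particle, `∫_{(ℝ³)^N} F ∏ᵢ wᵢ(xᵢ) = ∫_{[0,L)^{3N}} F ∏ᵢ wᵢ^per(xᵢ)` (from the tiling lemma
  `tsum_lintegral_cell_sub_latticeVec` of `PeriodicBoseGasLemma32.lean`, one particle at a time by
  `MeasureTheory.lmarginal`); `apply_sub_single_latticeVec` — generator periodicity ⇒ lattice
  invariance.
* `exists_smooth_cutoff` — the cut-off and its properties; `tsum_prodWeight_sub_latticeVec`,
  `tsum_rampWeight_sub_latticeVec`, `sum_tsum_indicator_ramps_le` — lattice sums of the weights.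
* `fderiv_prodCutoff_single`, `fderiv_cutoffState_single`, `ennnorm_fderiv_cutoffState_sq_le` — the
  product rule for `Φ_u = ψ(· + u) ∏ q(x_{ik})` and the pointwise kinetic bound.
* `lintegral_ennnorm_cutoffState_sq` (`‖Φ_u‖ = 1`), `lintegral_kineticDensity_cutoffState_le`,
  `lintegral_interaction_cutoffState_le`, `energyIntegral_cutoffState_le` — the energy for a fixed
  shift; `exists_dirichlet_le_periodic` — the best shift.
* `limsup_energyDensity_le_dyson` — **the Dyson–Lieb–Seiringer–Yngvason upper bound in the
  thermodynamic limit with Dirichlet boundary conditions** [LSSY2005, Thm. 2.2 (2.14)–(2.15), "in the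
  thermodynamic limit (and for all boundary conditions)"]: for finite-range measurable `v ≥ 0` with
  finite scattering length `a`, with the constants `C, c` of `LSSY2005_upperBound_periodic`,
  `limsup_N E₀^D(N, L_N)/L_N³ ≤ 4πρ²a(1 + C a(4πρ/3)^{1/3})` whenever `a(4πρ/3)^{1/3} < c`
  (`L_N = (N/ρ)^{1/3}`) — from `LSSY2005_upperBound_periodic_holds` (periodic boxes),
  `exists_dirichlet_le_periodic` (localisation, `M = ℓ = n`) and `limsup_energyDensity_le_of_block`
  (replication) by letting the block grow, `n → ∞`; `limsup_energyDensity_le_dyson'` — the same in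
  the `Y^{1/3}` form of (2.15), `∃ C ρ₀, ∀ ρ < ρ₀, limsup ≤ 4πρ²a(1 + C(ρa³)^{1/3})` (for `a > 0`);
  `eventually_groundStateEnergy_le_dyson` — the fixed-density finite-`N` form
  `E₀^D(N, (N/ρ)^{1/3}) ≤ 4πρa(1 + C(ρa³)^{1/3})N` for all large `N`. This is the first-order part of
  [BastiCenatiempoSchlein2021, Thm. 1.1]; the second-order (Lee–Huang–Yang) part needs the
  Fock-space trial state of Prop. 1.3 and is NOT proved here.
* `…_eta` versions (`ennnorm_fderiv_cutoffState_sq_le_eta`, …, `exists_dirichlet_le_periodic_eta`) —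
  the same localisation with a Young parameter `η > 0` on the ramps:
  `E₀^D(N, L + 2ℓ) ≤ (1 + 4η/M) E₀^per(N, L) + C(1 + η⁻¹)N/(Mℓ²)`, so that the kinetic excess can be
  made negligible against the second-order term (with `L = ρ^{-γ}` this costs `O(√(ρa)/L)` per
  particle after optimising `η`, subleading for every `γ > 1`, as the localisation error in the
  paper's proof of Thm. 1.1 with `γ = 11/10`).
* `BastiCenatiempoSchlein2021_upperBound_of_periodicLHYBlocks` — **the assembly "Proof of
  Theorem 1.1" from periodic blocks** (canonical form of Prop. 1.3 with `γ = 11/10` ⇒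
  `BastiCenatiempoSchlein2021_upperBound`): density shift `ρ̃ = ρ(1 + 8ρ^{3/5})` (1.8),
  localisation with `M = ⌈ρ^{-3/5}⌉` (Lemma A.1) and replication (Lemma A.2), every error being
  `O(ρ^{5/2+1/10})`; with the bookkeeping lemmas `lhy_mainTerm_adjusted_le`, `padded_density_lt`.
  What remains for `BastiCenatiempoSchlein2021_upperBound_holds` is exactly its hypothesis, the
  periodic Lee–Huang–Yang trial state of [BastiCenatiempoSchlein2021, Prop. 1.3] in canonical form.

## References

* [BastiCenatiempoSchlein2021] G. Basti, S. Cenatiempo, B. Schlein, *A new second-order upper bound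
  for the ground state energy of dilute Bose gases*, Forum Math. Sigma 9 (2021) e74
  (arXiv:2101.06222), App. A, Lemma A.1 with (A.1)–(A.5) (pp. 25–26 of the arXiv text).
* [LSSY2005] E. H. Lieb, R. Seiringer, J. P. Solovej, J. Yngvason, *The Mathematics of the Bose Gas
  and its Condensation* (2005), Ch. 2: boundary conditions (after (2.2)), Thm. 2.2 (2.14)–(2.15) and
  the sentence following it (p. 12 of arXiv:cond-mat/0610117).
-/

noncomputable section

open MeasureTheory Filter Metric
open scoped ENNReal NNReal Topology

namespace Literature.MathematicalPhysics.QuantumManyBody.BoseGas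

/-! ### Products of lattice sums: `∑_{n ∈ ℤ^k} ∏ᵢ fᵢ(nᵢ) = ∏ᵢ ∑_{m ∈ ℤ} fᵢ(m)` in `ℝ≥0∞` -/

/-- Tonelli for counting measure on `ℤ^k`: `∑_{n : Fin k → ℤ} ∏ᵢ fᵢ(nᵢ) = ∏ᵢ ∑_m fᵢ(m)` in `ℝ≥0∞`.
[folklore] -/
theorem tsum_pi_fin_int_prod : ∀ (k : ℕ) (f : Fin k → ℤ → ℝ≥0∞),
    ∑' n : Fin k → ℤ, ∏ i, f i (n i) = ∏ i, ∑' m, f i m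
  | 0, f => by simp [tsum_fintype]
  | k + 1, f => by
    rw [← (Fin.consEquiv fun _ : Fin (k + 1) ↦ ℤ).tsum_eq, ENNReal.tsum_prod', Fin.prod_univ_succ]
    simp only [Fin.consEquiv_apply, Fin.prod_univ_succ, Fin.cons_zero, Fin.cons_succ]
    rw [← ENNReal.tsum_mul_right]
    refine tsum_congr fun m ↦ ?_
    rw [ENNReal.tsum_mul_left, tsum_pi_fin_int_prod k fun i ↦ f i.succ]

/-- The same over the three axes: `∑_{n ∈ ℤ³} ∏ₖ fₖ(nₖ) = ∏ₖ ∑_m fₖ(m)`. [folklore] -/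
theorem tsum_pi_int_prod_three (f : Fin 3 → ℤ → ℝ≥0∞) :
    ∑' n : Fin 3 → ℤ, ∏ k, f k (n k) = ∏ k, ∑' m, f k m :=
  tsum_pi_fin_int_prod 3 f

/-! ### Unfolding the torus against a weight -/

variable {L : ℝ}

/-- Updating a coordinate commutes with subtracting a vector supported on that coordinate.
[folklore] -/
theorem update_sub_single {N : ℕ} (X : Config N) (i : Fin N) (y v : Space) :
    Function.update X i (y - v) = Function.update X i y - Pi.single i v := by
  funext j
  by_cases h : j = i
  · subst h; simp
  · simp [Function.update_of_ne h, Pi.single_eq_of_ne h]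

/-- Updating a coordinate commutes with subtracting a vector supported on another coordinate.
[folklore] -/
theorem update_sub_single_of_ne {N : ℕ} (X : Config N) {i j : Fin N} (hji : j ≠ i) (y v : Space) :
    Function.update (X - Pi.single j v) i y = Function.update X i y - Pi.single j v := by
  funext m
  by_cases h : m = i
  · subst h; simp [Pi.single_eq_of_ne hji.symm]
  · simp [Function.update_of_ne h]

/-- **Unfolding with a weight (one particle).** For `G ≥ 0` measurable and `Lℤ³`-periodic and any
measurable weight `w ≥ 0`, `∫_{ℝ³} G w = ∫_{[0,L)³} G · w^per`, `w^per = ∑_{n∈ℤ³} w(· - Ln)`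
(`latSum`): the translates of the cell tile `ℝ³`. [folklore] -/
theorem lintegral_mul_eq_lintegral_mul_indicator_latSum (hL : 0 < L) {G w : Space → ℝ≥0∞}
    (hG : Measurable G) (hw : Measurable w)
    (hper : ∀ (y : Space) (n : Fin 3 → ℤ), G (y - latticeVec L n) = G y) :
    ∫⁻ y, G y * w y = ∫⁻ y, G y * (cell L).indicator (fun y ↦ ∑' n : Fin 3 → ℤ, w (y - latticeVec L n)) y := by
  have h1 : ∫⁻ y, G y * w y = ∫⁻ y in cell L, G y * ∑' n : Fin 3 → ℤ, w (y - latticeVec L n) := by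
    rw [← tsum_lintegral_cell_sub_latticeVec hL fun y ↦ G y * w y]
    simp only [hper]
    have hm : ∀ n : Fin 3 → ℤ,
        AEMeasurable (fun y : Space ↦ G y * w (y - latticeVec L n)) (volume.restrict (cell L)) :=
      fun n ↦ (hG.mul (hw.comp (measurable_id.sub_const _))).aemeasurable
    rw [← lintegral_tsum hm]
    refine setLIntegral_congr_fun (measurableSet_cell L) fun y _ ↦ ?_
    rw [ENNReal.tsum_mul_left]
  rw [h1, ← lintegral_indicator (measurableSet_cell L)]
  refine lintegral_congr fun y ↦ ?_
  by_cases hy : y ∈ cell L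
  · simp [Set.indicator_of_mem hy]
  · simp [Set.indicator_of_notMem hy]

/-- **Unfolding with weights (`N` particles).** For `F ≥ 0` measurable on `(ℝ³)^N`, invariant under
the `Lℤ³`-translations of every single particle, and measurable weights `wᵢ ≥ 0`,
`∫_{(ℝ³)^N} F(X) ∏ᵢ wᵢ(xᵢ) dX = ∫_{[0,L)^{3N}} F(X) ∏ᵢ wᵢ^per(xᵢ) dX` (integrate the particles out
one at a time, `MeasureTheory.lmarginal`). [folklore] -/
theorem lintegral_mul_prod_eq_setLIntegral_cellN {N : ℕ} (hL : 0 < L) {F : Config N → ℝ≥0∞}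
    (hF : Measurable F)
    (hper : ∀ (X : Config N) (i : Fin N) (n : Fin 3 → ℤ), F (X - Pi.single i (latticeVec L n)) = F X)
    {w : Fin N → Space → ℝ≥0∞} (hw : ∀ i, Measurable (w i)) :
    ∫⁻ X, F X * ∏ i, w i (X i) = ∫⁻ X in cellN N L, F X * ∏ i, ∑' n : Fin 3 → ℤ, w i (X i - latticeVec L n) := by
  classical
  -- the claim for the marginal over a set `s` of particles, for all admissible `F`
  suffices key : ∀ (s : Finset (Fin N)) (F : Config N → ℝ≥0∞), Measurable F →
      (∀ (X : Config N) (i : Fin N) (n : Fin 3 → ℤ), i ∈ s →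
        F (X - Pi.single i (latticeVec L n)) = F X) →
      ∫⋯∫⁻_s, (fun X ↦ F X * ∏ i ∈ s, w i (X i)) ∂(fun _ : Fin N ↦ (volume : Measure Space)) =
        ∫⋯∫⁻_s, (fun X ↦ F X * ∏ i ∈ s, (cell L).indicator (fun y ↦ ∑' n : Fin 3 → ℤ, w i (y - latticeVec L n)) (X i))
          ∂(fun _ : Fin N ↦ (volume : Measure Space)) by
    have h := congr_fun (key Finset.univ F hF fun X i n _ ↦ hper X i n) 0
    rw [← lintegral_eq_lmarginal_univ (0 : Config N), ← lintegral_eq_lmarginal_univ (0 : Config N),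
      ← volume_pi] at h
    rw [h, ← lintegral_indicator (measurableSet_cellN N L)]
    refine lintegral_congr fun X ↦ ?_
    by_cases hX : X ∈ cellN N L
    · rw [Set.indicator_of_mem hX]
      congr 1
      exact Finset.prod_congr rfl fun i _ ↦ Set.indicator_of_mem (hX i) _
    · rw [Set.indicator_of_notMem hX]
      obtain ⟨i, hi⟩ : ∃ i, X i ∉ cell L := by
        by_contra h
        exact hX fun i ↦ not_not.mp (not_exists.mp h i)
      rw [Finset.prod_eq_zero (Finset.mem_univ i) (Set.indicator_of_notMem hi _), mul_zero]
  intro s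
  induction s using Finset.induction_on with
  | empty =>
    intro F _ _
    simp only [Finset.prod_empty, mul_one, lmarginal_empty]
  | insert i s hi ih =>
    intro F hF hFper
    have hli : ∀ j, Measurable fun y : Space ↦ (cell L).indicator (fun y ↦ ∑' n : Fin 3 → ℤ, w j (y - latticeVec L n)) y := fun j ↦
      (Measurable.tsum fun n ↦ (hw j).comp (measurable_id.sub_const _)).indicator (measurableSet_cell L)
    have hmeas₁ : Measurable fun X : Config N ↦ F X * ∏ j ∈ insert i s, w j (X j) :=
      hF.mul (Finset.measurable_prod _ fun j _ ↦ (hw j).comp (measurable_pi_apply j))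
    have hmeas₂ : Measurable fun X : Config N ↦
        F X * ∏ j ∈ insert i s, (cell L).indicator (fun y ↦ ∑' n : Fin 3 → ℤ, w j (y - latticeVec L n)) (X j) :=
      hF.mul (Finset.measurable_prod _ fun j _ ↦ (hli j).comp (measurable_pi_apply j))
    -- integrate particle `i` first (innermost)
    rw [lmarginal_insert' _ hmeas₁ hi, lmarginal_insert' _ hmeas₂ hi]
    -- the new integrand after the `xᵢ`-integration
    set H : Config N → ℝ≥0∞ := fun X ↦
      ∫⁻ y, F (Function.update X i y) * (cell L).indicator (fun y ↦ ∑' n : Fin 3 → ℤ, w i (y - latticeVec L n)) y with hH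
    have hg : Measurable fun p : Config N × Space ↦
        F (Function.update p.1 i p.2) * (cell L).indicator (fun y ↦ ∑' n : Fin 3 → ℤ, w i (y - latticeVec L n)) p.2 :=
      (hF.comp measurable_update').mul ((hli i).comp measurable_snd)
    have hHm : Measurable H := hg.lintegral_prod_right'
    have hHper : ∀ (X : Config N) (j : Fin N) (n : Fin 3 → ℤ), j ∈ s →
        H (X - Pi.single j (latticeVec L n)) = H X := by
      intro X j n hj
      have hji : j ≠ i := fun h ↦ hi (h ▸ hj)
      simp only [hH, update_sub_single_of_ne X hji, hFper _ j n (Finset.mem_insert_of_mem hj)]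
    -- left inner integral
    have hL' : (fun X : Config N ↦ ∫⁻ y, F (Function.update X i y) *
        ∏ j ∈ insert i s, w j (Function.update X i y j)) = fun X ↦ H X * ∏ j ∈ s, w j (X j) := by
      funext X
      have hprod : ∀ y, ∏ j ∈ insert i s, w j (Function.update X i y j) = w i y * ∏ j ∈ s, w j (X j) := by
        intro y
        rw [Finset.prod_insert hi, Function.update_self]
        congr 1
        exact Finset.prod_congr rfl fun j hj ↦ by rw [Function.update_of_ne (ne_of_mem_of_not_mem hj hi)]
      simp only [hprod, ← mul_assoc]
      have hm : Measurable fun y : Space ↦ F (Function.update X i y) * w i y :=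
        (hF.comp (measurable_update X)).mul (hw i)
      rw [lintegral_mul_const _ hm]
      congr 1
      -- unfold particle `i`
      have hGper : ∀ (y : Space) (n : Fin 3 → ℤ),
          F (Function.update X i (y - latticeVec L n)) = F (Function.update X i y) := by
        intro y n
        rw [update_sub_single, hFper _ i n (Finset.mem_insert_self i s)]
      exact lintegral_mul_eq_lintegral_mul_indicator_latSum hL (hF.comp (measurable_update X)) (hw i) hGper
    -- right inner integral
    have hR' : (fun X : Config N ↦ ∫⁻ y, F (Function.update X i y) *
        ∏ j ∈ insert i s, (cell L).indicator (fun y ↦ ∑' n : Fin 3 → ℤ, w j (y - latticeVec L n)) (Function.update X i y j)) =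
        fun X ↦ H X * ∏ j ∈ s, (cell L).indicator (fun y ↦ ∑' n : Fin 3 → ℤ, w j (y - latticeVec L n)) (X j) := by
      funext X
      have hprod : ∀ y, ∏ j ∈ insert i s, (cell L).indicator (fun y ↦ ∑' n : Fin 3 → ℤ, w j (y - latticeVec L n)) (Function.update X i y j) =
          (cell L).indicator (fun y ↦ ∑' n : Fin 3 → ℤ, w i (y - latticeVec L n)) y * ∏ j ∈ s, (cell L).indicator (fun y ↦ ∑' n : Fin 3 → ℤ, w j (y - latticeVec L n)) (X j) := by
        intro y
        rw [Finset.prod_insert hi, Function.update_self]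
        congr 1
        exact Finset.prod_congr rfl fun j hj ↦ by rw [Function.update_of_ne (ne_of_mem_of_not_mem hj hi)]
      simp only [hprod, ← mul_assoc]
      have hm : Measurable fun y : Space ↦ F (Function.update X i y) *
          (cell L).indicator (fun y ↦ ∑' n : Fin 3 → ℤ, w i (y - latticeVec L n)) y :=
        (hF.comp (measurable_update X)).mul (hli i)
      rw [lintegral_mul_const _ hm]
    rw [hL', hR']
    exact ih H hHm hHper


/-! ### From periodicity on the generators to invariance under the particle lattices -/

/-- `e_k(a + b) = e_k(a) + e_k(b)` for the coordinate vectors of `ℝ³`. [folklore] -/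
theorem euclideanSpace_single_add (k : Fin 3) (a b : ℝ) :
    EuclideanSpace.single k (a + b) = EuclideanSpace.single k a + EuclideanSpace.single k b := by
  ext j
  by_cases h : j = k
  · subst h; simp
  · simp [h]

/-- Coordinates of the coordinate vectors of `ℝ³`: `e_i(a)_j = a δ_{ij}`. [folklore] -/
theorem euclideanSpace_single_apply (i j : Fin 3) (a : ℝ) :
    (EuclideanSpace.single i a : Space) j = if j = i then a else 0 := by
  by_cases h : j = i
  · subst h; simp
  · simp [h]

/-- A function periodic under `X ↦ X + L e_{i,k}` for all particles `i` and axes `k` is invariant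
under the translation of any single particle by any vector of `Lℤ³`. [folklore] -/
theorem apply_sub_single_latticeVec {N : ℕ} {α : Type*} {ψ : Config N → α}
    (hψ : ∀ (X : Config N) (i : Fin N) (k : Fin 3), ψ (X + Pi.single i (EuclideanSpace.single k L)) = ψ X)
    (X : Config N) (i : Fin N) (n : Fin 3 → ℤ) : ψ (X - Pi.single i (latticeVec L n)) = ψ X := by
  -- natural multiples along one axis
  have hnat : ∀ (X : Config N) (k : Fin 3) (m : ℕ),
      ψ (X + Pi.single i (EuclideanSpace.single k (L * m))) = ψ X := by
    intro X k m
    induction m generalizing X with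
    | zero =>
      have : EuclideanSpace.single k (L * ((0 : ℕ) : ℝ)) = (0 : Space) := by ext j; simp
      rw [this, Pi.single_zero, add_zero]
    | succ m ih =>
      have h1 : EuclideanSpace.single k (L * ((m + 1 : ℕ) : ℝ)) =
          EuclideanSpace.single k (L * m) + EuclideanSpace.single k L := by
        rw [← euclideanSpace_single_add]; congr 1; push_cast; ring
      rw [h1, Pi.single_add, ← add_assoc, hψ, ih]
  -- integer multiples along one axis
  have hint : ∀ (X : Config N) (k : Fin 3) (z : ℤ),
      ψ (X + Pi.single i (EuclideanSpace.single k (L * z))) = ψ X := by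
    intro X k z
    rcases Int.eq_nat_or_neg z with ⟨m, rfl | rfl⟩
    · exact_mod_cast hnat X k m
    · have h := hnat (X + Pi.single i (EuclideanSpace.single k (L * ((-(m : ℤ) : ℤ) : ℝ)))) k m
      rw [add_assoc, ← Pi.single_add, ← euclideanSpace_single_add] at h
      have h0 : L * ((-(m : ℤ) : ℤ) : ℝ) + L * m = 0 := by push_cast; ring
      rw [h0] at h
      have : EuclideanSpace.single k (0 : ℝ) = (0 : Space) := by ext j; simp
      rw [this, Pi.single_zero, add_zero] at h
      exact h.symm
  -- decompose the lattice vector along the three axes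
  have hdec : latticeVec L n = EuclideanSpace.single 0 (L * n 0) + EuclideanSpace.single 1 (L * n 1) +
      EuclideanSpace.single 2 (L * n 2) := by
    ext k
    fin_cases k <;> simp [latticeVec_apply]
  set Y := X - Pi.single i (latticeVec L n) with hY
  have hX : X = Y + Pi.single i (EuclideanSpace.single 0 (L * n 0)) +
      Pi.single i (EuclideanSpace.single 1 (L * n 1)) + Pi.single i (EuclideanSpace.single 2 (L * n 2)) := by
    rw [hY, add_assoc, add_assoc, ← Pi.single_add, ← Pi.single_add, ← add_assoc, ← hdec, sub_add_cancel]
  conv_rhs => rw [hX]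
  rw [hint, hint, hint]


/-! ### A smooth cut-off with the two-term partition of unity `q(t)² + q(t+L)² = 1` -/

/-- **A smooth cut-off adapted to the period `L` with ramps of width `2ℓ ≤ L`.** There is a universal
constant `c` such that for all `0 < ℓ`, `2ℓ ≤ L` there is a `C¹` function `q : ℝ → [0, 1]`,
vanishing off `(0, L + 2ℓ)`, whose squared `Lℤ`-translates form a partition of unity
(`∑_{m ∈ ℤ} q(t - Lm)² = 1`: on `[0, 2ℓ]` the two non-zero terms are `sin²θ + cos²θ`), with
`|q'| ≤ c/ℓ` and `q' = 0` off the ramps `[0, 2ℓ] ∪ [L, L + 2ℓ]`. Construction: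
`q(t) = sin(π/2 · S(t/2ℓ)) cos(π/2 · S((t-L)/2ℓ))` with Mathlib's `Real.smoothTransition` `S`
(a `C^∞` smoothing of the cosine cut-off `q_{L,ℓ}` of [BastiCenatiempoSchlein2021, App. A, before
Lemma A.1], which is only Lipschitz). [folklore] -/
theorem exists_smooth_cutoff : ∃ c : ℝ, 0 ≤ c ∧ ∀ (ℓ L : ℝ), 0 < ℓ → 2 * ℓ ≤ L →
    ∃ q : ℝ → ℝ, ContDiff ℝ 1 q ∧ (∀ t, 0 ≤ q t ∧ q t ≤ 1) ∧
      (∀ t, q t ≠ 0 → t ∈ Set.Ioo 0 (L + 2 * ℓ)) ∧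
      (∀ t, ∑' m : ℤ, ENNReal.ofReal (q (t - L * m) ^ 2) = 1) ∧
      (∀ t, |deriv q t| ≤ c / ℓ) ∧
      (∀ t, deriv q t ≠ 0 → t ∈ Set.Icc 0 (2 * ℓ) ∪ Set.Icc L (L + 2 * ℓ)) := by
  -- a global bound on `S'` (bounded on `[0,1]`, zero elsewhere)
  obtain ⟨C₀, hC₀, hC⟩ : ∃ C : ℝ, 0 ≤ C ∧ ∀ x, |deriv Real.smoothTransition x| ≤ C := by
    obtain ⟨C, hC0, hC⟩ := exists_bound_deriv_smoothTransition
    refine ⟨C, hC0, fun x ↦ ?_⟩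
    by_cases hx : x ∈ Set.Icc (0 : ℝ) 1
    · exact hC x hx
    · rw [Set.mem_Icc, not_and_or, not_le, not_le] at hx
      rcases hx with hx | hx
      · rw [deriv_smoothTransition_of_nonpos hx.le, abs_zero]; exact hC0
      · rw [deriv_smoothTransition_of_one_le hx.le, abs_zero]; exact hC0
  refine ⟨Real.pi * C₀ / 2, by positivity, fun ℓ L hℓ hℓL ↦ ?_⟩
  have hL : 0 < L := by linarith
  have h2ℓ : 0 < 2 * ℓ := by linarith
  -- the two phases
  set a : ℝ → ℝ := fun t ↦ Real.pi / 2 * Real.smoothTransition (t / (2 * ℓ)) with ha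
  set b : ℝ → ℝ := fun t ↦ Real.pi / 2 * Real.smoothTransition ((t - L) / (2 * ℓ)) with hb
  set q : ℝ → ℝ := fun t ↦ Real.sin (a t) * Real.cos (b t) with hq
  have hS := Real.smoothTransition.contDiff (n := 1)
  have ha_diff : ContDiff ℝ 1 a := contDiff_const.mul (hS.comp (contDiff_id.div_const _))
  have hb_diff : ContDiff ℝ 1 b := contDiff_const.mul (hS.comp ((contDiff_id.sub contDiff_const).div_const _))
  have hq_diff : ContDiff ℝ 1 q := (Real.contDiff_sin.comp ha_diff).mul (Real.contDiff_cos.comp hb_diff)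
  -- ranges of the phases
  have ha_mem : ∀ t, a t ∈ Set.Icc 0 (Real.pi / 2) := fun t ↦
    ⟨mul_nonneg (by positivity) (Real.smoothTransition.nonneg _),
      mul_le_of_le_one_right (by positivity) (Real.smoothTransition.le_one _)⟩
  have hb_mem : ∀ t, b t ∈ Set.Icc 0 (Real.pi / 2) := fun t ↦
    ⟨mul_nonneg (by positivity) (Real.smoothTransition.nonneg _),
      mul_le_of_le_one_right (by positivity) (Real.smoothTransition.le_one _)⟩
  have hsin_nn : ∀ t, 0 ≤ Real.sin (a t) := fun t ↦
    Real.sin_nonneg_of_nonneg_of_le_pi (ha_mem t).1 ((ha_mem t).2.trans (by linarith [Real.pi_pos]))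
  have hcos_nn : ∀ t, 0 ≤ Real.cos (b t) := fun t ↦
    Real.cos_nonneg_of_neg_pi_div_two_le_of_le (by linarith [(hb_mem t).1, Real.pi_pos]) (hb_mem t).2
  -- values of the phases in the various regions
  have ha_of_le : ∀ t, t ≤ 0 → a t = 0 := fun t ht ↦ by
    simp only [ha, Real.smoothTransition.zero_of_nonpos (div_nonpos_of_nonpos_of_nonneg ht h2ℓ.le), mul_zero]
  have ha_of_ge : ∀ t, 2 * ℓ ≤ t → a t = Real.pi / 2 := fun t ht ↦ by
    simp only [ha, Real.smoothTransition.one_of_one_le ((one_le_div h2ℓ).2 ht), mul_one]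
  have hb_of_le : ∀ t, t ≤ L → b t = 0 := fun t ht ↦ by
    have h : (t - L) / (2 * ℓ) ≤ 0 := div_nonpos_of_nonpos_of_nonneg (by linarith) h2ℓ.le
    simp only [hb, Real.smoothTransition.zero_of_nonpos h, mul_zero]
  have hb_of_ge : ∀ t, L + 2 * ℓ ≤ t → b t = Real.pi / 2 := fun t ht ↦ by
    have h : 1 ≤ (t - L) / (2 * ℓ) := (one_le_div h2ℓ).2 (by linarith)
    simp only [hb, Real.smoothTransition.one_of_one_le h, mul_one]
  -- `q` on the regions
  have hq_of_le : ∀ t, t ≤ 0 → q t = 0 := fun t ht ↦ by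
    simp only [hq, ha_of_le t ht, Real.sin_zero, zero_mul]
  have hq_of_ge : ∀ t, L + 2 * ℓ ≤ t → q t = 0 := fun t ht ↦ by
    simp only [hq, hb_of_ge t ht, Real.cos_pi_div_two, mul_zero]
  have hq_mid : ∀ t, 2 * ℓ ≤ t → t ≤ L → q t = 1 := fun t h1 h2 ↦ by
    simp only [hq, ha_of_ge t h1, hb_of_le t h2, Real.sin_pi_div_two, Real.cos_zero, mul_one]
  have hq_low : ∀ t, t ≤ L → q t = Real.sin (a t) := fun t ht ↦ by
    simp only [hq, hb_of_le t ht, Real.cos_zero, mul_one]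
  have hq_high : ∀ t, 2 * ℓ ≤ t → q t = Real.cos (b t) := fun t ht ↦ by
    simp only [hq, ha_of_ge t ht, Real.sin_pi_div_two, one_mul]
  -- the phase of the upper ramp is the phase of the lower ramp shifted by `L`
  have hb_shift : ∀ t, b (t + L) = a t := fun t ↦ by simp only [ha, hb, add_sub_cancel_right]
  refine ⟨q, hq_diff, fun t ↦ ⟨mul_nonneg (hsin_nn t) (hcos_nn t),
    mul_le_one₀ (Real.sin_le_one _) (hcos_nn t) (Real.cos_le_one _)⟩, ?_, ?_, ?_, ?_⟩
  · -- support
    intro t ht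
    refine ⟨lt_of_not_ge fun h ↦ ht (hq_of_le t h), lt_of_not_ge fun h ↦ ht (hq_of_ge t h)⟩
  · -- partition of unity
    intro t
    -- reduce to `t ∈ [0, L)`
    set m₀ : ℤ := ⌊t / L⌋ with hm₀
    set t₀ : ℝ := t - L * m₀ with ht₀
    have ht₀mem : t₀ ∈ Set.Ico 0 L := by
      constructor
      · have := Int.floor_le (t / L)
        rw [ht₀, sub_nonneg]
        calc L * (m₀ : ℝ) ≤ L * (t / L) := by gcongr
          _ = t := by field_simp
      · have := Int.lt_floor_add_one (t / L)
        rw [ht₀, sub_lt_iff_lt_add]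
        calc t = L * (t / L) := by field_simp
          _ < L * ((m₀ : ℝ) + 1) := by gcongr
          _ = L + L * m₀ := by ring
    have hreindex : ∑' m : ℤ, ENNReal.ofReal (q (t - L * m) ^ 2) =
        ∑' m : ℤ, ENNReal.ofReal (q (t₀ - L * m) ^ 2) := by
      rw [← (Equiv.addRight m₀).tsum_eq]
      refine tsum_congr fun m ↦ ?_
      simp only [Equiv.coe_addRight, ht₀, Int.cast_add]
      ring_nf
    rw [hreindex]
    -- only `m = 0` and `m = -1` contribute
    have hvanish : ∀ m : ℤ, m ∉ ({0, -1} : Finset ℤ) → ENNReal.ofReal (q (t₀ - L * m) ^ 2) = 0 := by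
      intro m hm
      rw [Finset.mem_insert, Finset.mem_singleton, not_or] at hm
      rcases lt_trichotomy m 0 with h | h | h
      · -- `m ≤ -2`
        have hm2 : (m : ℝ) ≤ -2 := by exact_mod_cast (show m ≤ -2 by omega)
        rw [hq_of_ge, zero_pow two_ne_zero, ENNReal.ofReal_zero]
        nlinarith [ht₀mem.1]
      · exact absurd h hm.1
      · have hm1 : (1 : ℝ) ≤ m := by exact_mod_cast h
        rw [hq_of_le, zero_pow two_ne_zero, ENNReal.ofReal_zero]
        nlinarith [ht₀mem.2]
    rw [tsum_eq_sum (s := ({0, -1} : Finset ℤ)) hvanish, Finset.sum_insert (by simp), Finset.sum_singleton]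
    simp only [Int.cast_zero, mul_zero, sub_zero, Int.cast_neg, Int.cast_one, mul_neg, mul_one, sub_neg_eq_add]
    rw [hq_low t₀ ht₀mem.2.le, hq_high (t₀ + L) (by linarith [ht₀mem.1]), hb_shift,
      ← ENNReal.ofReal_add (sq_nonneg _) (sq_nonneg _), Real.sin_sq_add_cos_sq, ENNReal.ofReal_one]
  · -- derivative bound
    intro t
    have hda : HasDerivAt a (Real.pi / 2 * (deriv Real.smoothTransition (t / (2 * ℓ)) * (1 / (2 * ℓ)))) t := by
      have h1 : HasDerivAt (fun t ↦ t / (2 * ℓ)) (1 / (2 * ℓ)) t := by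
        simpa using (hasDerivAt_id t).div_const (2 * ℓ)
      have h2 := ((Real.smoothTransition.contDiff (n := 1)).differentiable one_ne_zero (t / (2 * ℓ))).hasDerivAt.comp t h1
      exact h2.const_mul _
    have hdb : HasDerivAt b (Real.pi / 2 * (deriv Real.smoothTransition ((t - L) / (2 * ℓ)) * (1 / (2 * ℓ)))) t := by
      have h1 : HasDerivAt (fun t ↦ (t - L) / (2 * ℓ)) (1 / (2 * ℓ)) t := by
        simpa using ((hasDerivAt_id t).sub_const L).div_const (2 * ℓ)
      have h2 := ((Real.smoothTransition.contDiff (n := 1)).differentiable one_ne_zero ((t - L) / (2 * ℓ))).hasDerivAt.comp t h1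
      exact h2.const_mul _
    have hdq : HasDerivAt q (Real.cos (a t) * (Real.pi / 2 * (deriv Real.smoothTransition (t / (2 * ℓ)) * (1 / (2 * ℓ)))) *
        Real.cos (b t) + Real.sin (a t) * (-Real.sin (b t) *
          (Real.pi / 2 * (deriv Real.smoothTransition ((t - L) / (2 * ℓ)) * (1 / (2 * ℓ)))))) t :=
      (hda.sin).mul (hdb.cos)
    rw [hdq.deriv]
    have h1 : |Real.cos (a t)| ≤ 1 := Real.abs_cos_le_one _
    have h2 : |Real.cos (b t)| ≤ 1 := Real.abs_cos_le_one _
    have h3 : |Real.sin (a t)| ≤ 1 := Real.abs_sin_le_one _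
    have h4 : |Real.sin (b t)| ≤ 1 := Real.abs_sin_le_one _
    have h5 := hC (t / (2 * ℓ))
    have h6 := hC ((t - L) / (2 * ℓ))
    have hℓ2 : 0 < 1 / (2 * ℓ) := by positivity
    calc _ ≤ |Real.cos (a t) * (Real.pi / 2 * (deriv Real.smoothTransition (t / (2 * ℓ)) * (1 / (2 * ℓ)))) *
          Real.cos (b t)| + |Real.sin (a t) * (-Real.sin (b t) *
          (Real.pi / 2 * (deriv Real.smoothTransition ((t - L) / (2 * ℓ)) * (1 / (2 * ℓ)))))| := abs_add_le _ _
      _ ≤ 1 * (Real.pi / 2 * (C₀ * (1 / (2 * ℓ)))) * 1 + 1 * (1 * (Real.pi / 2 * (C₀ * (1 / (2 * ℓ))))) := by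
          gcongr
          · rw [abs_mul, abs_mul]
            gcongr
            rw [abs_mul, abs_of_pos (by positivity : (0 : ℝ) < Real.pi / 2), abs_mul, abs_of_pos hℓ2]
            gcongr
          · rw [abs_mul, abs_mul, abs_neg]
            gcongr
            rw [abs_mul, abs_of_pos (by positivity : (0 : ℝ) < Real.pi / 2), abs_mul, abs_of_pos hℓ2]
            gcongr
      _ = Real.pi * C₀ / 2 / ℓ := by field_simp; ring
  · -- the derivative vanishes off the ramps
    intro t ht
    by_contra hmem
    apply ht
    rw [Set.mem_union, Set.mem_Icc, Set.mem_Icc, not_or, not_and_or, not_and_or, not_le, not_le, not_le,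
      not_le] at hmem
    obtain ⟨h1 | h1, h2 | h2⟩ := hmem
    · -- `t < 0`
      have h : q =ᶠ[𝓝 t] fun _ ↦ (0 : ℝ) := by
        filter_upwards [Iio_mem_nhds h1] with s hs using hq_of_le s hs.le
      rw [h.deriv_eq, deriv_const]
    · -- `t < 0` (and `L + 2ℓ < t`): impossible but harmless
      have h : q =ᶠ[𝓝 t] fun _ ↦ (0 : ℝ) := by
        filter_upwards [Iio_mem_nhds h1] with s hs using hq_of_le s hs.le
      rw [h.deriv_eq, deriv_const]
    · -- `2ℓ < t < L`
      have h : q =ᶠ[𝓝 t] fun _ ↦ (1 : ℝ) := by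
        filter_upwards [Ioo_mem_nhds h1 h2] with s hs using hq_mid s hs.1.le hs.2.le
      rw [h.deriv_eq, deriv_const]
    · -- `L + 2ℓ < t`
      have h : q =ᶠ[𝓝 t] fun _ ↦ (0 : ℝ) := by
        filter_upwards [Ioi_mem_nhds h2] with s hs using hq_of_ge s hs.le
      rw [h.deriv_eq, deriv_const]


/-! ### The cut-off weights and their lattice sums -/

section Weights

variable {q : ℝ → ℝ} {ℓ : ℝ}

/-- **Partition of unity for the product weight.** If `∑_m q(t - Lm)² = 1` for all `t`, then the
`Lℤ³`-translates of `W(y) = ∏ₖ q(yₖ)²` sum to `1`. [folklore] -/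
theorem tsum_prodWeight_sub_latticeVec (hpu : ∀ t, ∑' m : ℤ, ENNReal.ofReal (q (t - L * m) ^ 2) = 1)
    (y : Space) :
    ∑' n : Fin 3 → ℤ, ∏ k : Fin 3, ENNReal.ofReal (q ((y - latticeVec L n) k) ^ 2) = 1 := by
  have h := tsum_pi_int_prod_three fun k m ↦ ENNReal.ofReal (q (y k - L * m) ^ 2)
  simp only [hpu, Finset.prod_const_one] at h
  rw [← h]
  refine tsum_congr fun n ↦ Finset.prod_congr rfl fun k _ ↦ ?_
  rw [PiLp.sub_apply, latticeVec_apply]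

/-- **Lattice sum of the ramp weight.** For the weight `R_k(y) = 1_A(y_k) ∏_{m ≠ k} q(y_m)²` (the
`k`-th factor replaced by an indicator), the `Lℤ³`-translates sum to the `Lℤ`-periodisation
`∑_m 1_A(y_k - Lm)` of the indicator. [folklore] -/
theorem tsum_rampWeight_sub_latticeVec (hpu : ∀ t, ∑' m : ℤ, ENNReal.ofReal (q (t - L * m) ^ 2) = 1)
    (A : Set ℝ) (k : Fin 3) (y : Space) :
    ∑' n : Fin 3 → ℤ, A.indicator (1 : ℝ → ℝ≥0∞) ((y - latticeVec L n) k) *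
        ∏ m ∈ Finset.univ.erase k, ENNReal.ofReal (q ((y - latticeVec L n) m) ^ 2) =
      ∑' j : ℤ, A.indicator (1 : ℝ → ℝ≥0∞) (y k - L * j) := by
  classical
  set f : Fin 3 → ℤ → ℝ≥0∞ := fun k' j ↦
    if k' = k then A.indicator (1 : ℝ → ℝ≥0∞) (y k - L * j) else ENNReal.ofReal (q (y k' - L * j) ^ 2) with hf
  have h := tsum_pi_int_prod_three f
  have hlhs : ∀ n : Fin 3 → ℤ, ∏ k', f k' (n k') = A.indicator (1 : ℝ → ℝ≥0∞) ((y - latticeVec L n) k) *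
      ∏ m ∈ Finset.univ.erase k, ENNReal.ofReal (q ((y - latticeVec L n) m) ^ 2) := by
    intro n
    rw [← Finset.mul_prod_erase _ _ (Finset.mem_univ k)]
    simp only [hf, if_pos rfl, PiLp.sub_apply, latticeVec_apply]
    congr 1
    exact Finset.prod_congr rfl fun m hm ↦ by rw [if_neg (Finset.ne_of_mem_erase hm)]
  have hrhs : ∏ k', ∑' j, f k' j = ∑' j : ℤ, A.indicator (1 : ℝ → ℝ≥0∞) (y k - L * j) := by
    rw [← Finset.mul_prod_erase _ _ (Finset.mem_univ k)]
    have h1 : ∑' j, f k j = ∑' j : ℤ, A.indicator (1 : ℝ → ℝ≥0∞) (y k - L * j) := by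
      simp only [hf, if_pos rfl]
    have h2 : ∀ m ∈ Finset.univ.erase k, ∑' j, f m j = 1 := fun m hm ↦ by
      simp only [hf, if_neg (Finset.ne_of_mem_erase hm), hpu]
    rw [h1, Finset.prod_congr rfl h2, Finset.prod_const_one, mul_one]
  simp only [hlhs, hrhs] at h
  exact h

/-- At most two integers `j` have `s - 2ℓ j ∈ [0, 2ℓ]`; so `∑_j 1_{[0,2ℓ]}(s - 2ℓj) ≤ 2`. [folklore] -/
theorem tsum_indicator_Icc_sub_le_two (hℓ : 0 < ℓ) (s : ℝ) :
    ∑' j : ℤ, (Set.Icc 0 (2 * ℓ)).indicator (1 : ℝ → ℝ≥0∞) (s - 2 * ℓ * j) ≤ 2 := by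
  classical
  have h2ℓ : 0 < 2 * ℓ := by linarith
  set x : ℝ := s / (2 * ℓ) with hx
  -- active `j` lie in `{⌈x⌉ - 1, ⌈x⌉}`
  have hvanish : ∀ j : ℤ, j ∉ ({⌈x⌉ - 1, ⌈x⌉} : Finset ℤ) →
      (Set.Icc 0 (2 * ℓ)).indicator (1 : ℝ → ℝ≥0∞) (s - 2 * ℓ * j) = 0 := by
    intro j hj
    rw [Finset.mem_insert, Finset.mem_singleton, not_or] at hj
    apply Set.indicator_of_notMem
    rw [Set.mem_Icc, not_and_or, not_le, not_le]
    have hs : s = 2 * ℓ * x := by rw [hx]; field_simp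
    rcases lt_or_gt_of_ne hj.2 with h | h
    · by_cases h' : j < ⌈x⌉ - 1
      · -- `j ≤ ⌈x⌉ - 2 < x - 1`
        right
        have h1 : (j : ℝ) + 1 < x := by
          have := Int.ceil_lt_add_one x  -- hmm
          have hj2 : (j : ℝ) ≤ ⌈x⌉ - 2 := by exact_mod_cast (show j ≤ ⌈x⌉ - 2 by omega)
          have := Int.ceil_lt_add_one x
          linarith [Int.le_ceil x, this]
        rw [hs]; nlinarith
      · exact absurd (show j = ⌈x⌉ - 1 by omega) hj.1
    · -- `j ≥ ⌈x⌉ + 1 > x`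
      left
      have h1 : x < j := by
        have hj2 : (⌈x⌉ : ℝ) + 1 ≤ j := by exact_mod_cast (show ⌈x⌉ + 1 ≤ j by omega)
        linarith [Int.le_ceil x]
      rw [hs]; nlinarith
  rw [tsum_eq_sum (s := ({⌈x⌉ - 1, ⌈x⌉} : Finset ℤ)) hvanish]
  calc ∑ j ∈ ({⌈x⌉ - 1, ⌈x⌉} : Finset ℤ), (Set.Icc 0 (2 * ℓ)).indicator (1 : ℝ → ℝ≥0∞) (s - 2 * ℓ * j)
      ≤ ∑ _j ∈ ({⌈x⌉ - 1, ⌈x⌉} : Finset ℤ), (1 : ℝ≥0∞) :=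
        Finset.sum_le_sum fun j _ ↦ Set.indicator_le_self' (fun _ _ ↦ zero_le_one) _
    _ ≤ 2 := by
        rw [Finset.sum_const, nsmul_eq_mul, mul_one]
        exact_mod_cast Finset.card_le_two

/-- **Counting the ramp overlaps of the discrete shifts.** With `L = 2ℓM`, for every `s`,
`∑_{a < M} ∑_{m ∈ ℤ} 1_{ramps}(s - 2ℓa - Lm) ≤ 4`, where `ramps = [0, 2ℓ] ∪ [L, L + 2ℓ]`: the shifts
`2ℓ(a + Mm)` exhaust `2ℓℤ` injectively, and each of the two windows contains at most two of them.
[folklore] -/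
theorem sum_tsum_indicator_ramps_le (hℓ : 0 < ℓ) {M : ℕ} (hM : 0 < M) (hL : L = 2 * ℓ * M) (s : ℝ) :
    ∑ a : Fin M, ∑' m : ℤ, (Set.Icc 0 (2 * ℓ) ∪ Set.Icc L (L + 2 * ℓ)).indicator (1 : ℝ → ℝ≥0∞)
      (s - 2 * ℓ * (a : ℕ) - L * m) ≤ 4 := by
  classical
  -- split the two windows
  have hsplit : ∀ t : ℝ, (Set.Icc 0 (2 * ℓ) ∪ Set.Icc L (L + 2 * ℓ)).indicator (1 : ℝ → ℝ≥0∞) t ≤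
      (Set.Icc 0 (2 * ℓ)).indicator (1 : ℝ → ℝ≥0∞) t + (Set.Icc 0 (2 * ℓ)).indicator (1 : ℝ → ℝ≥0∞) (t - L) := by
    intro t
    by_cases ht : t ∈ Set.Icc 0 (2 * ℓ) ∪ Set.Icc L (L + 2 * ℓ)
    · rw [Set.indicator_of_mem ht, Pi.one_apply]
      rcases ht with h | h
      · rw [Set.indicator_of_mem h, Pi.one_apply]; exact le_self_add
      · have h' : t - L ∈ Set.Icc 0 (2 * ℓ) := ⟨by linarith [h.1], by linarith [h.2]⟩
        rw [Set.indicator_of_mem h', Pi.one_apply]; exact le_add_self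
    · rw [Set.indicator_of_notMem ht]; exact bot_le
  -- the injection `(a, m) ↦ a + M m`
  set e : Fin M × ℤ → ℤ := fun p ↦ (p.1 : ℕ) + (M : ℤ) * p.2 with he
  have hinj : Function.Injective e := by
    rintro ⟨a, m⟩ ⟨a', m'⟩ h
    simp only [he] at h
    have hM0 : (M : ℤ) ≠ 0 := by exact_mod_cast hM.ne'
    have ha : ((a : ℕ) : ℤ) = (a' : ℕ) := by
      have h1 := congrArg (· % (M : ℤ)) h
      simp only [Int.add_mul_emod_self_left] at h1
      rwa [Int.emod_eq_of_lt (by positivity) (by exact_mod_cast a.2),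
        Int.emod_eq_of_lt (by positivity) (by exact_mod_cast a'.2)] at h1
    have hm : m = m' := by
      rw [ha] at h
      exact mul_left_cancel₀ hM0 (by linarith)
    exact Prod.ext (Fin.ext (by exact_mod_cast ha)) hm
  have hkey : ∀ t : ℝ, ∑ a : Fin M, ∑' m : ℤ, (Set.Icc 0 (2 * ℓ)).indicator (1 : ℝ → ℝ≥0∞)
      (t - 2 * ℓ * (a : ℕ) - L * m) ≤ 2 := by
    intro t
    have h1 : ∑ a : Fin M, ∑' m : ℤ, (Set.Icc 0 (2 * ℓ)).indicator (1 : ℝ → ℝ≥0∞) (t - 2 * ℓ * (a : ℕ) - L * m) =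
        ∑' p : Fin M × ℤ, (Set.Icc 0 (2 * ℓ)).indicator (1 : ℝ → ℝ≥0∞) (t - 2 * ℓ * e p) := by
      rw [ENNReal.tsum_prod', tsum_fintype]
      refine Finset.sum_congr rfl fun a _ ↦ tsum_congr fun m ↦ ?_
      congr 1
      simp only [he, hL]; push_cast; ring
    rw [h1]
    exact (ENNReal.tsum_comp_le_tsum_of_injective hinj _).trans (tsum_indicator_Icc_sub_le_two hℓ t)
  calc _ ≤ ∑ a : Fin M, ∑' m : ℤ, ((Set.Icc 0 (2 * ℓ)).indicator (1 : ℝ → ℝ≥0∞) (s - 2 * ℓ * (a : ℕ) - L * m) +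
        (Set.Icc 0 (2 * ℓ)).indicator (1 : ℝ → ℝ≥0∞) (s - 2 * ℓ * (a : ℕ) - L * m - L)) :=
        Finset.sum_le_sum fun a _ ↦ ENNReal.tsum_le_tsum fun m ↦ hsplit _
    _ = ∑ a : Fin M, ∑' m : ℤ, (Set.Icc 0 (2 * ℓ)).indicator (1 : ℝ → ℝ≥0∞) (s - 2 * ℓ * (a : ℕ) - L * m) +
        ∑ a : Fin M, ∑' m : ℤ, (Set.Icc 0 (2 * ℓ)).indicator (1 : ℝ → ℝ≥0∞) ((s - L) - 2 * ℓ * (a : ℕ) - L * m) := by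
        rw [← Finset.sum_add_distrib]
        refine Finset.sum_congr rfl fun a _ ↦ ?_
        rw [ENNReal.tsum_add]
        congr 1
        refine tsum_congr fun m ↦ ?_
        congr 1; ring
    _ ≤ 2 + 2 := add_le_add (hkey s) (hkey (s - L))
    _ = 4 := by norm_num

end Weights


/-! ### The product cut-off `Q(X) = ∏_{i,k} q(x_{ik})` and its partial derivatives -/

section ProductCutoff

variable {N : ℕ} {q : ℝ → ℝ}

/-- The coordinate functional `X ↦ x_{ik}` on `(ℝ³)^N`. [folklore] -/
theorem coordCLM_apply (p : Fin N × Fin 3) (X : Config N) :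
    ((EuclideanSpace.proj p.2).comp (ContinuousLinearMap.proj (R := ℝ) p.1) : Config N →L[ℝ] ℝ) X = X p.1 p.2 :=
  rfl

/-- The coordinate functional on the coordinate direction `δ_{i,k}`: `1` on `(i,k)`, `0` elsewhere.
[folklore] -/
theorem coordCLM_single (p : Fin N × Fin 3) (i : Fin N) (k : Fin 3) :
    ((EuclideanSpace.proj p.2).comp (ContinuousLinearMap.proj (R := ℝ) p.1) : Config N →L[ℝ] ℝ)
      (Pi.single i (EuclideanSpace.single k (1 : ℝ))) = if p = (i, k) then 1 else 0 := by
  rw [coordCLM_apply]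
  obtain ⟨j, m⟩ := p
  by_cases hj : j = i
  · subst hj
    by_cases hm : m = k
    · subst hm; simp
    · simp [hm]
  · simp [hj]

/-- **Partial derivatives of the product cut-off.** For `C¹` `q`,
`∂_{ik} ∏_{j,m} q(x_{jm}) = q'(x_{ik}) ∏_{(j,m) ≠ (i,k)} q(x_{jm})`. [folklore] -/
theorem fderiv_prodCutoff_single (hq : ContDiff ℝ 1 q) (X : Config N) (i : Fin N) (k : Fin 3) :
    fderiv ℝ (fun X : Config N ↦ ∏ p : Fin N × Fin 3, q (X p.1 p.2)) X
        (Pi.single i (EuclideanSpace.single k (1 : ℝ))) =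
      deriv q (X i k) * ∏ p ∈ Finset.univ.erase (i, k), q (X p.1 p.2) := by
  classical
  set e : Fin N × Fin 3 → (Config N →L[ℝ] ℝ) := fun p ↦
    ((EuclideanSpace.proj p.2).comp (ContinuousLinearMap.proj (R := ℝ) p.1) : Config N →L[ℝ] ℝ) with he
  have hfac : ∀ p : Fin N × Fin 3, HasFDerivAt (fun X : Config N ↦ q (X p.1 p.2))
      (deriv q (X p.1 p.2) • e p) X := by
    intro p
    exact ((hq.differentiable one_ne_zero) (X p.1 p.2)).hasDerivAt.comp_hasFDerivAt X (e p).hasFDerivAt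
  have hprod := HasFDerivAt.finsetProd (u := Finset.univ) fun p _ ↦ hfac p
  rw [hprod.fderiv]
  have hep : ∀ p : Fin N × Fin 3, e p (Pi.single i (EuclideanSpace.single k (1 : ℝ))) =
      if p = (i, k) then 1 else 0 := fun p ↦ coordCLM_single p i k
  simp only [FunLike.coe_sum, Finset.sum_apply, FunLike.coe_smul,
    Pi.smul_apply, hep, smul_eq_mul, mul_ite, mul_one, mul_zero, Finset.sum_ite_eq',
    Finset.mem_univ, if_true]
  ring

/-- Splitting the product over all `(j,m) ≠ (i,k)` into the other particles and the other axes of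
particle `i`. [folklore] -/
theorem prod_erase_pair_eq {β : Type*} [CommMonoid β] (f : Fin N × Fin 3 → β) (i : Fin N) (k : Fin 3) :
    ∏ p ∈ Finset.univ.erase (i, k), f p =
      (∏ m ∈ Finset.univ.erase k, f (i, m)) * ∏ j ∈ Finset.univ.erase i, ∏ m, f (j, m) := by
  classical
  have hset : (Finset.univ.erase (i, k) : Finset (Fin N × Fin 3)) =
      ({i} ×ˢ Finset.univ.erase k) ∪ (Finset.univ.erase i ×ˢ Finset.univ) := by
    ext ⟨j, m⟩
    simp only [Finset.mem_erase, ne_eq, Prod.mk.injEq, Finset.mem_univ, and_true, Finset.mem_union,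
      Finset.mem_product, Finset.mem_singleton]
    tauto
  have hdisj : Disjoint ({i} ×ˢ Finset.univ.erase k : Finset (Fin N × Fin 3)) (Finset.univ.erase i ×ˢ Finset.univ) := by
    rw [Finset.disjoint_left]
    rintro ⟨j, m⟩ h1 h2
    simp only [Finset.mem_product, Finset.mem_singleton, Finset.mem_erase, Finset.mem_univ] at h1 h2
    exact h2.1.1 h1.1
  rw [hset, Finset.prod_union hdisj, Finset.prod_product, Finset.prod_singleton, Finset.prod_product]

end ProductCutoff


/-! ### The cut-off state `Φ_u(X) = ψ(X + u) Q(X)` and its kinetic density -/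

section CutoffState

variable {N : ℕ} {q : ℝ → ℝ} {ψ : Config N → ℂ}

/-- `(‖v‖₊)² = ofReal (‖v‖²)` in `ℝ≥0∞`. [folklore] -/
theorem ennnorm_sq_eq_ofReal (v : ℂ) : ((‖v‖₊ : ℝ≥0∞)) ^ 2 = ENNReal.ofReal (‖v‖ ^ 2) := by
  rw [ENNReal.ofReal_pow (norm_nonneg _), ofReal_norm, enorm_eq_nnnorm]

/-- **Derivative of the cut-off state** along `δ_{ik}`:
`∂_{ik}(ψ(· + u) Q) = ψ(X + u) ∂_{ik}Q(X) + Q(X) ∂_{ik}ψ(X + u)`. [folklore] -/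
theorem fderiv_cutoffState_single (hq : ContDiff ℝ 1 q) (hψ : ContDiff ℝ 1 ψ) (U X : Config N)
    (i : Fin N) (k : Fin 3) :
    fderiv ℝ (fun X : Config N ↦ ψ (X + U) * ((∏ p : Fin N × Fin 3, q (X p.1 p.2) : ℝ) : ℂ)) X
        (Pi.single i (EuclideanSpace.single k (1 : ℝ))) =
      ψ (X + U) * ((deriv q (X i k) * ∏ p ∈ Finset.univ.erase (i, k), q (X p.1 p.2) : ℝ) : ℂ) +
        ((∏ p : Fin N × Fin 3, q (X p.1 p.2) : ℝ) : ℂ) * fderiv ℝ ψ (X + U) (Pi.single i (EuclideanSpace.single k (1 : ℝ))) := by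
  classical
  have hA : HasFDerivAt (fun X : Config N ↦ ψ (X + U)) (fderiv ℝ ψ (X + U)) X := by
    have h := ((hψ.differentiable one_ne_zero) (X + U)).hasFDerivAt.comp X ((hasFDerivAt_id X).add_const U)
    exact h.congr_fderiv (ContinuousLinearMap.comp_id _)
  set e : Fin N × Fin 3 → (Config N →L[ℝ] ℝ) := fun p ↦
    ((EuclideanSpace.proj p.2).comp (ContinuousLinearMap.proj (R := ℝ) p.1) : Config N →L[ℝ] ℝ) with he
  have hfac : ∀ p : Fin N × Fin 3, HasFDerivAt (fun X : Config N ↦ q (X p.1 p.2))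
      (deriv q (X p.1 p.2) • e p) X := fun p ↦
    ((hq.differentiable one_ne_zero) (X p.1 p.2)).hasDerivAt.comp_hasFDerivAt X (e p).hasFDerivAt
  have hQ := HasFDerivAt.finsetProd (u := Finset.univ) fun p _ ↦ hfac p
  have hQ' : HasFDerivAt (fun X : Config N ↦ ∏ p : Fin N × Fin 3, q (X p.1 p.2))
      (fderiv ℝ (fun X : Config N ↦ ∏ p : Fin N × Fin 3, q (X p.1 p.2)) X) X :=
    hQ.differentiableAt.hasFDerivAt
  have hB : HasFDerivAt (fun X : Config N ↦ ((∏ p : Fin N × Fin 3, q (X p.1 p.2) : ℝ) : ℂ))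
      (Complex.ofRealCLM.comp (fderiv ℝ (fun X : Config N ↦ ∏ p : Fin N × Fin 3, q (X p.1 p.2)) X)) X :=
    Complex.ofRealCLM.hasFDerivAt.comp X hQ'
  have hfd : fderiv ℝ (fun X : Config N ↦ ψ (X + U) * ((∏ p : Fin N × Fin 3, q (X p.1 p.2) : ℝ) : ℂ)) X =
      ψ (X + U) • Complex.ofRealCLM.comp (fderiv ℝ (fun X : Config N ↦ ∏ p : Fin N × Fin 3, q (X p.1 p.2)) X) +
        ((∏ p : Fin N × Fin 3, q (X p.1 p.2) : ℝ) : ℂ) • fderiv ℝ ψ (X + U) :=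
    (hA.mul hB).fderiv
  rw [hfd]
  simp only [add_apply, smul_apply, ContinuousLinearMap.coe_comp, Function.comp_apply,
    Complex.ofRealCLM_apply, smul_eq_mul, fderiv_prodCutoff_single hq X i k]

/-- **Pointwise kinetic bound for the cut-off state.** With `0 ≤ q ≤ 1`, `|q'| ≤ D` and `q' = 0` off a
set `A`, for every particle `i` and axis `k`:
`|∂_{ik}Φ_u|² ≤ Q² |∂_{ik}ψ(X+u)|² (1 + 1_A(x_{ik})) + 2 D² 1_A(x_{ik}) (∏_{(j,m)≠(i,k)} q(x_{jm}))² |ψ(X+u)|²`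
(if `q'(x_{ik}) = 0` the derivative is `Q ∂ψ`; otherwise `x_{ik} ∈ A` and `|a + b|² ≤ 2|a|² + 2|b|²`).
[folklore] -/
theorem ennnorm_fderiv_cutoffState_sq_le (hq : ContDiff ℝ 1 q) (hψ : ContDiff ℝ 1 ψ)
    (hq01 : ∀ t, 0 ≤ q t ∧ q t ≤ 1) {D : ℝ} (hD : ∀ t, |deriv q t| ≤ D) {A : Set ℝ}
    (hA : ∀ t, deriv q t ≠ 0 → t ∈ A) (U X : Config N) (i : Fin N) (k : Fin 3) :
    ((‖fderiv ℝ (fun X : Config N ↦ ψ (X + U) * ((∏ p : Fin N × Fin 3, q (X p.1 p.2) : ℝ) : ℂ)) X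
        (Pi.single i (EuclideanSpace.single k (1 : ℝ)))‖₊ : ℝ≥0∞)) ^ 2 ≤
      ENNReal.ofReal ((∏ p : Fin N × Fin 3, q (X p.1 p.2)) ^ 2) *
          ((‖fderiv ℝ ψ (X + U) (Pi.single i (EuclideanSpace.single k (1 : ℝ)))‖₊ : ℝ≥0∞)) ^ 2 *
          (1 + A.indicator (1 : ℝ → ℝ≥0∞) (X i k)) +
        2 * ENNReal.ofReal (D ^ 2) * A.indicator (1 : ℝ → ℝ≥0∞) (X i k) *
          ENNReal.ofReal ((∏ p ∈ Finset.univ.erase (i, k), q (X p.1 p.2)) ^ 2) *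
          ((‖ψ (X + U)‖₊ : ℝ≥0∞)) ^ 2 := by
  classical
  rw [fderiv_cutoffState_single hq hψ U X i k]
  set Qf : ℝ := ∏ p : Fin N × Fin 3, q (X p.1 p.2) with hQf
  set P : ℝ := ∏ p ∈ Finset.univ.erase (i, k), q (X p.1 p.2) with hP
  set dψ : ℂ := fderiv ℝ ψ (X + U) (Pi.single i (EuclideanSpace.single k (1 : ℝ))) with hdψ
  have hQf0 : 0 ≤ Qf := Finset.prod_nonneg fun p _ ↦ (hq01 _).1
  by_cases h0 : deriv q (X i k) = 0
  · -- the derivative is `Q ∂ψ`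
    rw [h0, zero_mul, Complex.ofReal_zero, mul_zero, zero_add, ennorm_real_mul_sq Qf hQf0]
    calc ENNReal.ofReal (Qf ^ 2) * ((‖dψ‖₊ : ℝ≥0∞)) ^ 2
        = ENNReal.ofReal (Qf ^ 2) * ((‖dψ‖₊ : ℝ≥0∞)) ^ 2 * 1 := (mul_one _).symm
      _ ≤ ENNReal.ofReal (Qf ^ 2) * ((‖dψ‖₊ : ℝ≥0∞)) ^ 2 * (1 + A.indicator (1 : ℝ → ℝ≥0∞) (X i k)) := by
          gcongr; exact le_self_add
      _ ≤ _ := le_self_add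
  · -- on the ramp
    have hmem : X i k ∈ A := hA _ h0
    rw [Set.indicator_of_mem hmem, Pi.one_apply]
    have hreal : ‖ψ (X + U) * ((deriv q (X i k) * P : ℝ) : ℂ) + (Qf : ℂ) * dψ‖ ^ 2 ≤
        2 * Qf ^ 2 * ‖dψ‖ ^ 2 + 2 * D ^ 2 * P ^ 2 * ‖ψ (X + U)‖ ^ 2 := by
      have h1 : ‖ψ (X + U) * ((deriv q (X i k) * P : ℝ) : ℂ) + (Qf : ℂ) * dψ‖ ≤
          ‖ψ (X + U)‖ * (|deriv q (X i k)| * |P|) + |Qf| * ‖dψ‖ := by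
        refine (norm_add_le _ _).trans (le_of_eq ?_)
        rw [norm_mul, norm_mul, Complex.norm_real, Complex.norm_real, Real.norm_eq_abs, Real.norm_eq_abs,
          abs_mul]
      have h2 : |deriv q (X i k)| * |P| ≤ D * |P| := mul_le_mul_of_nonneg_right (hD _) (abs_nonneg _)
      have h3 : ‖ψ (X + U) * ((deriv q (X i k) * P : ℝ) : ℂ) + (Qf : ℂ) * dψ‖ ≤
          ‖ψ (X + U)‖ * (D * |P|) + |Qf| * ‖dψ‖ := by
        refine h1.trans ?_; gcongr
      have h4 : 0 ≤ ‖ψ (X + U)‖ * (D * |P|) + |Qf| * ‖dψ‖ := by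
        have : 0 ≤ D := (abs_nonneg _).trans (hD 0)
        positivity
      calc _ ≤ (‖ψ (X + U)‖ * (D * |P|) + |Qf| * ‖dψ‖) ^ 2 := by
            exact pow_le_pow_left₀ (norm_nonneg _) h3 2
        _ ≤ 2 * (|Qf| * ‖dψ‖) ^ 2 + 2 * (‖ψ (X + U)‖ * (D * |P|)) ^ 2 := by
            nlinarith [sq_nonneg (‖ψ (X + U)‖ * (D * |P|) - |Qf| * ‖dψ‖)]
        _ = 2 * Qf ^ 2 * ‖dψ‖ ^ 2 + 2 * D ^ 2 * P ^ 2 * ‖ψ (X + U)‖ ^ 2 := by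
            rw [mul_pow, mul_pow, mul_pow, sq_abs, sq_abs]; ring
    rw [ennnorm_sq_eq_ofReal, ennnorm_sq_eq_ofReal dψ, ennnorm_sq_eq_ofReal (ψ (X + U))]
    refine (ENNReal.ofReal_le_ofReal hreal).trans (le_of_eq ?_)
    have hD0 : 0 ≤ D := (abs_nonneg _).trans (hD 0)
    rw [ENNReal.ofReal_add (by positivity) (by positivity), ENNReal.ofReal_mul (by positivity),
      ENNReal.ofReal_mul (by positivity), ENNReal.ofReal_mul (by positivity), ENNReal.ofReal_mul (by positivity),
      ENNReal.ofReal_mul (by positivity), ENNReal.ofReal_ofNat]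
    ring

end CutoffState


/-! ### Periodic objects: measurability and invariances -/

section PeriodicFacts

variable {N : ℕ} {v : ℝ → ℝ≥0∞}

/-- The periodised potential is measurable. [folklore] -/
theorem measurable_periodizedPotential (hv : Measurable v) (L : ℝ) : Measurable (periodizedPotential v L) := by
  unfold periodizedPotential
  exact Measurable.tsum fun n ↦ hv.comp (measurable_id.sub_const _).norm

/-- The periodic interaction is measurable. [folklore] -/
theorem measurable_periodicInteraction (hv : Measurable v) (L : ℝ) :
    Measurable (periodicInteraction (N := N) v L) := by
  unfold periodicInteraction
  refine Finset.measurable_sum _ fun i _ ↦ Finset.measurable_sum _ fun j _ ↦ ?_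
  exact (measurable_periodizedPotential hv L).comp ((measurable_config_apply i).sub (measurable_config_apply j))

/-- The periodised potential is invariant under the lattice `Lℤ³`. [folklore] -/
theorem periodizedPotential_sub_latticeVec (v : ℝ → ℝ≥0∞) (L : ℝ) (y : Space) (n : Fin 3 → ℤ) :
    periodizedPotential v L (y - latticeVec L n) = periodizedPotential v L y := by
  unfold periodizedPotential
  conv_rhs => rw [← (Equiv.addRight n).tsum_eq fun m ↦ v ‖y - latticeVec L m‖]
  refine tsum_congr fun m ↦ ?_
  simp only [Equiv.coe_addRight, latticeVec_add]
  congr 2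
  abel

/-- The periodised potential is invariant under the lattice `Lℤ³` (additive form). [folklore] -/
theorem periodizedPotential_add_latticeVec (v : ℝ → ℝ≥0∞) (L : ℝ) (y : Space) (n : Fin 3 → ℤ) :
    periodizedPotential v L (y + latticeVec L n) = periodizedPotential v L y := by
  rw [← periodizedPotential_sub_latticeVec v L (y + latticeVec L n) n, add_sub_cancel_right]

/-- The periodic interaction is invariant under translating one particle by a lattice vector.
[folklore] -/
theorem periodicInteraction_sub_single_latticeVec (v : ℝ → ℝ≥0∞) (L : ℝ) (X : Config N) (i : Fin N)
    (n : Fin 3 → ℤ) : periodicInteraction v L (X - Pi.single i (latticeVec L n)) = periodicInteraction v L X := by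
  unfold periodicInteraction
  refine Finset.sum_congr rfl fun a _ ↦ Finset.sum_congr rfl fun b hb ↦ ?_
  have hab : a ≠ b := (Finset.mem_filter.1 hb).2.ne
  simp only [Pi.sub_apply]
  by_cases ha : a = i
  · subst ha
    rw [Pi.single_eq_same, Pi.single_eq_of_ne hab.symm, sub_zero, sub_right_comm]
    exact periodizedPotential_sub_latticeVec v L _ n
  · rw [Pi.single_eq_of_ne ha, sub_zero]
    by_cases hb' : b = i
    · subst hb'
      rw [Pi.single_eq_same]
      have : X a - (X b - latticeVec L n) = X a - X b + latticeVec L n := by abel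
      rw [this]
      exact periodizedPotential_add_latticeVec v L _ n
    · rw [Pi.single_eq_of_ne hb', sub_zero]

/-- The periodic interaction is invariant under a common translation of all particles. [folklore] -/
theorem periodicInteraction_add_const (v : ℝ → ℝ≥0∞) (L : ℝ) (X : Config N) (u : Space) :
    periodicInteraction v L (X + fun _ ↦ u) = periodicInteraction v L X := by
  unfold periodicInteraction
  simp only [Pi.add_apply, add_sub_add_right_eq_sub]

/-- The derivative of a function invariant under a translation is invariant under it. [folklore] -/
theorem fderiv_add_eq_of_invariant {E : Type*} [NormedAddCommGroup E] [NormedSpace ℝ E] {f : E → ℂ} {a : E}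
    (hf : ∀ x, f (x + a) = f x) (x : E) : fderiv ℝ f (x + a) = fderiv ℝ f x := by
  rw [← fderiv_comp_add_right a]
  congr 1
  funext y
  exact hf y

/-- The kinetic density of a generator-periodic wave function is generator-periodic. [folklore] -/
theorem kineticDensity_add_single_of_periodic {ψ : Config N → ℂ} {L : ℝ}
    (hψ : ∀ (X : Config N) (i : Fin N) (k : Fin 3), ψ (X + Pi.single i (EuclideanSpace.single k L)) = ψ X)
    (X : Config N) (i : Fin N) (k : Fin 3) :
    kineticDensity ψ (X + Pi.single i (EuclideanSpace.single k L)) = kineticDensity ψ X := by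
  unfold kineticDensity
  rw [fderiv_add_eq_of_invariant (fun Y ↦ hψ Y i k)]

end PeriodicFacts

/-! ### The cut-off state of a periodic trial state: regularity, support, symmetry, norm -/

section CutoffStateBasic

variable {N : ℕ} {L ℓ : ℝ} {q : ℝ → ℝ}

/-- The cut-off state is `C¹`. [folklore] -/
theorem contDiff_cutoffState (hq : ContDiff ℝ 1 q) {ψ : Config N → ℂ} (hψ : ContDiff ℝ 1 ψ) (U : Config N) :
    ContDiff ℝ 1 (fun X : Config N ↦ ψ (X + U) * ((∏ p : Fin N × Fin 3, q (X p.1 p.2) : ℝ) : ℂ)) := by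
  refine (hψ.comp (contDiff_id.add contDiff_const)).mul (Complex.ofRealCLM.contDiff.comp ?_)
  exact contDiff_prod fun p _ ↦ hq.comp
    (((EuclideanSpace.proj p.2).comp (ContinuousLinearMap.proj (R := ℝ) p.1) : Config N →L[ℝ] ℝ).contDiff)

/-- Where the cut-off state does not vanish, every particle is in the box `Λ_{L+2ℓ}`. [folklore] -/
theorem mem_box_of_cutoffState_ne_zero (hsupp : ∀ t, q t ≠ 0 → t ∈ Set.Ioo 0 (L + 2 * ℓ))
    (ψ : Config N → ℂ) (U X : Config N)
    (hX : ψ (X + U) * ((∏ p : Fin N × Fin 3, q (X p.1 p.2) : ℝ) : ℂ) ≠ 0) (i : Fin N) :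
    X i ∈ box (L + 2 * ℓ) := by
  intro k
  have hprod : (∏ p : Fin N × Fin 3, q (X p.1 p.2)) ≠ 0 := by
    intro h; apply hX; rw [h]; simp
  exact hsupp _ (Finset.prod_ne_zero_iff.1 hprod (i, k) (Finset.mem_univ _))

/-- The cut-off state of a Bose-symmetric function is Bose-symmetric. [folklore] -/
theorem cutoffState_comp_perm {ψ : Config N → ℂ} (hψ : ∀ (σ : Equiv.Perm (Fin N)) (X : Config N), ψ (X ∘ σ) = ψ X)
    (u : Space) (π : Equiv.Perm (Fin N)) (X : Config N) :
    ψ ((X ∘ π) + fun _ ↦ u) * ((∏ p : Fin N × Fin 3, q ((X ∘ π) p.1 p.2) : ℝ) : ℂ) =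
      ψ (X + fun _ ↦ u) * ((∏ p : Fin N × Fin 3, q (X p.1 p.2) : ℝ) : ℂ) := by
  have h1 : ((X ∘ π) + fun _ ↦ u) = (X + fun _ ↦ u) ∘ π := rfl
  have hprod : (∏ p : Fin N × Fin 3, q ((X ∘ π) p.1 p.2)) = ∏ p : Fin N × Fin 3, q (X p.1 p.2) :=
    Fintype.prod_equiv (π.prodCongr (Equiv.refl (Fin 3))) _ _ fun p ↦ by simp
  rw [h1, hψ, hprod]

/-- **The squared modulus of the cut-off state**: `|Φ_u(X)|² = |ψ(X + u)|² ∏ᵢ W(xᵢ)` with the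
per-particle weight `W(y) = ∏ₖ q(yₖ)²`. [folklore] -/
theorem ennnorm_cutoffState_sq (hq0 : ∀ t, 0 ≤ q t) (ψ : Config N → ℂ) (U X : Config N) :
    ((‖ψ (X + U) * ((∏ p : Fin N × Fin 3, q (X p.1 p.2) : ℝ) : ℂ)‖₊ : ℝ≥0∞)) ^ 2 =
      ((‖ψ (X + U)‖₊ : ℝ≥0∞)) ^ 2 * ∏ i : Fin N, ∏ k : Fin 3, ENNReal.ofReal (q (X i k) ^ 2) := by
  rw [mul_comm (ψ (X + U)), ennorm_real_mul_sq _ (Finset.prod_nonneg fun p _ ↦ hq0 _), mul_comm]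
  congr 1
  rw [← Finset.prod_pow, ENNReal.ofReal_prod_of_nonneg fun p _ ↦ sq_nonneg _]
  exact Fintype.prod_prod_type fun p ↦ ENNReal.ofReal (q (X p.1 p.2) ^ 2)

/-- **The cut-off state is normalised**: `∫ |Φ_u|² = ∫_{cell} |ψ|² = 1` (unfolding with the partition
of unity `∑_n W(· - Ln) = 1`, then shifting the cell). [folklore] -/
theorem lintegral_ennnorm_cutoffState_sq (hL : 0 < L) (hqc : Continuous q) (hq0 : ∀ t, 0 ≤ q t)
    (hpu : ∀ t, ∑' m : ℤ, ENNReal.ofReal (q (t - L * m) ^ 2) = 1)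
    (Ψ : PeriodicTrialState N L) (u : Space) :
    ∫⁻ X, ((‖Ψ.ψ (X + fun _ ↦ u) * ((∏ p : Fin N × Fin 3, q (X p.1 p.2) : ℝ) : ℂ)‖₊ : ℝ≥0∞)) ^ 2 = 1 := by
  simp only [ennnorm_cutoffState_sq hq0]
  have hF : Measurable fun X : Config N ↦ ((‖Ψ.ψ (X + fun _ ↦ u)‖₊ : ℝ≥0∞)) ^ 2 :=
    measurable_normSq (Ψ.contDiff.continuous.comp (continuous_id.add continuous_const))
  have hper : ∀ (X : Config N) (i : Fin N) (n : Fin 3 → ℤ),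
      ((‖Ψ.ψ (X - Pi.single i (latticeVec L n) + fun _ ↦ u)‖₊ : ℝ≥0∞)) ^ 2 =
        ((‖Ψ.ψ (X + fun _ ↦ u)‖₊ : ℝ≥0∞)) ^ 2 := by
    intro X i n
    rw [sub_add_eq_add_sub, apply_sub_single_latticeVec Ψ.periodic]
  have hw : Measurable fun y : Space ↦ ∏ k : Fin 3, ENNReal.ofReal (q (y k) ^ 2) :=
    Finset.measurable_prod _ fun k _ ↦ ENNReal.measurable_ofReal.comp
      ((hqc.measurable.comp (by fun_prop : Measurable fun y : Space ↦ y k)).pow_const 2)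
  rw [lintegral_mul_prod_eq_setLIntegral_cellN hL hF hper (w := fun _ ↦ fun y : Space ↦
    ∏ k : Fin 3, ENNReal.ofReal (q (y k) ^ 2)) fun _ ↦ hw]
  simp only [tsum_prodWeight_sub_latticeVec hpu, Finset.prod_const_one, mul_one]
  rw [lintegral_cellN_comp_add hL (G := fun X ↦ ((‖Ψ.ψ X‖₊ : ℝ≥0∞)) ^ 2) (fun X i k ↦ by rw [Ψ.periodic])]
  exact Ψ.norm_eq

end CutoffStateBasic


/-! ### Unfolding integrals of the cut-off state against the main and the ramp weights -/

section CutoffIntegrals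

variable {N : ℕ} {L : ℝ} {q : ℝ → ℝ}

/-- The `Lℤ`-periodisation of an indicator is `L`-periodic. [folklore] -/
theorem tsum_indicator_add_period (A : Set ℝ) (L t : ℝ) :
    ∑' j : ℤ, A.indicator (1 : ℝ → ℝ≥0∞) (t + L - L * j) = ∑' j : ℤ, A.indicator (1 : ℝ → ℝ≥0∞) (t - L * j) := by
  rw [← (Equiv.addRight (1 : ℤ)).tsum_eq]
  refine tsum_congr fun j ↦ ?_
  simp only [Equiv.coe_addRight, Int.cast_add, Int.cast_one]
  congr 1; ring

/-- **Unfolding against the main weight.** For a generator-periodic measurable `G ≥ 0` and the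
partition-of-unity weight `W(y) = ∏ₖ q(yₖ)²`: `∫ G(X + u) ∏ᵢ W(xᵢ) dX = ∫_{cell} G`. [folklore] -/
theorem lintegral_comp_add_mul_prodWeight (hL : 0 < L) (hqc : Continuous q)
    (hpu : ∀ t, ∑' m : ℤ, ENNReal.ofReal (q (t - L * m) ^ 2) = 1) {G : Config N → ℝ≥0∞} (hG : Measurable G)
    (hGper : ∀ (X : Config N) (i : Fin N) (k : Fin 3), G (X + Pi.single i (EuclideanSpace.single k L)) = G X)
    (U : Config N) :
    ∫⁻ X, G (X + U) * ∏ i : Fin N, ∏ k : Fin 3, ENNReal.ofReal (q (X i k) ^ 2) = ∫⁻ X in cellN N L, G X := by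
  have hF : Measurable fun X : Config N ↦ G (X + U) := hG.comp (measurable_id.add_const U)
  have hper : ∀ (X : Config N) (i : Fin N) (n : Fin 3 → ℤ), G (X - Pi.single i (latticeVec L n) + U) = G (X + U) := by
    intro X i n
    rw [sub_add_eq_add_sub, apply_sub_single_latticeVec hGper]
  have hw : Measurable fun y : Space ↦ ∏ k : Fin 3, ENNReal.ofReal (q (y k) ^ 2) :=
    Finset.measurable_prod _ fun k _ ↦ ENNReal.measurable_ofReal.comp
      ((hqc.measurable.comp (by fun_prop : Measurable fun y : Space ↦ y k)).pow_const 2)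
  rw [lintegral_mul_prod_eq_setLIntegral_cellN hL hF hper (w := fun _ ↦ fun y : Space ↦
    ∏ k : Fin 3, ENNReal.ofReal (q (y k) ^ 2)) fun _ ↦ hw]
  simp only [tsum_prodWeight_sub_latticeVec hpu, Finset.prod_const_one, mul_one]
  exact lintegral_cellN_comp_add hL hGper U

/-- **Unfolding against the ramp weight in particle `i`, axis `k`.** With the `k`-th factor of the
`i`-th particle's weight replaced by `1_A`, `∫ G(X + u) ∏ⱼ w'ⱼ(xⱼ) dX = ∫_{cell} G(X) ρ_A(x_{ik} - u_k) dX`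
where `ρ_A = ∑_j 1_A(· - Lj)`. [folklore] -/
theorem lintegral_comp_add_mul_rampWeight (hL : 0 < L) (hqc : Continuous q)
    (hpu : ∀ t, ∑' m : ℤ, ENNReal.ofReal (q (t - L * m) ^ 2) = 1) {A : Set ℝ} (hAm : MeasurableSet A)
    {G : Config N → ℝ≥0∞} (hG : Measurable G)
    (hGper : ∀ (X : Config N) (i : Fin N) (k : Fin 3), G (X + Pi.single i (EuclideanSpace.single k L)) = G X)
    (u : Space) (i : Fin N) (k : Fin 3) :
    ∫⁻ X, G (X + fun _ ↦ u) *
        ∏ j : Fin N, (Function.update (fun _ : Fin N ↦ fun y : Space ↦ ∏ m : Fin 3, ENNReal.ofReal (q (y m) ^ 2)) i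
          (fun y : Space ↦ A.indicator (1 : ℝ → ℝ≥0∞) (y k) *
            ∏ m ∈ Finset.univ.erase k, ENNReal.ofReal (q (y m) ^ 2)) j) (X j) =
      ∫⁻ X in cellN N L, G X * ∑' n : ℤ, A.indicator (1 : ℝ → ℝ≥0∞) (X i k - u k - L * n) := by
  classical
  set W : Space → ℝ≥0∞ := fun y ↦ ∏ m : Fin 3, ENNReal.ofReal (q (y m) ^ 2) with hW
  set Rk : Space → ℝ≥0∞ := fun y ↦ A.indicator (1 : ℝ → ℝ≥0∞) (y k) *
    ∏ m ∈ Finset.univ.erase k, ENNReal.ofReal (q (y m) ^ 2) with hRk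
  have hF : Measurable fun X : Config N ↦ G (X + fun _ ↦ u) := hG.comp (measurable_id.add_const _)
  have hper : ∀ (X : Config N) (i : Fin N) (n : Fin 3 → ℤ),
      G (X - Pi.single i (latticeVec L n) + fun _ ↦ u) = G (X + fun _ ↦ u) := by
    intro X i n
    rw [sub_add_eq_add_sub, apply_sub_single_latticeVec hGper]
  have hqm : ∀ m : Fin 3, Measurable fun y : Space ↦ ENNReal.ofReal (q (y m) ^ 2) := fun m ↦
    ENNReal.measurable_ofReal.comp ((hqc.measurable.comp (by fun_prop : Measurable fun y : Space ↦ y m)).pow_const 2)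
  have hWm : Measurable W := Finset.measurable_prod _ fun m _ ↦ hqm m
  have hRkm : Measurable Rk :=
    ((measurable_one.indicator hAm).comp (by fun_prop : Measurable fun y : Space ↦ y k)).mul
      (Finset.measurable_prod _ fun m _ ↦ hqm m)
  have hw : ∀ j, Measurable (Function.update (fun _ : Fin N ↦ W) i Rk j) := by
    intro j
    by_cases hj : j = i
    · subst hj; rw [Function.update_self]; exact hRkm
    · rw [Function.update_of_ne hj]; exact hWm
  rw [lintegral_mul_prod_eq_setLIntegral_cellN hL hF hper hw]
  -- evaluate the lattice sums of the weights
  have hlat : ∀ X : Config N, ∏ j, ∑' n : Fin 3 → ℤ, Function.update (fun _ : Fin N ↦ W) i Rk j (X j - latticeVec L n) =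
      ∑' n : ℤ, A.indicator (1 : ℝ → ℝ≥0∞) (X i k - L * n) := by
    intro X
    rw [← Finset.mul_prod_erase _ _ (Finset.mem_univ i), Function.update_self]
    have h1 : ∀ j ∈ Finset.univ.erase i, ∑' n : Fin 3 → ℤ, Function.update (fun _ : Fin N ↦ W) i Rk j (X j - latticeVec L n) = 1 := by
      intro j hj
      rw [Function.update_of_ne (Finset.ne_of_mem_erase hj)]
      exact tsum_prodWeight_sub_latticeVec hpu (X j)
    rw [Finset.prod_congr rfl h1, Finset.prod_const_one, mul_one]
    exact tsum_rampWeight_sub_latticeVec hpu A k (X i)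
  simp only [hlat]
  -- shift the cell by `u`
  have hHper : ∀ (Y : Config N) (i' : Fin N) (k' : Fin 3),
      G (Y + Pi.single i' (EuclideanSpace.single k' L)) *
          ∑' n : ℤ, A.indicator (1 : ℝ → ℝ≥0∞) ((Y + Pi.single i' (EuclideanSpace.single k' L) : Config N) i k - u k - L * n) =
        G Y * ∑' n : ℤ, A.indicator (1 : ℝ → ℝ≥0∞) (Y i k - u k - L * n) := by
    intro Y i' k'
    rw [hGper]
    congr 1
    rw [Pi.add_apply]
    by_cases hi' : i = i'
    · subst hi'
      rw [Pi.single_eq_same, PiLp.add_apply]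
      by_cases hk' : k = k'
      · subst hk'
        rw [euclideanSpace_single_apply, if_pos rfl, show Y i k + L - u k = (Y i k - u k) + L by ring]
        exact tsum_indicator_add_period A L _
      · rw [euclideanSpace_single_apply, if_neg hk', add_zero]
    · rw [Pi.single_eq_of_ne hi', add_zero]
  have h := lintegral_cellN_comp_add hL
    (G := fun Y : Config N ↦ G Y * ∑' n : ℤ, A.indicator (1 : ℝ → ℝ≥0∞) (Y i k - u k - L * n)) hHper (fun _ ↦ u)
  simp only [Pi.add_apply, PiLp.add_apply, add_sub_cancel_right] at h
  exact h

end CutoffIntegrals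


/-! ### The energy of the cut-off state for a fixed shift -/

section CutoffEnergy

variable {N : ℕ} {L : ℝ} {q : ℝ → ℝ} {v : ℝ → ℝ≥0∞}

/-- The periodic interaction is generator-periodic. [folklore] -/
theorem periodicInteraction_add_single (v : ℝ → ℝ≥0∞) (L : ℝ) (X : Config N) (i : Fin N) (k : Fin 3) :
    periodicInteraction v L (X + Pi.single i (EuclideanSpace.single k L)) = periodicInteraction v L X := by
  have h := periodicInteraction_sub_single_latticeVec v L (X + Pi.single i (EuclideanSpace.single k L)) i (Pi.single k 1)
  rw [latticeVec_single, add_sub_cancel_right] at h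
  exact h.symm

/-- **Pointwise bookkeeping of the kinetic bound.** In terms of the per-particle weights
`W(y) = ∏ₘ q(yₘ)²` and `R_k(y) = 1_A(y_k) ∏_{m ≠ k} q(y_m)²` (with `0 ≤ q ≤ 1`): the two terms of
`ennnorm_fderiv_cutoffState_sq_le` are bounded by
`G₁ ∏ⱼ W(xⱼ) + (G₁ + G₂) · R_k(xᵢ) ∏_{j ≠ i} W(xⱼ)`. [folklore] -/
theorem kineticBound_terms_le (hq01 : ∀ t, 0 ≤ q t ∧ q t ≤ 1) (A : Set ℝ) (X : Config N) (i : Fin N) (k : Fin 3)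
    (G₁ G₂ D2 : ℝ≥0∞) :
    ENNReal.ofReal ((∏ p : Fin N × Fin 3, q (X p.1 p.2)) ^ 2) * G₁ * (1 + A.indicator (1 : ℝ → ℝ≥0∞) (X i k)) +
        D2 * A.indicator (1 : ℝ → ℝ≥0∞) (X i k) *
          ENNReal.ofReal ((∏ p ∈ Finset.univ.erase (i, k), q (X p.1 p.2)) ^ 2) * G₂ ≤
      G₁ * ∏ j : Fin N, ∏ m : Fin 3, ENNReal.ofReal (q (X j m) ^ 2) +
        (G₁ + D2 * G₂) * ∏ j : Fin N, (Function.update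
          (fun _ : Fin N ↦ fun y : Space ↦ ∏ m : Fin 3, ENNReal.ofReal (q (y m) ^ 2)) i
          (fun y : Space ↦ A.indicator (1 : ℝ → ℝ≥0∞) (y k) *
            ∏ m ∈ Finset.univ.erase k, ENNReal.ofReal (q (y m) ^ 2)) j) (X j) := by
  classical
  -- the products in `ℝ≥0∞`
  have hQ : ENNReal.ofReal ((∏ p : Fin N × Fin 3, q (X p.1 p.2)) ^ 2) =
      ∏ j : Fin N, ∏ m : Fin 3, ENNReal.ofReal (q (X j m) ^ 2) := by
    rw [← Finset.prod_pow, ENNReal.ofReal_prod_of_nonneg fun p _ ↦ sq_nonneg _]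
    exact Fintype.prod_prod_type fun p ↦ ENNReal.ofReal (q (X p.1 p.2) ^ 2)
  have hP : ENNReal.ofReal ((∏ p ∈ Finset.univ.erase (i, k), q (X p.1 p.2)) ^ 2) =
      (∏ m ∈ Finset.univ.erase k, ENNReal.ofReal (q (X i m) ^ 2)) *
        ∏ j ∈ Finset.univ.erase i, ∏ m : Fin 3, ENNReal.ofReal (q (X j m) ^ 2) := by
    rw [← Finset.prod_pow, ENNReal.ofReal_prod_of_nonneg fun p _ ↦ sq_nonneg _]
    exact prod_erase_pair_eq (fun p ↦ ENNReal.ofReal (q (X p.1 p.2) ^ 2)) i k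
  have hw' : ∏ j : Fin N, (Function.update
      (fun _ : Fin N ↦ fun y : Space ↦ ∏ m : Fin 3, ENNReal.ofReal (q (y m) ^ 2)) i
      (fun y : Space ↦ A.indicator (1 : ℝ → ℝ≥0∞) (y k) *
        ∏ m ∈ Finset.univ.erase k, ENNReal.ofReal (q (y m) ^ 2)) j) (X j) =
      (A.indicator (1 : ℝ → ℝ≥0∞) (X i k) * ∏ m ∈ Finset.univ.erase k, ENNReal.ofReal (q (X i m) ^ 2)) *
        ∏ j ∈ Finset.univ.erase i, ∏ m : Fin 3, ENNReal.ofReal (q (X j m) ^ 2) := by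
    rw [← Finset.mul_prod_erase _ _ (Finset.mem_univ i), Function.update_self]
    congr 1
    exact Finset.prod_congr rfl fun j hj ↦ by rw [Function.update_of_ne (Finset.ne_of_mem_erase hj)]
  have hWi : ∏ m : Fin 3, ENNReal.ofReal (q (X i m) ^ 2) ≤ ∏ m ∈ Finset.univ.erase k, ENNReal.ofReal (q (X i m) ^ 2) := by
    rw [← Finset.mul_prod_erase _ _ (Finset.mem_univ k)]
    refine mul_le_of_le_one_left' ?_
    rw [ENNReal.ofReal_le_one]
    have h := hq01 (X i k)
    nlinarith [h.1, h.2]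
  have hsplit : ∏ j : Fin N, ∏ m : Fin 3, ENNReal.ofReal (q (X j m) ^ 2) =
      (∏ m : Fin 3, ENNReal.ofReal (q (X i m) ^ 2)) * ∏ j ∈ Finset.univ.erase i, ∏ m : Fin 3, ENNReal.ofReal (q (X j m) ^ 2) :=
    (Finset.mul_prod_erase _ _ (Finset.mem_univ i)).symm
  rw [hQ, hP, hw']
  set Wi := ∏ m : Fin 3, ENNReal.ofReal (q (X i m) ^ 2)
  set Wi' := ∏ m ∈ Finset.univ.erase k, ENNReal.ofReal (q (X i m) ^ 2)
  set rest := ∏ j ∈ Finset.univ.erase i, ∏ m : Fin 3, ENNReal.ofReal (q (X j m) ^ 2)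
  set ind := A.indicator (1 : ℝ → ℝ≥0∞) (X i k)
  rw [hsplit]
  have key : ind * (Wi * rest) ≤ ind * Wi' * rest := by
    rw [mul_assoc]; gcongr
  calc Wi * rest * G₁ * (1 + ind) + D2 * ind * (Wi' * rest) * G₂
      = G₁ * (Wi * rest) + G₁ * (ind * (Wi * rest)) + D2 * G₂ * (ind * Wi' * rest) := by ring
    _ ≤ G₁ * (Wi * rest) + G₁ * (ind * Wi' * rest) + D2 * G₂ * (ind * Wi' * rest) := by gcongr
    _ = G₁ * (Wi * rest) + (G₁ + D2 * G₂) * (ind * Wi' * rest) := by ring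

/-- **Kinetic energy of the cut-off state (fixed shift).**
`∫ |∇Φ_u|² ≤ ∫_{cell} |∇ψ|² + ∑_{i,k} ∫_{cell} (|∂_{ik}ψ|² + 2D²|ψ|²)(X) ρ_A(x_{ik} - u_k) dX`. [folklore] -/
theorem lintegral_kineticDensity_cutoffState_le (hL : 0 < L) (hq : ContDiff ℝ 1 q)
    (hq01 : ∀ t, 0 ≤ q t ∧ q t ≤ 1) (hpu : ∀ t, ∑' m : ℤ, ENNReal.ofReal (q (t - L * m) ^ 2) = 1)
    {D : ℝ} (hD : ∀ t, |deriv q t| ≤ D) {A : Set ℝ} (hAm : MeasurableSet A) (hA : ∀ t, deriv q t ≠ 0 → t ∈ A)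
    (Ψ : PeriodicTrialState N L) (u : Space) :
    ∫⁻ X, kineticDensity (fun X : Config N ↦ Ψ.ψ (X + fun _ ↦ u) * ((∏ p : Fin N × Fin 3, q (X p.1 p.2) : ℝ) : ℂ)) X ≤
      (∫⁻ X in cellN N L, kineticDensity Ψ.ψ X) +
        ∑ i : Fin N, ∑ k : Fin 3, ∫⁻ X in cellN N L,
          (((‖fderiv ℝ Ψ.ψ X (Pi.single i (EuclideanSpace.single k (1 : ℝ)))‖₊ : ℝ≥0∞)) ^ 2 +
              2 * ENNReal.ofReal (D ^ 2) * ((‖Ψ.ψ X‖₊ : ℝ≥0∞)) ^ 2) *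
            ∑' n : ℤ, A.indicator (1 : ℝ → ℝ≥0∞) (X i k - u k - L * n) := by
  classical
  set U : Config N := fun _ ↦ u with hU
  -- abbreviations for the periodic integrands
  set G₁ : Fin N → Fin 3 → Config N → ℝ≥0∞ := fun i k X ↦
    ((‖fderiv ℝ Ψ.ψ X (Pi.single i (EuclideanSpace.single k (1 : ℝ)))‖₊ : ℝ≥0∞)) ^ 2 with hG₁
  set G₂ : Config N → ℝ≥0∞ := fun X ↦ ((‖Ψ.ψ X‖₊ : ℝ≥0∞)) ^ 2 with hG₂
  have hG₁m : ∀ i k, Measurable (G₁ i k) := fun i k ↦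
    ((Ψ.contDiff.continuous_fderiv one_ne_zero).clm_apply continuous_const).measurable.nnnorm.coe_nnreal_ennreal.pow_const _
  have hG₂m : Measurable G₂ := measurable_normSq Ψ.contDiff.continuous
  have hG₁per : ∀ i k (X : Config N) (i' : Fin N) (k' : Fin 3),
      G₁ i k (X + Pi.single i' (EuclideanSpace.single k' L)) = G₁ i k X := by
    intro i k X i' k'
    simp only [hG₁, fderiv_add_eq_of_invariant (fun Y ↦ Ψ.periodic Y i' k')]
  have hG₂per : ∀ (X : Config N) (i' : Fin N) (k' : Fin 3),
      G₂ (X + Pi.single i' (EuclideanSpace.single k' L)) = G₂ X := by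
    intro X i' k'
    simp only [hG₂, Ψ.periodic]
  -- pointwise bound
  have hpt : ∀ X : Config N,
      kineticDensity (fun X : Config N ↦ Ψ.ψ (X + U) * ((∏ p : Fin N × Fin 3, q (X p.1 p.2) : ℝ) : ℂ)) X ≤
        ∑ i : Fin N, ∑ k : Fin 3, (G₁ i k (X + U) * ∏ j : Fin N, ∏ m : Fin 3, ENNReal.ofReal (q (X j m) ^ 2) +
          (G₁ i k (X + U) + 2 * ENNReal.ofReal (D ^ 2) * G₂ (X + U)) * ∏ j : Fin N, (Function.update
            (fun _ : Fin N ↦ fun y : Space ↦ ∏ m : Fin 3, ENNReal.ofReal (q (y m) ^ 2)) i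
            (fun y : Space ↦ A.indicator (1 : ℝ → ℝ≥0∞) (y k) *
              ∏ m ∈ Finset.univ.erase k, ENNReal.ofReal (q (y m) ^ 2)) j) (X j)) := by
    intro X
    unfold kineticDensity
    refine Finset.sum_le_sum fun i _ ↦ Finset.sum_le_sum fun k _ ↦ ?_
    refine (ennnorm_fderiv_cutoffState_sq_le hq Ψ.contDiff hq01 hD hA U X i k).trans ?_
    have h := kineticBound_terms_le hq01 A X i k (G₁ i k (X + U)) (G₂ (X + U)) (2 * ENNReal.ofReal (D ^ 2))
    simp only [hG₁, hG₂] at h ⊢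
    convert h using 2
  refine (lintegral_mono hpt).trans (le_of_eq ?_)
  -- integrate term by term
  have hWm : Measurable fun y : Space ↦ ∏ m : Fin 3, ENNReal.ofReal (q (y m) ^ 2) :=
    Finset.measurable_prod _ fun m _ ↦ ENNReal.measurable_ofReal.comp
      ((hq.continuous.measurable.comp (by fun_prop : Measurable fun y : Space ↦ y m)).pow_const 2)
  have hRm : ∀ k : Fin 3, Measurable fun y : Space ↦ A.indicator (1 : ℝ → ℝ≥0∞) (y k) *
      ∏ m ∈ Finset.univ.erase k, ENNReal.ofReal (q (y m) ^ 2) := fun k ↦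
    ((measurable_one.indicator hAm).comp (by fun_prop : Measurable fun y : Space ↦ y k)).mul
      (Finset.measurable_prod _ fun m _ ↦ ENNReal.measurable_ofReal.comp
        ((hq.continuous.measurable.comp (by fun_prop : Measurable fun y : Space ↦ y m)).pow_const 2))
  have hwm : ∀ (i : Fin N) (k : Fin 3) (j : Fin N), Measurable (Function.update
      (fun _ : Fin N ↦ fun y : Space ↦ ∏ m : Fin 3, ENNReal.ofReal (q (y m) ^ 2)) i
      (fun y : Space ↦ A.indicator (1 : ℝ → ℝ≥0∞) (y k) *
        ∏ m ∈ Finset.univ.erase k, ENNReal.ofReal (q (y m) ^ 2)) j) := by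
    intro i k j
    by_cases hj : j = i
    · subst hj; rw [Function.update_self]; exact hRm k
    · rw [Function.update_of_ne hj]; exact hWm
  have hmeasA : ∀ i k, Measurable fun X : Config N ↦ G₁ i k (X + U) * ∏ j : Fin N, ∏ m : Fin 3, ENNReal.ofReal (q (X j m) ^ 2) :=
    fun i k ↦ ((hG₁m i k).comp (measurable_id.add_const U)).mul
      (Finset.measurable_prod _ fun j _ ↦ hWm.comp (measurable_config_apply j))
  have hmeasB : ∀ i k, Measurable fun X : Config N ↦ (G₁ i k (X + U) + 2 * ENNReal.ofReal (D ^ 2) * G₂ (X + U)) *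
      ∏ j : Fin N, (Function.update (fun _ : Fin N ↦ fun y : Space ↦ ∏ m : Fin 3, ENNReal.ofReal (q (y m) ^ 2)) i
        (fun y : Space ↦ A.indicator (1 : ℝ → ℝ≥0∞) (y k) *
          ∏ m ∈ Finset.univ.erase k, ENNReal.ofReal (q (y m) ^ 2)) j) (X j) :=
    fun i k ↦ (((hG₁m i k).comp (measurable_id.add_const U)).add
      ((hG₂m.comp (measurable_id.add_const U)).const_mul _)).mul
        (Finset.measurable_prod _ fun j _ ↦ (hwm i k j).comp (measurable_config_apply j))
  have hmeasAB : ∀ i k, Measurable fun X : Config N ↦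
      G₁ i k (X + U) * ∏ j : Fin N, ∏ m : Fin 3, ENNReal.ofReal (q (X j m) ^ 2) +
        (G₁ i k (X + U) + 2 * ENNReal.ofReal (D ^ 2) * G₂ (X + U)) *
          ∏ j : Fin N, (Function.update (fun _ : Fin N ↦ fun y : Space ↦ ∏ m : Fin 3, ENNReal.ofReal (q (y m) ^ 2)) i
            (fun y : Space ↦ A.indicator (1 : ℝ → ℝ≥0∞) (y k) *
              ∏ m ∈ Finset.univ.erase k, ENNReal.ofReal (q (y m) ^ 2)) j) (X j) :=
    fun i k ↦ (hmeasA i k).add (hmeasB i k)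
  have hmeasS : ∀ i, Measurable fun X : Config N ↦ ∑ k : Fin 3,
      (G₁ i k (X + U) * ∏ j : Fin N, ∏ m : Fin 3, ENNReal.ofReal (q (X j m) ^ 2) +
        (G₁ i k (X + U) + 2 * ENNReal.ofReal (D ^ 2) * G₂ (X + U)) *
          ∏ j : Fin N, (Function.update (fun _ : Fin N ↦ fun y : Space ↦ ∏ m : Fin 3, ENNReal.ofReal (q (y m) ^ 2)) i
            (fun y : Space ↦ A.indicator (1 : ℝ → ℝ≥0∞) (y k) *
              ∏ m ∈ Finset.univ.erase k, ENNReal.ofReal (q (y m) ^ 2)) j) (X j)) :=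
    fun i ↦ Finset.measurable_sum _ fun k _ ↦ hmeasAB i k
  -- unfold each term
  have hA' : ∀ i k, ∫⁻ X, G₁ i k (X + U) * ∏ j : Fin N, ∏ m : Fin 3, ENNReal.ofReal (q (X j m) ^ 2) =
      ∫⁻ X in cellN N L, G₁ i k X := fun i k ↦
    lintegral_comp_add_mul_prodWeight hL hq.continuous hpu (hG₁m i k) (hG₁per i k) U
  have hB' : ∀ i k, ∫⁻ X, (G₁ i k (X + U) + 2 * ENNReal.ofReal (D ^ 2) * G₂ (X + U)) *
      ∏ j : Fin N, (Function.update (fun _ : Fin N ↦ fun y : Space ↦ ∏ m : Fin 3, ENNReal.ofReal (q (y m) ^ 2)) i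
        (fun y : Space ↦ A.indicator (1 : ℝ → ℝ≥0∞) (y k) *
          ∏ m ∈ Finset.univ.erase k, ENNReal.ofReal (q (y m) ^ 2)) j) (X j) =
      ∫⁻ X in cellN N L, (G₁ i k X + 2 * ENNReal.ofReal (D ^ 2) * G₂ X) *
        ∑' n : ℤ, A.indicator (1 : ℝ → ℝ≥0∞) (X i k - u k - L * n) := by
    intro i k
    exact lintegral_comp_add_mul_rampWeight hL hq.continuous hpu hAm
      (G := fun X ↦ G₁ i k X + 2 * ENNReal.ofReal (D ^ 2) * G₂ X)
      ((hG₁m i k).add (hG₂m.const_mul _)) (fun X i' k' ↦ by rw [hG₁per, hG₂per]) u i k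
  have hkin : ∑ i : Fin N, ∑ k : Fin 3, ∫⁻ X in cellN N L, G₁ i k X = ∫⁻ X in cellN N L, kineticDensity Ψ.ψ X := by
    have h1 : ∀ i : Fin N, ∑ k : Fin 3, ∫⁻ X in cellN N L, G₁ i k X = ∫⁻ X in cellN N L, ∑ k : Fin 3, G₁ i k X :=
      fun i ↦ (lintegral_finsetSum _ fun k _ ↦ hG₁m i k).symm
    simp only [h1]
    rw [← lintegral_finsetSum _ fun i _ ↦ Finset.measurable_sum _ fun k _ ↦ hG₁m i k]
    simp only [hG₁, kineticDensity]
  calc ∫⁻ X, ∑ i : Fin N, ∑ k : Fin 3,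
        (G₁ i k (X + U) * ∏ j : Fin N, ∏ m : Fin 3, ENNReal.ofReal (q (X j m) ^ 2) +
          (G₁ i k (X + U) + 2 * ENNReal.ofReal (D ^ 2) * G₂ (X + U)) *
            ∏ j : Fin N, (Function.update (fun _ : Fin N ↦ fun y : Space ↦ ∏ m : Fin 3, ENNReal.ofReal (q (y m) ^ 2)) i
              (fun y : Space ↦ A.indicator (1 : ℝ → ℝ≥0∞) (y k) *
                ∏ m ∈ Finset.univ.erase k, ENNReal.ofReal (q (y m) ^ 2)) j) (X j))
      = ∑ i : Fin N, ∑ k : Fin 3, ((∫⁻ X in cellN N L, G₁ i k X) +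
          ∫⁻ X in cellN N L, (G₁ i k X + 2 * ENNReal.ofReal (D ^ 2) * G₂ X) *
            ∑' n : ℤ, A.indicator (1 : ℝ → ℝ≥0∞) (X i k - u k - L * n)) := by
        rw [lintegral_finsetSum _ fun i _ ↦ hmeasS i]
        refine Finset.sum_congr rfl fun i _ ↦ ?_
        rw [lintegral_finsetSum _ fun k _ ↦ hmeasAB i k]
        refine Finset.sum_congr rfl fun k _ ↦ ?_
        rw [lintegral_add_left (hmeasA i k), hA', hB']
    _ = (∫⁻ X in cellN N L, kineticDensity Ψ.ψ X) +
        ∑ i : Fin N, ∑ k : Fin 3, ∫⁻ X in cellN N L,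
          (((‖fderiv ℝ Ψ.ψ X (Pi.single i (EuclideanSpace.single k (1 : ℝ)))‖₊ : ℝ≥0∞)) ^ 2 +
              2 * ENNReal.ofReal (D ^ 2) * ((‖Ψ.ψ X‖₊ : ℝ≥0∞)) ^ 2) *
            ∑' n : ℤ, A.indicator (1 : ℝ → ℝ≥0∞) (X i k - u k - L * n) := by
        simp only [Finset.sum_add_distrib]
        rw [hkin]

end CutoffEnergy


/-! ### Interaction of the cut-off state; the energy for a fixed shift -/

section CutoffEnergy2

variable {N : ℕ} {L : ℝ} {q : ℝ → ℝ} {v : ℝ → ℝ≥0∞}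

/-- **Interaction energy of the cut-off state (fixed shift)**: bounded by the periodic interaction
energy, `∫ (∑_{i<j} v)|Φ_u|² ≤ ∫_{cell} (∑_{i<j} v^per)|ψ|²` (`v ≤ v^per`, unfolding, shift of the cell).
[folklore] -/
theorem lintegral_interaction_cutoffState_le (hL : 0 < L) (hvm : Measurable v) (hqc : Continuous q)
    (hq0 : ∀ t, 0 ≤ q t) (hpu : ∀ t, ∑' m : ℤ, ENNReal.ofReal (q (t - L * m) ^ 2) = 1)
    (Ψ : PeriodicTrialState N L) (u : Space) :
    ∫⁻ X, interaction v X *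
        ((‖Ψ.ψ (X + fun _ ↦ u) * ((∏ p : Fin N × Fin 3, q (X p.1 p.2) : ℝ) : ℂ)‖₊ : ℝ≥0∞)) ^ 2 ≤
      ∫⁻ X in cellN N L, periodicInteraction v L X * ((‖Ψ.ψ X‖₊ : ℝ≥0∞)) ^ 2 := by
  set U : Config N := fun _ ↦ u with hU
  have hpt : ∀ X : Config N, interaction v X *
      ((‖Ψ.ψ (X + U) * ((∏ p : Fin N × Fin 3, q (X p.1 p.2) : ℝ) : ℂ)‖₊ : ℝ≥0∞)) ^ 2 ≤
      (periodicInteraction v L (X + U) * ((‖Ψ.ψ (X + U)‖₊ : ℝ≥0∞)) ^ 2) *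
        ∏ i : Fin N, ∏ k : Fin 3, ENNReal.ofReal (q (X i k) ^ 2) := by
    intro X
    rw [ennnorm_cutoffState_sq hq0, ← mul_assoc, hU, periodicInteraction_add_const]
    gcongr
    exact interaction_le_periodicInteraction v L X
  refine (lintegral_mono hpt).trans (le_of_eq ?_)
  have hG : Measurable fun X : Config N ↦ periodicInteraction v L X * ((‖Ψ.ψ X‖₊ : ℝ≥0∞)) ^ 2 :=
    (measurable_periodicInteraction hvm L).mul (measurable_normSq Ψ.contDiff.continuous)
  have hGper : ∀ (X : Config N) (i : Fin N) (k : Fin 3),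
      periodicInteraction v L (X + Pi.single i (EuclideanSpace.single k L)) *
          ((‖Ψ.ψ (X + Pi.single i (EuclideanSpace.single k L))‖₊ : ℝ≥0∞)) ^ 2 =
        periodicInteraction v L X * ((‖Ψ.ψ X‖₊ : ℝ≥0∞)) ^ 2 := by
    intro X i k
    rw [periodicInteraction_add_single, Ψ.periodic]
  exact lintegral_comp_add_mul_prodWeight hL hqc hpu hG hGper U

/-- **Energy of the cut-off state for a fixed shift `u`.**
`𝓔^D[Φ_u] ≤ 𝓔^per[Ψ] + ∑_{i,k} ∫_{cell} (|∂_{ik}ψ|² + 2D²|ψ|²)(X) ρ_A(x_{ik} - u_k) dX`. [folklore] -/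
theorem energyIntegral_cutoffState_le (hL : 0 < L) (hvm : Measurable v) (hq : ContDiff ℝ 1 q)
    (hq01 : ∀ t, 0 ≤ q t ∧ q t ≤ 1) (hpu : ∀ t, ∑' m : ℤ, ENNReal.ofReal (q (t - L * m) ^ 2) = 1)
    {D : ℝ} (hD : ∀ t, |deriv q t| ≤ D) {A : Set ℝ} (hAm : MeasurableSet A) (hA : ∀ t, deriv q t ≠ 0 → t ∈ A)
    (Ψ : PeriodicTrialState N L) (u : Space) :
    ∫⁻ X, kineticDensity (fun X : Config N ↦ Ψ.ψ (X + fun _ ↦ u) * ((∏ p : Fin N × Fin 3, q (X p.1 p.2) : ℝ) : ℂ)) X +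
        interaction v X * ((‖Ψ.ψ (X + fun _ ↦ u) * ((∏ p : Fin N × Fin 3, q (X p.1 p.2) : ℝ) : ℂ)‖₊ : ℝ≥0∞)) ^ 2 ≤
      periodicEnergy v Ψ +
        ∑ i : Fin N, ∑ k : Fin 3, ∫⁻ X in cellN N L,
          (((‖fderiv ℝ Ψ.ψ X (Pi.single i (EuclideanSpace.single k (1 : ℝ)))‖₊ : ℝ≥0∞)) ^ 2 +
              2 * ENNReal.ofReal (D ^ 2) * ((‖Ψ.ψ X‖₊ : ℝ≥0∞)) ^ 2) *
            ∑' n : ℤ, A.indicator (1 : ℝ → ℝ≥0∞) (X i k - u k - L * n) := by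
  have hΦ := contDiff_cutoffState hq Ψ.contDiff (fun _ ↦ u)
  rw [lintegral_add_left (measurable_kineticDensity hΦ), periodicEnergy,
    lintegral_add_left (measurable_kineticDensity Ψ.contDiff), add_right_comm]
  exact add_le_add (lintegral_kineticDensity_cutoffState_le hL hq hq01 hpu hD hAm hA Ψ u)
    (lintegral_interaction_cutoffState_le hL hvm hq.continuous (fun t ↦ (hq01 t).1) hpu Ψ u)

end CutoffEnergy2

/-! ### Averaging over the discrete shifts `u ∈ (2ℓ · {0,…,M-1})³` -/

section Averaging

variable {N : ℕ} {L ℓ : ℝ}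

/-- Summing a function of one coordinate over `{0,…,M-1}³` counts each value `M²` times. [folklore] -/
theorem sum_pi_apply_eq {M : ℕ} {β : Type*} [AddCommMonoid β] (k : Fin 3) (g : Fin M → β) :
    ∑ a : Fin 3 → Fin M, g (a k) = (M ^ 2) • ∑ b : Fin M, g b := by
  classical
  rw [Fintype.sum_equiv (Equiv.piSplitAt k fun _ ↦ Fin M) (fun a ↦ g (a k))
    (fun p ↦ g p.1) fun a ↦ rfl, Fintype.sum_prod_type, Finset.smul_sum]
  refine Finset.sum_congr rfl fun b _ ↦ ?_
  simp only [Finset.sum_const, Finset.card_univ, Fintype.card_fun, Fintype.card_fin,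
    Fintype.card_subtype_compl, Fintype.card_subtype_eq, Nat.reduceSub]

/-- **The ramp count, summed over the discrete shifts**, is at most `4M²` (uniformly in the point):
with `L = 2ℓM`, `∑_{a ∈ {0..M-1}³} ρ_{ramps}(t - 2ℓ a_k) ≤ 4M²`. [folklore] -/
theorem sum_tsum_indicator_ramps_shift_le (hℓ : 0 < ℓ) {M : ℕ} (hM : 0 < M) (hL : L = 2 * ℓ * M) (k : Fin 3)
    (t : ℝ) :
    ∑ a : Fin 3 → Fin M, ∑' n : ℤ, (Set.Icc 0 (2 * ℓ) ∪ Set.Icc L (L + 2 * ℓ)).indicator (1 : ℝ → ℝ≥0∞)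
        (t - 2 * ℓ * ((a k : ℕ) : ℝ) - L * n) ≤ 4 * (M : ℝ≥0∞) ^ 2 := by
  rw [sum_pi_apply_eq k fun b : Fin M ↦ ∑' n : ℤ, (Set.Icc 0 (2 * ℓ) ∪ Set.Icc L (L + 2 * ℓ)).indicator
    (1 : ℝ → ℝ≥0∞) (t - 2 * ℓ * ((b : ℕ) : ℝ) - L * n), nsmul_eq_mul]
  calc ((M ^ 2 : ℕ) : ℝ≥0∞) * _ ≤ ((M ^ 2 : ℕ) : ℝ≥0∞) * 4 := by
        gcongr; exact sum_tsum_indicator_ramps_le hℓ hM hL t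
    _ = 4 * (M : ℝ≥0∞) ^ 2 := by push_cast; ring

end Averaging


/-! ### Lemma A.1 (smooth cut-off form): from the torus to a slightly larger Dirichlet box -/

section Localization

/-- **Localisation of periodic states into a Dirichlet box (Lemma A.1 of [BastiCenatiempoSchlein2021,
App. A], smooth cut-off / Cauchy–Schwarz form).** There is a universal constant `C` such that for
all `N`, all `ℓ > 0`, `M ≥ 1` and all measurable `v ≥ 0`, with `L = 2ℓM`,
`E₀^D(N, L + 2ℓ) ≤ (1 + 4/M) E₀^per(N, L) + C N/(M ℓ²)`.
Proof: for a periodic trial state `Ψ` and a shift `u`, the Dirichlet function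
`Φ_u(X) = ψ(X + u) ∏_{i,k} q(x_{ik})` (with the cut-off `q` of `exists_smooth_cutoff`) is normalised
and lives in `Λ_{L+2ℓ}^N`; its energy is `𝓔^per[Ψ]` plus ramp terms
(`energyIntegral_cutoffState_le`), whose sum over the `M³` shifts `u ∈ (2ℓ{0,…,M-1})³` is at most
`4M²(T + 6ND²)`, `D = c/ℓ` (`sum_tsum_indicator_ramps_shift_le`); the best shift gives the claim
(the paper averages over all `u ∈ Λ_L` and integrates the cross term by parts instead, obtaining
`⟨Ψ, 𝓗Ψ⟩ + (C/(Lℓ))⟨Ψ, 𝒩Ψ⟩` without the factor `1 + 4/M` — (A.1)–(A.5)).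
[cite: BastiCenatiempoSchlein2021, App. A, Lemma A.1 with (A.1)–(A.5)] -/
theorem exists_dirichlet_le_periodic : ∃ C : ℝ, 0 ≤ C ∧ ∀ (N : ℕ) (ℓ : ℝ) (M : ℕ) (v : ℝ → ℝ≥0∞),
    0 < ℓ → 0 < M → Measurable v →
    groundStateEnergy v N (2 * ℓ * M + 2 * ℓ) ≤
      (1 + 4 / (M : ℝ≥0∞)) * periodicGroundStateEnergy v N (2 * ℓ * M) +
        ENNReal.ofReal (C * N / (M * ℓ ^ 2)) := by
  classical
  obtain ⟨c, hc0, hcut⟩ := exists_smooth_cutoff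
  refine ⟨24 * c ^ 2, by positivity, fun N ℓ M v hℓ hM hvm ↦ ?_⟩
  set L : ℝ := 2 * ℓ * M with hLdef
  have hM1 : (1 : ℝ) ≤ M := by exact_mod_cast hM
  have hℓL : 2 * ℓ ≤ L := by rw [hLdef]; nlinarith
  have hL : 0 < L := by linarith
  obtain ⟨q, hq, hq01, hsupp, hpu, hD, hA⟩ := hcut ℓ L hℓ hℓL
  set A : Set ℝ := Set.Icc 0 (2 * ℓ) ∪ Set.Icc L (L + 2 * ℓ) with hAdef
  have hAm : MeasurableSet A := measurableSet_Icc.union measurableSet_Icc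
  set D : ℝ := c / ℓ with hDdef
  -- constants in `ℝ≥0∞`
  have hM0 : (M : ℝ≥0∞) ≠ 0 := Nat.cast_ne_zero.2 hM.ne'
  have hMtop : (M : ℝ≥0∞) ≠ ⊤ := ENNReal.natCast_ne_top M
  set K : ℝ≥0∞ := ENNReal.ofReal (24 * c ^ 2 * N / (M * ℓ ^ 2)) with hKdef
  have hK : 24 * (N : ℝ≥0∞) * ENNReal.ofReal (D ^ 2) * (M : ℝ≥0∞)⁻¹ = K := by
    rw [hKdef, hDdef, ← ENNReal.ofReal_natCast N, ← ENNReal.ofReal_natCast M,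
      ← ENNReal.ofReal_inv_of_pos (by exact_mod_cast hM : (0 : ℝ) < M), ← ENNReal.ofReal_ofNat 24,
      ← ENNReal.ofReal_mul (by norm_num), ← ENNReal.ofReal_mul (by positivity), ← ENNReal.ofReal_mul (by positivity)]
    congr 1
    field_simp
  -- the bound for every periodic trial state
  suffices key : ∀ Ψ : PeriodicTrialState N L,
      groundStateEnergy v N (L + 2 * ℓ) ≤ (1 + 4 / (M : ℝ≥0∞)) * periodicEnergy v Ψ + K by
    have h14 : (1 + 4 / (M : ℝ≥0∞)) ≠ 0 := by simp
    have h14' : (1 + 4 / (M : ℝ≥0∞)) ≠ ⊤ := by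
      rw [ENNReal.add_ne_top]; exact ⟨ENNReal.one_ne_top, ENNReal.div_ne_top (by simp) hM0⟩
    show groundStateEnergy v N (L + 2 * ℓ) ≤ (1 + 4 / (M : ℝ≥0∞)) * periodicGroundStateEnergy v N L + K
    rw [periodicGroundStateEnergy, ENNReal.mul_iInf_of_ne h14 h14', ENNReal.iInf_add]
    exact le_iInf key
  intro Ψ
  -- the shifts and their error terms
  set u : (Fin 3 → Fin M) → Space := fun a ↦ latticeVec (2 * ℓ) fun m ↦ ((a m : ℕ) : ℤ) with hudef
  have hu : ∀ a k, u a k = 2 * ℓ * ((a k : ℕ) : ℝ) := fun a k ↦ by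
    rw [hudef]; simp only [latticeVec_apply, Int.cast_natCast]
  set f : Fin N → Fin 3 → Config N → ℝ≥0∞ := fun i k X ↦
    ((‖fderiv ℝ Ψ.ψ X (Pi.single i (EuclideanSpace.single k (1 : ℝ)))‖₊ : ℝ≥0∞)) ^ 2 +
      2 * ENNReal.ofReal (D ^ 2) * ((‖Ψ.ψ X‖₊ : ℝ≥0∞)) ^ 2 with hfdef
  set ρ : (Fin 3 → Fin M) → Fin N → Fin 3 → Config N → ℝ≥0∞ := fun a i k X ↦
    ∑' n : ℤ, A.indicator (1 : ℝ → ℝ≥0∞) (X i k - u a k - L * n) with hρdef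
  set Err : (Fin 3 → Fin M) → ℝ≥0∞ := fun a ↦ ∑ i : Fin N, ∑ k : Fin 3, ∫⁻ X in cellN N L, f i k X * ρ a i k X with hErr
  have hfm : ∀ i k, Measurable (f i k) := fun i k ↦
    (((Ψ.contDiff.continuous_fderiv one_ne_zero).clm_apply continuous_const).measurable.nnnorm.coe_nnreal_ennreal.pow_const _).add
      ((measurable_normSq Ψ.contDiff.continuous).const_mul _)
  have hρm : ∀ a i k, Measurable (ρ a i k) := fun a i k ↦
    Measurable.tsum fun n ↦ (measurable_one.indicator hAm).comp
      ((((by fun_prop : Measurable fun y : Space ↦ y k)).comp (measurable_config_apply i)).sub_const _ |>.sub_const _)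
  -- Step 1: energy of each cut-off state
  have hstep1 : ∀ a, ∫⁻ X, kineticDensity (fun X : Config N ↦ Ψ.ψ (X + fun _ ↦ u a) *
        ((∏ p : Fin N × Fin 3, q (X p.1 p.2) : ℝ) : ℂ)) X +
      interaction v X * ((‖Ψ.ψ (X + fun _ ↦ u a) * ((∏ p : Fin N × Fin 3, q (X p.1 p.2) : ℝ) : ℂ)‖₊ : ℝ≥0∞)) ^ 2 ≤
      periodicEnergy v Ψ + Err a := fun a ↦
    energyIntegral_cutoffState_le hL hvm hq hq01 hpu hD hAm hA Ψ (u a)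
  -- Step 2: the sum of the error terms over the shifts
  have hT : ∑ i : Fin N, ∑ k : Fin 3, ∫⁻ X in cellN N L, f i k X =
      (∫⁻ X in cellN N L, kineticDensity Ψ.ψ X) + 6 * N * ENNReal.ofReal (D ^ 2) := by
    have h1 : ∀ i k, ∫⁻ X in cellN N L, f i k X =
        (∫⁻ X in cellN N L, ((‖fderiv ℝ Ψ.ψ X (Pi.single i (EuclideanSpace.single k (1 : ℝ)))‖₊ : ℝ≥0∞)) ^ 2) +
          2 * ENNReal.ofReal (D ^ 2) := by
      intro i k
      rw [hfdef]
      simp only []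
      rw [lintegral_add_left ((((Ψ.contDiff.continuous_fderiv one_ne_zero).clm_apply
          continuous_const).measurable.nnnorm.coe_nnreal_ennreal.pow_const _)),
        lintegral_const_mul _ (measurable_normSq Ψ.contDiff.continuous), Ψ.norm_eq, mul_one]
    simp only [h1, Finset.sum_add_distrib, Finset.sum_const, Finset.card_univ, Fintype.card_fin, nsmul_eq_mul]
    congr 1
    · have h2 : ∀ i : Fin N, ∑ k : Fin 3, ∫⁻ X in cellN N L,
          ((‖fderiv ℝ Ψ.ψ X (Pi.single i (EuclideanSpace.single k (1 : ℝ)))‖₊ : ℝ≥0∞)) ^ 2 =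
          ∫⁻ X in cellN N L, ∑ k : Fin 3, ((‖fderiv ℝ Ψ.ψ X (Pi.single i (EuclideanSpace.single k (1 : ℝ)))‖₊ : ℝ≥0∞)) ^ 2 :=
        fun i ↦ (lintegral_finsetSum _ fun k _ ↦ ((Ψ.contDiff.continuous_fderiv one_ne_zero).clm_apply
          continuous_const).measurable.nnnorm.coe_nnreal_ennreal.pow_const _).symm
      simp only [h2]
      rw [← lintegral_finsetSum _ fun i _ ↦ Finset.measurable_sum _ fun k _ ↦
        ((Ψ.contDiff.continuous_fderiv one_ne_zero).clm_apply continuous_const).measurable.nnnorm.coe_nnreal_ennreal.pow_const _]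
      rfl
    · push_cast; ring
  have hstep2 : ∑ a : Fin 3 → Fin M, Err a ≤
      4 * (M : ℝ≥0∞) ^ 2 * ((∫⁻ X in cellN N L, kineticDensity Ψ.ψ X) + 6 * N * ENNReal.ofReal (D ^ 2)) := by
    rw [← hT, Finset.mul_sum]
    simp only [hErr]
    rw [Finset.sum_comm]
    refine Finset.sum_le_sum fun i _ ↦ ?_
    rw [Finset.mul_sum, Finset.sum_comm]
    refine Finset.sum_le_sum fun k _ ↦ ?_
    have hm : ∀ a : Fin 3 → Fin M, Measurable fun X ↦ f i k X * ρ a i k X := fun a ↦ (hfm i k).mul (hρm a i k)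
    rw [← lintegral_finsetSum _ fun a _ ↦ hm a]
    calc ∫⁻ X in cellN N L, ∑ a : Fin 3 → Fin M, f i k X * ρ a i k X
        = ∫⁻ X in cellN N L, f i k X * ∑ a : Fin 3 → Fin M, ρ a i k X := by
          refine lintegral_congr fun X ↦ ?_; rw [Finset.mul_sum]
      _ ≤ ∫⁻ X in cellN N L, f i k X * (4 * (M : ℝ≥0∞) ^ 2) := by
          refine lintegral_mono fun X ↦ ?_
          gcongr
          have h := sum_tsum_indicator_ramps_shift_le hℓ hM hLdef k (X i k)
          simp only [hρdef, hu]
          exact h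
      _ = 4 * (M : ℝ≥0∞) ^ 2 * ∫⁻ X in cellN N L, f i k X := by
          rw [lintegral_mul_const _ (hfm i k), mul_comm]
  -- Step 3: the best shift
  haveI : Nonempty (Fin M) := ⟨⟨0, hM⟩⟩
  obtain ⟨a₀, -, ha₀⟩ := Finset.exists_min_image Finset.univ Err Finset.univ_nonempty
  have hcard : (Fintype.card (Fin 3 → Fin M) : ℝ≥0∞) = (M : ℝ≥0∞) ^ 3 := by
    rw [Fintype.card_fun, Fintype.card_fin, Fintype.card_fin]; push_cast; ring
  have hstep3 : (M : ℝ≥0∞) ^ 3 * Err a₀ ≤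
      4 * (M : ℝ≥0∞) ^ 2 * ((∫⁻ X in cellN N L, kineticDensity Ψ.ψ X) + 6 * N * ENNReal.ofReal (D ^ 2)) := by
    refine le_trans ?_ hstep2
    rw [← hcard, ← nsmul_eq_mul, ← Finset.card_univ]
    exact Finset.card_nsmul_le_sum _ _ _ fun a _ ↦ ha₀ a (Finset.mem_univ a)
  have hErr : Err a₀ ≤ (M : ℝ≥0∞)⁻¹ * (4 * ((∫⁻ X in cellN N L, kineticDensity Ψ.ψ X) + 6 * N * ENNReal.ofReal (D ^ 2))) := by
    have hM2 : ((M : ℝ≥0∞) ^ 2) ≠ 0 := pow_ne_zero _ hM0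
    have hM2' : ((M : ℝ≥0∞) ^ 2) ≠ ⊤ := ENNReal.pow_ne_top hMtop
    have hM3 : ((M : ℝ≥0∞) ^ 3) ≠ 0 := pow_ne_zero _ hM0
    have hM3' : ((M : ℝ≥0∞) ^ 3) ≠ ⊤ := ENNReal.pow_ne_top hMtop
    have h1 : Err a₀ = ((M : ℝ≥0∞) ^ 3)⁻¹ * ((M : ℝ≥0∞) ^ 3 * Err a₀) := by
      rw [← mul_assoc, ENNReal.inv_mul_cancel hM3 hM3', one_mul]
    rw [h1]
    refine (mul_le_mul_right hstep3 _).trans (le_of_eq ?_)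
    rw [pow_succ, ENNReal.mul_inv (Or.inl hM2) (Or.inl hM2')]
    calc ((M : ℝ≥0∞) ^ 2)⁻¹ * (M : ℝ≥0∞)⁻¹ *
          (4 * (M : ℝ≥0∞) ^ 2 * ((∫⁻ X in cellN N L, kineticDensity Ψ.ψ X) + 6 * N * ENNReal.ofReal (D ^ 2)))
        = (M : ℝ≥0∞)⁻¹ * (4 * ((∫⁻ X in cellN N L, kineticDensity Ψ.ψ X) + 6 * N * ENNReal.ofReal (D ^ 2))) *
            (((M : ℝ≥0∞) ^ 2)⁻¹ * (M : ℝ≥0∞) ^ 2) := by ring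
      _ = _ := by rw [ENNReal.inv_mul_cancel hM2 hM2', mul_one]
  -- Step 4: the Dirichlet state of the best shift
  have hΦ := contDiff_cutoffState hq Ψ.contDiff (fun _ ↦ u a₀)
  have hΦs : ∀ X, Ψ.ψ (X + fun _ ↦ u a₀) * ((∏ p : Fin N × Fin 3, q (X p.1 p.2) : ℝ) : ℂ) ≠ 0 →
      ∀ i, X i ∈ box (L + 2 * ℓ) := fun X hX i ↦ mem_box_of_cutoffState_ne_zero hsupp Ψ.ψ _ X hX i
  have hΦp : ∀ (π : Equiv.Perm (Fin N)) (X : Config N),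
      Ψ.ψ ((X ∘ π) + fun _ ↦ u a₀) * ((∏ p : Fin N × Fin 3, q ((X ∘ π) p.1 p.2) : ℝ) : ℂ) =
        Ψ.ψ (X + fun _ ↦ u a₀) * ((∏ p : Fin N × Fin 3, q (X p.1 p.2) : ℝ) : ℂ) :=
    fun π X ↦ cutoffState_comp_perm Ψ.symm (u a₀) π X
  have hΦn := lintegral_ennnorm_cutoffState_sq hL hq.continuous (fun t ↦ (hq01 t).1) hpu Ψ (u a₀)
  have hE := groundStateEnergy_le_of_raw v hΦ hΦs hΦp hΦn
  -- Step 5: conclude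
  have hTle : (∫⁻ X in cellN N L, kineticDensity Ψ.ψ X) ≤ periodicEnergy v Ψ := by
    rw [periodicEnergy, lintegral_add_left (measurable_kineticDensity Ψ.contDiff)]
    exact le_self_add
  calc groundStateEnergy v N (L + 2 * ℓ) ≤ _ := hE
    _ ≤ periodicEnergy v Ψ + Err a₀ := hstep1 a₀
    _ ≤ periodicEnergy v Ψ + (M : ℝ≥0∞)⁻¹ * (4 * ((∫⁻ X in cellN N L, kineticDensity Ψ.ψ X) +
        6 * N * ENNReal.ofReal (D ^ 2))) := add_le_add_right hErr _
    _ ≤ periodicEnergy v Ψ + (M : ℝ≥0∞)⁻¹ * (4 * (periodicEnergy v Ψ + 6 * N * ENNReal.ofReal (D ^ 2))) := by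
        gcongr
    _ = (1 + 4 / (M : ℝ≥0∞)) * periodicEnergy v Ψ + 24 * (N : ℝ≥0∞) * ENNReal.ofReal (D ^ 2) * (M : ℝ≥0∞)⁻¹ := by
        rw [ENNReal.div_eq_inv_mul]; ring
    _ = (1 + 4 / (M : ℝ≥0∞)) * periodicEnergy v Ψ + K := by rw [hK]

end Localization

/-! ### The first-order (Dyson–LSSY) upper bound in the thermodynamic limit, Dirichlet boxes -/

section Thermodynamic

/-- `a / x^{-1/3} = a x^{1/3}` (`b = (4πρ₁/3)^{-1/3}` in LSSY's Theorem 2.2). [folklore] -/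
theorem div_rpow_neg_third {a x : ℝ} (hx : 0 ≤ x) : a / x ^ (-(1 : ℝ) / 3) = a * x ^ ((1 : ℝ) / 3) := by
  rw [show (-(1 : ℝ) / 3) = -((1 : ℝ) / 3) by ring, Real.rpow_neg hx, div_inv_eq_mul]

/-- **The Dyson–Lieb–Seiringer–Yngvason upper bound in the thermodynamic limit with Dirichlet
boundary conditions** ([LSSY2005, Thm. 2.2 (2.14)–(2.15), "Thus in the thermodynamic limit (and for
all boundary conditions) `e₀(ρ)/(4πμρa) ≤ 1 + const·Y^{1/3}`"]): for a measurable `v ≥ 0` of finite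
range with finite scattering length `a` there are `C, c > 0` (those of `LSSY2005_upperBound_periodic`)
such that for every density `ρ > 0` with `a(4πρ/3)^{1/3} < c`,
`limsup_N E₀^D(N, L_N)/L_N³ ≤ 4πρ²a(1 + C a(4πρ/3)^{1/3})`, `L_N = (N/ρ)^{1/3}`.
Proof: replicate (`limsup_energyDensity_le_of_block`) the Dirichlet blocks obtained by localising
(`exists_dirichlet_le_periodic`, `M = ℓ = n`, `L = 2n²`) the periodic boxes of LSSY's Theorem 2.2
(`LSSY2005_upperBound_periodic_holds`) with `N₀ = ⌈ρ(2n²+2n+R+1)³⌉ + 1` particles, and let `n → ∞`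
(the block density tends to `ρ`, the localisation errors to `0`). This is the first-order part of
[BastiCenatiempoSchlein2021, Thm. 1.1] for the Dirichlet thermodynamic energy density.
[cite: LSSY2005, Thm. 2.2 (2.14)–(2.15)] -/
theorem limsup_energyDensity_le_dyson {v : ℝ → ℝ≥0∞} {R₀ : ℝ} (hvR : ∀ r, R₀ < r → v r = 0)
    (hvm : Measurable v) (hfin : scatteringLength v ≠ ⊤) :
    ∃ C c : ℝ, 0 < C ∧ 0 < c ∧ ∀ ρ : ℝ, 0 < ρ →
      (scatteringLength v).toReal * (4 * Real.pi * ρ / 3) ^ ((1 : ℝ) / 3) < c →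
      limsup (fun N : ℕ ↦ groundStateEnergy v N (sideLength ρ N) / ENNReal.ofReal (sideLength ρ N ^ 3)) atTop ≤
        ENNReal.ofReal (4 * Real.pi * ρ ^ 2 * (scatteringLength v).toReal *
          (1 + C * ((scatteringLength v).toReal * (4 * Real.pi * ρ / 3) ^ ((1 : ℝ) / 3)))) := by
  -- the range, made non-negative
  set R : ℝ := max R₀ 0 with hRdef
  have hR : 0 ≤ R := le_max_right _ _
  have hvR' : ∀ r, R < r → v r = 0 := fun r hr ↦ hvR r (lt_of_le_of_lt (le_max_left _ _) hr)
  obtain ⟨C, c, hC, hc, hLSSY⟩ := LSSY2005_upperBound_periodic_holds v R hvm hvR' hfin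
  obtain ⟨Cl, hCl, hloc⟩ := exists_dirichlet_le_periodic
  refine ⟨C, c, hC, hc, fun ρ hρ hsmall ↦ ?_⟩
  set a : ℝ := (scatteringLength v).toReal with ha
  have ha0 : 0 ≤ a := ENNReal.toReal_nonneg
  -- the sequence of blocks
  set Lp : ℕ → ℝ := fun n ↦ 2 * (n : ℝ) ^ 2 with hLp
  set d : ℕ → ℝ := fun n ↦ 2 * (n : ℝ) ^ 2 + 2 * n + R + 1 with hd
  set N₀ : ℕ → ℕ := fun n ↦ ⌈ρ * d n ^ 3⌉₊ + 1 with hN₀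
  set ρ₁ : ℕ → ℝ := fun n ↦ ((N₀ n : ℝ) - 1) / Lp n ^ 3 with hρ₁
  have hd0 : ∀ n, 0 < d n := fun n ↦ by rw [hd]; positivity
  have hN₀1 : ∀ n, ((N₀ n : ℝ) - 1) = ⌈ρ * d n ^ 3⌉₊ := fun n ↦ by rw [hN₀]; push_cast; ring
  have hρd : ∀ n, ρ * d n ^ 3 < N₀ n := fun n ↦ by
    rw [hN₀]; push_cast; linarith [Nat.le_ceil (ρ * d n ^ 3)]
  have hN₀2 : ∀ n, 2 ≤ N₀ n := fun n ↦ by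
    show 2 ≤ ⌈ρ * d n ^ 3⌉₊ + 1
    have : 1 ≤ ⌈ρ * d n ^ 3⌉₊ := Nat.one_le_ceil_iff.2 (by positivity)
    omega
  -- Step 1: `ρ₁(n) → ρ`
  have htend_inv : Tendsto (fun n : ℕ ↦ (n : ℝ)⁻¹) atTop (𝓝 0) := tendsto_inv_atTop_zero.comp tendsto_natCast_atTop_atTop
  have hdLp : Tendsto (fun n : ℕ ↦ d n / Lp n) atTop (𝓝 1) := by
    have h : ∀ᶠ n : ℕ in atTop, d n / Lp n = 1 + (n : ℝ)⁻¹ + (R + 1) / 2 * ((n : ℝ)⁻¹) ^ 2 := by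
      filter_upwards [eventually_gt_atTop 0] with n hn
      have hn' : (0 : ℝ) < n := Nat.cast_pos.2 hn
      rw [hd, hLp]; field_simp; ring
    rw [tendsto_congr' h]
    have : Tendsto (fun n : ℕ ↦ 1 + (n : ℝ)⁻¹ + (R + 1) / 2 * ((n : ℝ)⁻¹) ^ 2) atTop (𝓝 (1 + 0 + (R + 1) / 2 * 0 ^ 2)) :=
      (tendsto_const_nhds.add htend_inv).add (tendsto_const_nhds.mul (htend_inv.pow 2))
    simpa using this
  have hLpt : Tendsto Lp atTop atTop :=
    ((tendsto_pow_atTop two_ne_zero).comp tendsto_natCast_atTop_atTop).const_mul_atTop (by norm_num : (0 : ℝ) < 2)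
  have hLp3 : Tendsto (fun n : ℕ ↦ (Lp n ^ 3)⁻¹) atTop (𝓝 0) :=
    tendsto_inv_atTop_zero.comp ((tendsto_pow_atTop three_ne_zero).comp hLpt)
  have hρ₁t : Tendsto ρ₁ atTop (𝓝 ρ) := by
    have hlo : ∀ᶠ n : ℕ in atTop, ρ * (d n / Lp n) ^ 3 ≤ ρ₁ n := by
      filter_upwards [eventually_gt_atTop 0] with n hn
      have hLp0 : 0 < Lp n := by show 0 < 2 * (n : ℝ) ^ 2; positivity
      show ρ * (d n / Lp n) ^ 3 ≤ ((N₀ n : ℝ) - 1) / Lp n ^ 3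
      rw [hN₀1, div_pow, ← mul_div_assoc, div_le_div_iff_of_pos_right (pow_pos hLp0 3)]
      exact Nat.le_ceil _
    have hhi : ∀ᶠ n : ℕ in atTop, ρ₁ n ≤ ρ * (d n / Lp n) ^ 3 + (Lp n ^ 3)⁻¹ := by
      filter_upwards [eventually_gt_atTop 0] with n hn
      have hLp0 : 0 < Lp n := by show 0 < 2 * (n : ℝ) ^ 2; positivity
      show ((N₀ n : ℝ) - 1) / Lp n ^ 3 ≤ ρ * (d n / Lp n) ^ 3 + (Lp n ^ 3)⁻¹
      rw [hN₀1, div_pow, ← mul_div_assoc, ← one_div, ← add_div,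
        div_le_div_iff_of_pos_right (pow_pos hLp0 3)]
      exact (Nat.ceil_lt_add_one (by positivity)).le
    refine tendsto_of_tendsto_of_tendsto_of_le_of_le' ?_ ?_ hlo hhi
    · have : Tendsto (fun n ↦ ρ * (d n / Lp n) ^ 3) atTop (𝓝 (ρ * 1 ^ 3)) := tendsto_const_nhds.mul (hdLp.pow 3)
      simpa using this
    · have : Tendsto (fun n ↦ ρ * (d n / Lp n) ^ 3 + (Lp n ^ 3)⁻¹) atTop (𝓝 (ρ * 1 ^ 3 + 0)) :=
        (tendsto_const_nhds.mul (hdLp.pow 3)).add hLp3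
      simpa using this
  -- Step 2: the comparison sequence and its limit
  set g : ℕ → ℝ := fun n ↦ ρ * ((1 + 4 / (n : ℝ)) * (4 * Real.pi * ρ₁ n * a *
      (1 + C * (a * (4 * Real.pi * ρ₁ n / 3) ^ ((1 : ℝ) / 3))))) + ρ * (Cl / (n : ℝ) ^ 3) with hg
  have hx : Tendsto (fun n : ℕ ↦ a * (4 * Real.pi * ρ₁ n / 3) ^ ((1 : ℝ) / 3)) atTop
      (𝓝 (a * (4 * Real.pi * ρ / 3) ^ ((1 : ℝ) / 3))) :=
    tendsto_const_nhds.mul (((hρ₁t.const_mul _).div_const _).rpow_const (Or.inr (by norm_num)))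
  have hgt : Tendsto g atTop
      (𝓝 (4 * Real.pi * ρ ^ 2 * a * (1 + C * (a * (4 * Real.pi * ρ / 3) ^ ((1 : ℝ) / 3))))) := by
    have h1 : Tendsto (fun n : ℕ ↦ 1 + 4 / (n : ℝ)) atTop (𝓝 (1 + 0)) :=
      tendsto_const_nhds.add (tendsto_const_div_atTop_nhds_zero_nat 4)
    have h3 : Tendsto (fun n : ℕ ↦ ρ * (Cl / (n : ℝ) ^ 3)) atTop (𝓝 (ρ * (Cl * 0 ^ 3))) := by
      refine tendsto_const_nhds.mul (((htend_inv.pow 3).const_mul Cl).congr fun n ↦ ?_)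
      rw [div_eq_mul_inv, inv_pow]
    have h4 : Tendsto (fun n : ℕ ↦ ρ * ((1 + 4 / (n : ℝ)) * (4 * Real.pi * ρ₁ n * a *
        (1 + C * (a * (4 * Real.pi * ρ₁ n / 3) ^ ((1 : ℝ) / 3)))))) atTop
        (𝓝 (ρ * ((1 + 0) * (4 * Real.pi * ρ * a * (1 + C * (a * (4 * Real.pi * ρ / 3) ^ ((1 : ℝ) / 3))))))) :=
      tendsto_const_nhds.mul (h1.mul (((tendsto_const_nhds.mul hρ₁t).mul tendsto_const_nhds).mul
        (tendsto_const_nhds.add (tendsto_const_nhds.mul hx))))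
    have T := h4.add h3
    have heq : ρ * ((1 + 0) * (4 * Real.pi * ρ * a * (1 + C * (a * (4 * Real.pi * ρ / 3) ^ ((1 : ℝ) / 3))))) +
        ρ * (Cl * 0 ^ 3) = 4 * Real.pi * ρ ^ 2 * a * (1 + C * (a * (4 * Real.pi * ρ / 3) ^ ((1 : ℝ) / 3))) := by
      ring
    rw [heq] at T
    exact T
  -- Step 3: eventually, the energy density is bounded by `g n`
  have hev : ∀ᶠ n : ℕ in atTop,
      limsup (fun N : ℕ ↦ groundStateEnergy v N (sideLength ρ N) / ENNReal.ofReal (sideLength ρ N ^ 3)) atTop ≤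
        ENNReal.ofReal (g n) := by
    filter_upwards [eventually_ge_atTop 1, hLpt.eventually_gt_atTop (2 * R), hx.eventually_lt_const hsmall]
      with n hn1 hRL hab
    have hn : (0 : ℝ) < n := by exact_mod_cast hn1
    have hLp0 : 0 < Lp n := by rw [hLp]; positivity
    have hLpn : 2 * (n : ℝ) * (n : ℕ) = Lp n := by rw [hLp]; push_cast; ring
    have hN₀pos : 0 < N₀ n := lt_of_lt_of_le two_pos (hN₀2 n)
    have hN₀r : (0 : ℝ) < N₀ n := Nat.cast_pos.2 hN₀pos
    have hρ₁0 : 0 ≤ ρ₁ n := by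
      rw [hρ₁]; simp only []; rw [hN₀1]; positivity
    -- the three bounds
    have hblock := limsup_energyDensity_le_of_block hvR' hvm hR hN₀pos (L₀ := 2 * (n : ℝ) * (n : ℕ) + 2 * n)
      (by positivity) hρ (d := d n) (by rw [hd]; push_cast; nlinarith) (hρd n)
    have hlocn := hloc (N₀ n) (n : ℝ) n v hn hn1 hvm
    nth_rewrite 2 [hLpn] at hlocn
    have hL1 := hLSSY (N₀ n) (Lp n) (hN₀2 n) hLp0 hRL
    simp only [] at hL1
    have hab' : a / (4 * Real.pi * (((N₀ n : ℝ) - 1) / Lp n ^ 3) / 3) ^ (-(1 : ℝ) / 3) ≤ c := by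
      rw [div_rpow_neg_third (by rw [hN₀1]; positivity)]
      exact hab.le
    have hL2 := hL1 hab'
    rw [div_rpow_neg_third (by rw [hN₀1]; positivity)] at hL2
    -- combine
    have hg0 : 0 ≤ 4 * Real.pi * ρ₁ n * a * (1 + C * (a * (4 * Real.pi * ρ₁ n / 3) ^ ((1 : ℝ) / 3))) := by positivity
    calc limsup (fun N : ℕ ↦ groundStateEnergy v N (sideLength ρ N) / ENNReal.ofReal (sideLength ρ N ^ 3)) atTop
        ≤ ENNReal.ofReal (ρ / N₀ n) * groundStateEnergy v (N₀ n) (2 * (n : ℝ) * (n : ℕ) + 2 * n) := hblock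
      _ ≤ ENNReal.ofReal (ρ / N₀ n) * ((1 + 4 / (n : ℝ≥0∞)) * periodicGroundStateEnergy v (N₀ n) (Lp n) +
          ENNReal.ofReal (Cl * N₀ n / (n * (n : ℝ) ^ 2))) := by gcongr
      _ ≤ ENNReal.ofReal (ρ / N₀ n) * ((1 + 4 / (n : ℝ≥0∞)) *
          ENNReal.ofReal (4 * Real.pi * ρ₁ n * a * (1 + C * (a * (4 * Real.pi * ρ₁ n / 3) ^ ((1 : ℝ) / 3))) * N₀ n) +
          ENNReal.ofReal (Cl * N₀ n / (n * (n : ℝ) ^ 2))) := by gcongr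
      _ = ENNReal.ofReal (g n) := by
          have h14 : (1 + 4 / (n : ℝ≥0∞)) = ENNReal.ofReal (1 + 4 / n) := by
            rw [ENNReal.ofReal_add zero_le_one (by positivity), ENNReal.ofReal_one,
              ENNReal.ofReal_div_of_pos hn, ENNReal.ofReal_ofNat, ENNReal.ofReal_natCast]
          rw [h14, ← ENNReal.ofReal_mul (by positivity), ← ENNReal.ofReal_add (by positivity) (by positivity),
            ← ENNReal.ofReal_mul (by positivity), hg]
          congr 1
          field_simp
  -- Step 4: pass to the limit
  exact ge_of_tendsto (ENNReal.tendsto_ofReal hgt) hev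

/-- `a (4πρ/3)^{1/3} = (4π/3)^{1/3} (ρa³)^{1/3}` for `a, ρ ≥ 0` (LSSY's `a/b` versus `Y^{1/3}`,
`Y = 4πρa³/3`). [cite: LSSY2005, Thm. 2.2 (2.14)–(2.15)] -/
theorem mul_rpow_third_eq {a ρ : ℝ} (ha : 0 ≤ a) (hρ : 0 ≤ ρ) :
    a * (4 * Real.pi * ρ / 3) ^ ((1 : ℝ) / 3) = (4 * Real.pi / 3) ^ ((1 : ℝ) / 3) * (ρ * a ^ 3) ^ ((1 : ℝ) / 3) := by
  have h3 : (a ^ 3) ^ ((1 : ℝ) / 3) = a := by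
    rw [show ((1 : ℝ) / 3) = ((3 : ℕ) : ℝ)⁻¹ by norm_num, Real.pow_rpow_inv_natCast ha (by norm_num)]
  rw [show 4 * Real.pi * ρ / 3 = (4 * Real.pi / 3) * ρ by ring,
    Real.mul_rpow (by positivity) hρ, Real.mul_rpow hρ (by positivity), h3]
  ring

/-- **The Dyson–LSSY thermodynamic upper bound in the `Y^{1/3}` form of [LSSY2005, (2.15)]** (Dirichlet
boundary conditions): for finite-range measurable `v ≥ 0` with scattering length `0 < a < ∞` there are
`C` and `ρ₀ > 0` such that for all `0 < ρ < ρ₀`,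
`limsup_N E₀^D(N, L_N)/L_N³ ≤ 4πρ²a(1 + C (ρa³)^{1/3})`, `L_N = (N/ρ)^{1/3}`.
[cite: LSSY2005, Thm. 2.2 (2.15) and the sentence following it] -/
theorem limsup_energyDensity_le_dyson' {v : ℝ → ℝ≥0∞} {R₀ : ℝ} (hvR : ∀ r, R₀ < r → v r = 0)
    (hvm : Measurable v) (hfin : scatteringLength v ≠ ⊤) (hpos : 0 < scatteringLength v) :
    ∃ C ρ₀ : ℝ, 0 < C ∧ 0 < ρ₀ ∧ ∀ ρ : ℝ, 0 < ρ → ρ < ρ₀ →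
      limsup (fun N : ℕ ↦ groundStateEnergy v N (sideLength ρ N) / ENNReal.ofReal (sideLength ρ N ^ 3)) atTop ≤
        ENNReal.ofReal (4 * Real.pi * ρ ^ 2 * (scatteringLength v).toReal *
          (1 + C * (ρ * (scatteringLength v).toReal ^ 3) ^ ((1 : ℝ) / 3))) := by
  obtain ⟨C, c, hC, hc, h⟩ := limsup_energyDensity_le_dyson hvR hvm hfin
  set a : ℝ := (scatteringLength v).toReal with ha
  have ha0 : 0 < a := ENNReal.toReal_pos hpos.ne' hfin
  set κ : ℝ := (4 * Real.pi / 3) ^ ((1 : ℝ) / 3) with hκ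
  have hκ0 : 0 < κ := Real.rpow_pos_of_pos (by positivity) _
  -- `ρ₀`: `κ (ρ₀ a³)^{1/3} = c`, i.e. `ρ₀ = (c/κ)³ / a³`
  refine ⟨C * κ, (c / κ) ^ 3 / a ^ 3, by positivity, by positivity, fun ρ hρ hρ₀ ↦ ?_⟩
  have hY : (ρ * a ^ 3) ^ ((1 : ℝ) / 3) < c / κ := by
    have h1 : ρ * a ^ 3 < (c / κ) ^ 3 := by rwa [lt_div_iff₀ (by positivity)] at hρ₀
    calc (ρ * a ^ 3) ^ ((1 : ℝ) / 3) < ((c / κ) ^ 3) ^ ((1 : ℝ) / 3) :=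
          Real.rpow_lt_rpow (by positivity) h1 (by norm_num)
      _ = c / κ := by
          rw [show ((1 : ℝ) / 3) = ((3 : ℕ) : ℝ)⁻¹ by norm_num, Real.pow_rpow_inv_natCast (by positivity) (by norm_num)]
  have hsmall : a * (4 * Real.pi * ρ / 3) ^ ((1 : ℝ) / 3) < c := by
    rw [mul_rpow_third_eq ha0.le hρ.le, ← hκ]
    rwa [lt_div_iff₀ hκ0, mul_comm] at hY
  have hmain := h ρ hρ hsmall
  rw [mul_rpow_third_eq ha0.le hρ.le, ← hκ] at hmain
  convert hmain using 4
  ring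

/-- **Dyson's upper bound at fixed density in finite Dirichlet boxes, for all large `N`.** For
finite-range measurable `v ≥ 0` with `0 < a < ∞` there are `C` and `ρ₀ > 0` such that for all
`0 < ρ < ρ₀`, for all sufficiently large `N`, `E₀^D(N, (N/ρ)^{1/3}) ≤ 4πρa(1 + C(ρa³)^{1/3}) N`
(from the `limsup` bound with constant `C`, using the strict slack `C < C + 1` and `L_N³ = N/ρ`).
[cite: LSSY2005, Thm. 2.2 (2.14)–(2.15)] -/
theorem eventually_groundStateEnergy_le_dyson {v : ℝ → ℝ≥0∞} {R₀ : ℝ} (hvR : ∀ r, R₀ < r → v r = 0)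
    (hvm : Measurable v) (hfin : scatteringLength v ≠ ⊤) (hpos : 0 < scatteringLength v) :
    ∃ C ρ₀ : ℝ, 0 < C ∧ 0 < ρ₀ ∧ ∀ ρ : ℝ, 0 < ρ → ρ < ρ₀ →
      ∀ᶠ N : ℕ in atTop, groundStateEnergy v N (sideLength ρ N) ≤
        ENNReal.ofReal (4 * Real.pi * ρ * (scatteringLength v).toReal *
          (1 + C * (ρ * (scatteringLength v).toReal ^ 3) ^ ((1 : ℝ) / 3)) * N) := by
  obtain ⟨C, ρ₀, hC, hρ₀, h⟩ := limsup_energyDensity_le_dyson' hvR hvm hfin hpos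
  set a : ℝ := (scatteringLength v).toReal with ha
  have ha0 : 0 < a := ENNReal.toReal_pos hpos.ne' hfin
  refine ⟨C + 1, ρ₀, by positivity, hρ₀, fun ρ hρ hρρ₀ ↦ ?_⟩
  set Y : ℝ := (ρ * a ^ 3) ^ ((1 : ℝ) / 3) with hY
  have hY0 : 0 < Y := Real.rpow_pos_of_pos (by positivity) _
  set B' : ℝ := 4 * Real.pi * ρ ^ 2 * a * (1 + (C + 1) * Y) with hB'
  have hB'pos : 0 < B' := by positivity
  have hlt : limsup (fun N : ℕ ↦ groundStateEnergy v N (sideLength ρ N) /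
      ENNReal.ofReal (sideLength ρ N ^ 3)) atTop < ENNReal.ofReal B' := by
    refine lt_of_le_of_lt (h ρ hρ hρρ₀) ?_
    rw [ENNReal.ofReal_lt_ofReal_iff hB'pos, hB']
    have : 4 * Real.pi * ρ ^ 2 * a * (C * Y) < 4 * Real.pi * ρ ^ 2 * a * ((C + 1) * Y) := by
      gcongr; linarith
    nlinarith
  filter_upwards [Filter.eventually_lt_of_limsup_lt hlt, eventually_gt_atTop 0] with N hN hN0
  have hL3 : sideLength ρ N ^ 3 = N / ρ := by
    have h0 : (0 : ℝ) ≤ N / ρ := div_nonneg (Nat.cast_nonneg N) hρ.le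
    rw [sideLength, ← Real.rpow_natCast, ← Real.rpow_mul h0]
    norm_num
  have hL3pos : 0 < sideLength ρ N ^ 3 := by rw [hL3]; exact div_pos (Nat.cast_pos.2 hN0) hρ
  have hne0 : ENNReal.ofReal (sideLength ρ N ^ 3) ≠ 0 := (ENNReal.ofReal_pos.2 hL3pos).ne'
  rw [ENNReal.div_lt_iff (Or.inl hne0) (Or.inl ENNReal.ofReal_ne_top), ← ENNReal.ofReal_mul hB'pos.le] at hN
  refine hN.le.trans (le_of_eq ?_)
  congr 1
  rw [hB', hL3]
  field_simp

end Thermodynamic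


/-! ### The Young-parameter (`η`) versions, for second-order applications -/

section Eta

variable {N : ℕ} {L : ℝ} {q : ℝ → ℝ} {ψ : Config N → ℂ} {v : ℝ → ℝ≥0∞}

/-- **Pointwise kinetic bound for the cut-off state, with a Young parameter `η > 0`.** As
`ennnorm_fderiv_cutoffState_sq_le`, but with `|a + b|² ≤ (1+η)|b|² + (1+η⁻¹)|a|²` on the ramps:
`|∂_{ik}Φ_u|² ≤ Q²|∂_{ik}ψ(X+u)|²(1 + η 1_A(x_{ik})) + (1+η⁻¹)D² 1_A(x_{ik}) (∏_{(j,m)≠(i,k)} q)² |ψ(X+u)|²`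
(the form needed for second-order precision: the kinetic excess can be made small independently of
the cut-off cost). [folklore] -/
theorem ennnorm_fderiv_cutoffState_sq_le_eta (hq : ContDiff ℝ 1 q) (hψ : ContDiff ℝ 1 ψ)
    (hq01 : ∀ t, 0 ≤ q t ∧ q t ≤ 1) {D : ℝ} (hD : ∀ t, |deriv q t| ≤ D) {A : Set ℝ}
    (hA : ∀ t, deriv q t ≠ 0 → t ∈ A) {η : ℝ} (hη : 0 < η) (U X : Config N) (i : Fin N) (k : Fin 3) :
    ((‖fderiv ℝ (fun X : Config N ↦ ψ (X + U) * ((∏ p : Fin N × Fin 3, q (X p.1 p.2) : ℝ) : ℂ)) X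
        (Pi.single i (EuclideanSpace.single k (1 : ℝ)))‖₊ : ℝ≥0∞)) ^ 2 ≤
      ENNReal.ofReal ((∏ p : Fin N × Fin 3, q (X p.1 p.2)) ^ 2) *
          ((‖fderiv ℝ ψ (X + U) (Pi.single i (EuclideanSpace.single k (1 : ℝ)))‖₊ : ℝ≥0∞)) ^ 2 *
          (1 + ENNReal.ofReal η * A.indicator (1 : ℝ → ℝ≥0∞) (X i k)) +
        (1 + ENNReal.ofReal η⁻¹) * ENNReal.ofReal (D ^ 2) * A.indicator (1 : ℝ → ℝ≥0∞) (X i k) *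
          ENNReal.ofReal ((∏ p ∈ Finset.univ.erase (i, k), q (X p.1 p.2)) ^ 2) *
          ((‖ψ (X + U)‖₊ : ℝ≥0∞)) ^ 2 := by
  classical
  rw [fderiv_cutoffState_single hq hψ U X i k]
  set Qf : ℝ := ∏ p : Fin N × Fin 3, q (X p.1 p.2) with hQf
  set P : ℝ := ∏ p ∈ Finset.univ.erase (i, k), q (X p.1 p.2) with hP
  set dψ : ℂ := fderiv ℝ ψ (X + U) (Pi.single i (EuclideanSpace.single k (1 : ℝ))) with hdψ
  have hQf0 : 0 ≤ Qf := Finset.prod_nonneg fun p _ ↦ (hq01 _).1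
  by_cases h0 : deriv q (X i k) = 0
  · -- the derivative is `Q ∂ψ`
    rw [h0, zero_mul, Complex.ofReal_zero, mul_zero, zero_add, ennorm_real_mul_sq Qf hQf0]
    calc ENNReal.ofReal (Qf ^ 2) * ((‖dψ‖₊ : ℝ≥0∞)) ^ 2
        = ENNReal.ofReal (Qf ^ 2) * ((‖dψ‖₊ : ℝ≥0∞)) ^ 2 * 1 := (mul_one _).symm
      _ ≤ ENNReal.ofReal (Qf ^ 2) * ((‖dψ‖₊ : ℝ≥0∞)) ^ 2 * (1 + ENNReal.ofReal η * A.indicator (1 : ℝ → ℝ≥0∞) (X i k)) := by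
          gcongr; exact le_self_add
      _ ≤ _ := le_self_add
  · -- on the ramp: Young's inequality
    have hmem : X i k ∈ A := hA _ h0
    rw [Set.indicator_of_mem hmem, Pi.one_apply]
    have hreal : ‖ψ (X + U) * ((deriv q (X i k) * P : ℝ) : ℂ) + (Qf : ℂ) * dψ‖ ^ 2 ≤
        (1 + η) * Qf ^ 2 * ‖dψ‖ ^ 2 + (1 + η⁻¹) * D ^ 2 * P ^ 2 * ‖ψ (X + U)‖ ^ 2 := by
      have h1 : ‖ψ (X + U) * ((deriv q (X i k) * P : ℝ) : ℂ) + (Qf : ℂ) * dψ‖ ≤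
          ‖ψ (X + U)‖ * (|deriv q (X i k)| * |P|) + |Qf| * ‖dψ‖ := by
        refine (norm_add_le _ _).trans (le_of_eq ?_)
        rw [norm_mul, norm_mul, Complex.norm_real, Complex.norm_real, Real.norm_eq_abs, Real.norm_eq_abs,
          abs_mul]
      have h3 : ‖ψ (X + U) * ((deriv q (X i k) * P : ℝ) : ℂ) + (Qf : ℂ) * dψ‖ ≤
          ‖ψ (X + U)‖ * (D * |P|) + |Qf| * ‖dψ‖ := by
        refine h1.trans ?_; gcongr; exact hD _
      have hD0 : 0 ≤ D := (abs_nonneg _).trans (hD 0)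
      set x : ℝ := ‖ψ (X + U)‖ * (D * |P|) with hx
      set y : ℝ := |Qf| * ‖dψ‖ with hy
      have hx0 : 0 ≤ x := by positivity
      have hy0 : 0 ≤ y := by positivity
      -- Young: `2xy ≤ η y² + η⁻¹ x²`
      have young : 2 * x * y ≤ η * y ^ 2 + η⁻¹ * x ^ 2 := by
        have hid : η * (η * y ^ 2 + η⁻¹ * x ^ 2 - 2 * x * y) = (η * y - x) ^ 2 := by
          have : η * η⁻¹ = 1 := mul_inv_cancel₀ hη.ne'
          linear_combination (x ^ 2) * this
        have hnn : 0 ≤ η * (η * y ^ 2 + η⁻¹ * x ^ 2 - 2 * x * y) := by rw [hid]; exact sq_nonneg _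
        by_contra hc
        have hc' : η * y ^ 2 + η⁻¹ * x ^ 2 - 2 * x * y < 0 := by linarith [not_le.mp hc]
        linarith [mul_neg_of_pos_of_neg hη hc']
      calc _ ≤ (x + y) ^ 2 := pow_le_pow_left₀ (norm_nonneg _) h3 2
        _ ≤ (1 + η) * y ^ 2 + (1 + η⁻¹) * x ^ 2 := by nlinarith [young]
        _ = (1 + η) * Qf ^ 2 * ‖dψ‖ ^ 2 + (1 + η⁻¹) * D ^ 2 * P ^ 2 * ‖ψ (X + U)‖ ^ 2 := by
            rw [hx, hy, mul_pow, mul_pow, mul_pow, sq_abs, sq_abs]; ring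
    rw [ennnorm_sq_eq_ofReal, ennnorm_sq_eq_ofReal dψ, ennnorm_sq_eq_ofReal (ψ (X + U))]
    refine (ENNReal.ofReal_le_ofReal hreal).trans (le_of_eq ?_)
    have hD0 : 0 ≤ D := (abs_nonneg _).trans (hD 0)
    have hη1 : (0 : ℝ) ≤ 1 + η := by positivity
    have hη2 : (0 : ℝ) ≤ 1 + η⁻¹ := by positivity
    rw [ENNReal.ofReal_add (by positivity) (by positivity), ENNReal.ofReal_mul (by positivity),
      ENNReal.ofReal_mul (by positivity), ENNReal.ofReal_mul (by positivity), ENNReal.ofReal_mul (by positivity),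
      ENNReal.ofReal_mul (by positivity), ENNReal.ofReal_add zero_le_one hη.le, ENNReal.ofReal_add zero_le_one (inv_nonneg.2 hη.le),
      ENNReal.ofReal_one]
    ring

/-- **Pointwise bookkeeping of the kinetic bound (with a coefficient `E` on the ramp excess).** In terms of the per-particle weights
`W(y) = ∏ₘ q(yₘ)²` and `R_k(y) = 1_A(y_k) ∏_{m ≠ k} q(y_m)²` (with `0 ≤ q ≤ 1`): the two terms of
`ennnorm_fderiv_cutoffState_sq_le` are bounded by
`G₁ ∏ⱼ W(xⱼ) + (G₁ + G₂) · R_k(xᵢ) ∏_{j ≠ i} W(xⱼ)`. [folklore] -/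
theorem kineticBound_terms_le_eta (hq01 : ∀ t, 0 ≤ q t ∧ q t ≤ 1) (A : Set ℝ) (X : Config N) (i : Fin N) (k : Fin 3)
    (G₁ G₂ D2 E : ℝ≥0∞) :
    ENNReal.ofReal ((∏ p : Fin N × Fin 3, q (X p.1 p.2)) ^ 2) * G₁ * (1 + E * A.indicator (1 : ℝ → ℝ≥0∞) (X i k)) +
        D2 * A.indicator (1 : ℝ → ℝ≥0∞) (X i k) *
          ENNReal.ofReal ((∏ p ∈ Finset.univ.erase (i, k), q (X p.1 p.2)) ^ 2) * G₂ ≤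
      G₁ * ∏ j : Fin N, ∏ m : Fin 3, ENNReal.ofReal (q (X j m) ^ 2) +
        (E * G₁ + D2 * G₂) * ∏ j : Fin N, (Function.update
          (fun _ : Fin N ↦ fun y : Space ↦ ∏ m : Fin 3, ENNReal.ofReal (q (y m) ^ 2)) i
          (fun y : Space ↦ A.indicator (1 : ℝ → ℝ≥0∞) (y k) *
            ∏ m ∈ Finset.univ.erase k, ENNReal.ofReal (q (y m) ^ 2)) j) (X j) := by
  classical
  -- the products in `ℝ≥0∞`
  have hQ : ENNReal.ofReal ((∏ p : Fin N × Fin 3, q (X p.1 p.2)) ^ 2) =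
      ∏ j : Fin N, ∏ m : Fin 3, ENNReal.ofReal (q (X j m) ^ 2) := by
    rw [← Finset.prod_pow, ENNReal.ofReal_prod_of_nonneg fun p _ ↦ sq_nonneg _]
    exact Fintype.prod_prod_type fun p ↦ ENNReal.ofReal (q (X p.1 p.2) ^ 2)
  have hP : ENNReal.ofReal ((∏ p ∈ Finset.univ.erase (i, k), q (X p.1 p.2)) ^ 2) =
      (∏ m ∈ Finset.univ.erase k, ENNReal.ofReal (q (X i m) ^ 2)) *
        ∏ j ∈ Finset.univ.erase i, ∏ m : Fin 3, ENNReal.ofReal (q (X j m) ^ 2) := by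
    rw [← Finset.prod_pow, ENNReal.ofReal_prod_of_nonneg fun p _ ↦ sq_nonneg _]
    exact prod_erase_pair_eq (fun p ↦ ENNReal.ofReal (q (X p.1 p.2) ^ 2)) i k
  have hw' : ∏ j : Fin N, (Function.update
      (fun _ : Fin N ↦ fun y : Space ↦ ∏ m : Fin 3, ENNReal.ofReal (q (y m) ^ 2)) i
      (fun y : Space ↦ A.indicator (1 : ℝ → ℝ≥0∞) (y k) *
        ∏ m ∈ Finset.univ.erase k, ENNReal.ofReal (q (y m) ^ 2)) j) (X j) =
      (A.indicator (1 : ℝ → ℝ≥0∞) (X i k) * ∏ m ∈ Finset.univ.erase k, ENNReal.ofReal (q (X i m) ^ 2)) *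
        ∏ j ∈ Finset.univ.erase i, ∏ m : Fin 3, ENNReal.ofReal (q (X j m) ^ 2) := by
    rw [← Finset.mul_prod_erase _ _ (Finset.mem_univ i), Function.update_self]
    congr 1
    exact Finset.prod_congr rfl fun j hj ↦ by rw [Function.update_of_ne (Finset.ne_of_mem_erase hj)]
  have hWi : ∏ m : Fin 3, ENNReal.ofReal (q (X i m) ^ 2) ≤ ∏ m ∈ Finset.univ.erase k, ENNReal.ofReal (q (X i m) ^ 2) := by
    rw [← Finset.mul_prod_erase _ _ (Finset.mem_univ k)]
    refine mul_le_of_le_one_left' ?_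
    rw [ENNReal.ofReal_le_one]
    have h := hq01 (X i k)
    nlinarith [h.1, h.2]
  have hsplit : ∏ j : Fin N, ∏ m : Fin 3, ENNReal.ofReal (q (X j m) ^ 2) =
      (∏ m : Fin 3, ENNReal.ofReal (q (X i m) ^ 2)) * ∏ j ∈ Finset.univ.erase i, ∏ m : Fin 3, ENNReal.ofReal (q (X j m) ^ 2) :=
    (Finset.mul_prod_erase _ _ (Finset.mem_univ i)).symm
  rw [hQ, hP, hw']
  set Wi := ∏ m : Fin 3, ENNReal.ofReal (q (X i m) ^ 2)
  set Wi' := ∏ m ∈ Finset.univ.erase k, ENNReal.ofReal (q (X i m) ^ 2)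
  set rest := ∏ j ∈ Finset.univ.erase i, ∏ m : Fin 3, ENNReal.ofReal (q (X j m) ^ 2)
  set ind := A.indicator (1 : ℝ → ℝ≥0∞) (X i k)
  rw [hsplit]
  have key : ind * (Wi * rest) ≤ ind * Wi' * rest := by
    rw [mul_assoc]; gcongr
  calc Wi * rest * G₁ * (1 + E * ind) + D2 * ind * (Wi' * rest) * G₂
      = G₁ * (Wi * rest) + E * G₁ * (ind * (Wi * rest)) + D2 * G₂ * (ind * Wi' * rest) := by ring
    _ ≤ G₁ * (Wi * rest) + E * G₁ * (ind * Wi' * rest) + D2 * G₂ * (ind * Wi' * rest) := by gcongr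
    _ = G₁ * (Wi * rest) + (E * G₁ + D2 * G₂) * (ind * Wi' * rest) := by ring

/-- **Kinetic energy of the cut-off state (fixed shift, Young parameter `η`).**
`∫ |∇Φ_u|² ≤ ∫_{cell} |∇ψ|² + ∑_{i,k} ∫_{cell} (η|∂_{ik}ψ|² + (1+η⁻¹)D²|ψ|²)(X) ρ_A(x_{ik} - u_k) dX`.
[folklore] -/
theorem lintegral_kineticDensity_cutoffState_le_eta (hL : 0 < L) (hq : ContDiff ℝ 1 q)
    (hq01 : ∀ t, 0 ≤ q t ∧ q t ≤ 1) (hpu : ∀ t, ∑' m : ℤ, ENNReal.ofReal (q (t - L * m) ^ 2) = 1)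
    {D : ℝ} (hD : ∀ t, |deriv q t| ≤ D) {A : Set ℝ} (hAm : MeasurableSet A) (hA : ∀ t, deriv q t ≠ 0 → t ∈ A)
    {η : ℝ} (hη : 0 < η) (Ψ : PeriodicTrialState N L) (u : Space) :
    ∫⁻ X, kineticDensity (fun X : Config N ↦ Ψ.ψ (X + fun _ ↦ u) * ((∏ p : Fin N × Fin 3, q (X p.1 p.2) : ℝ) : ℂ)) X ≤
      (∫⁻ X in cellN N L, kineticDensity Ψ.ψ X) +
        ∑ i : Fin N, ∑ k : Fin 3, ∫⁻ X in cellN N L,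
          (ENNReal.ofReal η * ((‖fderiv ℝ Ψ.ψ X (Pi.single i (EuclideanSpace.single k (1 : ℝ)))‖₊ : ℝ≥0∞)) ^ 2 +
              (1 + ENNReal.ofReal η⁻¹) * ENNReal.ofReal (D ^ 2) * ((‖Ψ.ψ X‖₊ : ℝ≥0∞)) ^ 2) *
            ∑' n : ℤ, A.indicator (1 : ℝ → ℝ≥0∞) (X i k - u k - L * n) := by
  classical
  set U : Config N := fun _ ↦ u with hU
  -- abbreviations for the periodic integrands
  set G₁ : Fin N → Fin 3 → Config N → ℝ≥0∞ := fun i k X ↦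
    ((‖fderiv ℝ Ψ.ψ X (Pi.single i (EuclideanSpace.single k (1 : ℝ)))‖₊ : ℝ≥0∞)) ^ 2 with hG₁
  set G₂ : Config N → ℝ≥0∞ := fun X ↦ ((‖Ψ.ψ X‖₊ : ℝ≥0∞)) ^ 2 with hG₂
  have hG₁m : ∀ i k, Measurable (G₁ i k) := fun i k ↦
    ((Ψ.contDiff.continuous_fderiv one_ne_zero).clm_apply continuous_const).measurable.nnnorm.coe_nnreal_ennreal.pow_const _
  have hG₂m : Measurable G₂ := measurable_normSq Ψ.contDiff.continuous
  have hG₁per : ∀ i k (X : Config N) (i' : Fin N) (k' : Fin 3),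
      G₁ i k (X + Pi.single i' (EuclideanSpace.single k' L)) = G₁ i k X := by
    intro i k X i' k'
    simp only [hG₁, fderiv_add_eq_of_invariant (fun Y ↦ Ψ.periodic Y i' k')]
  have hG₂per : ∀ (X : Config N) (i' : Fin N) (k' : Fin 3),
      G₂ (X + Pi.single i' (EuclideanSpace.single k' L)) = G₂ X := by
    intro X i' k'
    simp only [hG₂, Ψ.periodic]
  -- pointwise bound
  have hpt : ∀ X : Config N,
      kineticDensity (fun X : Config N ↦ Ψ.ψ (X + U) * ((∏ p : Fin N × Fin 3, q (X p.1 p.2) : ℝ) : ℂ)) X ≤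
        ∑ i : Fin N, ∑ k : Fin 3, (G₁ i k (X + U) * ∏ j : Fin N, ∏ m : Fin 3, ENNReal.ofReal (q (X j m) ^ 2) +
          (ENNReal.ofReal η * G₁ i k (X + U) + (1 + ENNReal.ofReal η⁻¹) * ENNReal.ofReal (D ^ 2) * G₂ (X + U)) * ∏ j : Fin N, (Function.update
            (fun _ : Fin N ↦ fun y : Space ↦ ∏ m : Fin 3, ENNReal.ofReal (q (y m) ^ 2)) i
            (fun y : Space ↦ A.indicator (1 : ℝ → ℝ≥0∞) (y k) *
              ∏ m ∈ Finset.univ.erase k, ENNReal.ofReal (q (y m) ^ 2)) j) (X j)) := by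
    intro X
    unfold kineticDensity
    refine Finset.sum_le_sum fun i _ ↦ Finset.sum_le_sum fun k _ ↦ ?_
    refine (ennnorm_fderiv_cutoffState_sq_le_eta hq Ψ.contDiff hq01 hD hA hη U X i k).trans ?_
    have h := kineticBound_terms_le_eta hq01 A X i k (G₁ i k (X + U)) (G₂ (X + U))
      ((1 + ENNReal.ofReal η⁻¹) * ENNReal.ofReal (D ^ 2)) (ENNReal.ofReal η)
    simp only [hG₁, hG₂] at h ⊢
    convert h using 2
  refine (lintegral_mono hpt).trans (le_of_eq ?_)
  -- integrate term by term
  have hWm : Measurable fun y : Space ↦ ∏ m : Fin 3, ENNReal.ofReal (q (y m) ^ 2) :=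
    Finset.measurable_prod _ fun m _ ↦ ENNReal.measurable_ofReal.comp
      ((hq.continuous.measurable.comp (by fun_prop : Measurable fun y : Space ↦ y m)).pow_const 2)
  have hRm : ∀ k : Fin 3, Measurable fun y : Space ↦ A.indicator (1 : ℝ → ℝ≥0∞) (y k) *
      ∏ m ∈ Finset.univ.erase k, ENNReal.ofReal (q (y m) ^ 2) := fun k ↦
    ((measurable_one.indicator hAm).comp (by fun_prop : Measurable fun y : Space ↦ y k)).mul
      (Finset.measurable_prod _ fun m _ ↦ ENNReal.measurable_ofReal.comp
        ((hq.continuous.measurable.comp (by fun_prop : Measurable fun y : Space ↦ y m)).pow_const 2))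
  have hwm : ∀ (i : Fin N) (k : Fin 3) (j : Fin N), Measurable (Function.update
      (fun _ : Fin N ↦ fun y : Space ↦ ∏ m : Fin 3, ENNReal.ofReal (q (y m) ^ 2)) i
      (fun y : Space ↦ A.indicator (1 : ℝ → ℝ≥0∞) (y k) *
        ∏ m ∈ Finset.univ.erase k, ENNReal.ofReal (q (y m) ^ 2)) j) := by
    intro i k j
    by_cases hj : j = i
    · subst hj; rw [Function.update_self]; exact hRm k
    · rw [Function.update_of_ne hj]; exact hWm
  have hmeasA : ∀ i k, Measurable fun X : Config N ↦ G₁ i k (X + U) * ∏ j : Fin N, ∏ m : Fin 3, ENNReal.ofReal (q (X j m) ^ 2) :=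
    fun i k ↦ ((hG₁m i k).comp (measurable_id.add_const U)).mul
      (Finset.measurable_prod _ fun j _ ↦ hWm.comp (measurable_config_apply j))
  have hmeasB : ∀ i k, Measurable fun X : Config N ↦ (ENNReal.ofReal η * G₁ i k (X + U) + (1 + ENNReal.ofReal η⁻¹) * ENNReal.ofReal (D ^ 2) * G₂ (X + U)) *
      ∏ j : Fin N, (Function.update (fun _ : Fin N ↦ fun y : Space ↦ ∏ m : Fin 3, ENNReal.ofReal (q (y m) ^ 2)) i
        (fun y : Space ↦ A.indicator (1 : ℝ → ℝ≥0∞) (y k) *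
          ∏ m ∈ Finset.univ.erase k, ENNReal.ofReal (q (y m) ^ 2)) j) (X j) :=
    fun i k ↦ ((((hG₁m i k).comp (measurable_id.add_const U)).const_mul _).add
      ((hG₂m.comp (measurable_id.add_const U)).const_mul _)).mul
        (Finset.measurable_prod _ fun j _ ↦ (hwm i k j).comp (measurable_config_apply j))
  have hmeasAB : ∀ i k, Measurable fun X : Config N ↦
      G₁ i k (X + U) * ∏ j : Fin N, ∏ m : Fin 3, ENNReal.ofReal (q (X j m) ^ 2) +
        (ENNReal.ofReal η * G₁ i k (X + U) + (1 + ENNReal.ofReal η⁻¹) * ENNReal.ofReal (D ^ 2) * G₂ (X + U)) *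
          ∏ j : Fin N, (Function.update (fun _ : Fin N ↦ fun y : Space ↦ ∏ m : Fin 3, ENNReal.ofReal (q (y m) ^ 2)) i
            (fun y : Space ↦ A.indicator (1 : ℝ → ℝ≥0∞) (y k) *
              ∏ m ∈ Finset.univ.erase k, ENNReal.ofReal (q (y m) ^ 2)) j) (X j) :=
    fun i k ↦ (hmeasA i k).add (hmeasB i k)
  have hmeasS : ∀ i, Measurable fun X : Config N ↦ ∑ k : Fin 3,
      (G₁ i k (X + U) * ∏ j : Fin N, ∏ m : Fin 3, ENNReal.ofReal (q (X j m) ^ 2) +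
        (ENNReal.ofReal η * G₁ i k (X + U) + (1 + ENNReal.ofReal η⁻¹) * ENNReal.ofReal (D ^ 2) * G₂ (X + U)) *
          ∏ j : Fin N, (Function.update (fun _ : Fin N ↦ fun y : Space ↦ ∏ m : Fin 3, ENNReal.ofReal (q (y m) ^ 2)) i
            (fun y : Space ↦ A.indicator (1 : ℝ → ℝ≥0∞) (y k) *
              ∏ m ∈ Finset.univ.erase k, ENNReal.ofReal (q (y m) ^ 2)) j) (X j)) :=
    fun i ↦ Finset.measurable_sum _ fun k _ ↦ hmeasAB i k
  -- unfold each term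
  have hA' : ∀ i k, ∫⁻ X, G₁ i k (X + U) * ∏ j : Fin N, ∏ m : Fin 3, ENNReal.ofReal (q (X j m) ^ 2) =
      ∫⁻ X in cellN N L, G₁ i k X := fun i k ↦
    lintegral_comp_add_mul_prodWeight hL hq.continuous hpu (hG₁m i k) (hG₁per i k) U
  have hB' : ∀ i k, ∫⁻ X, (ENNReal.ofReal η * G₁ i k (X + U) + (1 + ENNReal.ofReal η⁻¹) * ENNReal.ofReal (D ^ 2) * G₂ (X + U)) *
      ∏ j : Fin N, (Function.update (fun _ : Fin N ↦ fun y : Space ↦ ∏ m : Fin 3, ENNReal.ofReal (q (y m) ^ 2)) i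
        (fun y : Space ↦ A.indicator (1 : ℝ → ℝ≥0∞) (y k) *
          ∏ m ∈ Finset.univ.erase k, ENNReal.ofReal (q (y m) ^ 2)) j) (X j) =
      ∫⁻ X in cellN N L, (ENNReal.ofReal η * G₁ i k X + (1 + ENNReal.ofReal η⁻¹) * ENNReal.ofReal (D ^ 2) * G₂ X) *
        ∑' n : ℤ, A.indicator (1 : ℝ → ℝ≥0∞) (X i k - u k - L * n) := by
    intro i k
    exact lintegral_comp_add_mul_rampWeight hL hq.continuous hpu hAm
      (G := fun X ↦ ENNReal.ofReal η * G₁ i k X + (1 + ENNReal.ofReal η⁻¹) * ENNReal.ofReal (D ^ 2) * G₂ X)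
      (((hG₁m i k).const_mul _).add (hG₂m.const_mul _)) (fun X i' k' ↦ by rw [hG₁per, hG₂per]) u i k
  have hkin : ∑ i : Fin N, ∑ k : Fin 3, ∫⁻ X in cellN N L, G₁ i k X = ∫⁻ X in cellN N L, kineticDensity Ψ.ψ X := by
    have h1 : ∀ i : Fin N, ∑ k : Fin 3, ∫⁻ X in cellN N L, G₁ i k X = ∫⁻ X in cellN N L, ∑ k : Fin 3, G₁ i k X :=
      fun i ↦ (lintegral_finsetSum _ fun k _ ↦ hG₁m i k).symm
    simp only [h1]
    rw [← lintegral_finsetSum _ fun i _ ↦ Finset.measurable_sum _ fun k _ ↦ hG₁m i k]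
    simp only [hG₁, kineticDensity]
  calc ∫⁻ X, ∑ i : Fin N, ∑ k : Fin 3,
        (G₁ i k (X + U) * ∏ j : Fin N, ∏ m : Fin 3, ENNReal.ofReal (q (X j m) ^ 2) +
          (ENNReal.ofReal η * G₁ i k (X + U) + (1 + ENNReal.ofReal η⁻¹) * ENNReal.ofReal (D ^ 2) * G₂ (X + U)) *
            ∏ j : Fin N, (Function.update (fun _ : Fin N ↦ fun y : Space ↦ ∏ m : Fin 3, ENNReal.ofReal (q (y m) ^ 2)) i
              (fun y : Space ↦ A.indicator (1 : ℝ → ℝ≥0∞) (y k) *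
                ∏ m ∈ Finset.univ.erase k, ENNReal.ofReal (q (y m) ^ 2)) j) (X j))
      = ∑ i : Fin N, ∑ k : Fin 3, ((∫⁻ X in cellN N L, G₁ i k X) +
          ∫⁻ X in cellN N L, (ENNReal.ofReal η * G₁ i k X + (1 + ENNReal.ofReal η⁻¹) * ENNReal.ofReal (D ^ 2) * G₂ X) *
            ∑' n : ℤ, A.indicator (1 : ℝ → ℝ≥0∞) (X i k - u k - L * n)) := by
        rw [lintegral_finsetSum _ fun i _ ↦ hmeasS i]
        refine Finset.sum_congr rfl fun i _ ↦ ?_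
        rw [lintegral_finsetSum _ fun k _ ↦ hmeasAB i k]
        refine Finset.sum_congr rfl fun k _ ↦ ?_
        rw [lintegral_add_left (hmeasA i k), hA', hB']
    _ = (∫⁻ X in cellN N L, kineticDensity Ψ.ψ X) +
        ∑ i : Fin N, ∑ k : Fin 3, ∫⁻ X in cellN N L,
          (ENNReal.ofReal η * ((‖fderiv ℝ Ψ.ψ X (Pi.single i (EuclideanSpace.single k (1 : ℝ)))‖₊ : ℝ≥0∞)) ^ 2 +
              (1 + ENNReal.ofReal η⁻¹) * ENNReal.ofReal (D ^ 2) * ((‖Ψ.ψ X‖₊ : ℝ≥0∞)) ^ 2) *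
            ∑' n : ℤ, A.indicator (1 : ℝ → ℝ≥0∞) (X i k - u k - L * n) := by
        simp only [Finset.sum_add_distrib]
        rw [hkin]

/-- **Energy of the cut-off state for a fixed shift `u` (Young parameter `η`).**
`𝓔^D[Φ_u] ≤ 𝓔^per[Ψ] + ∑_{i,k} ∫_{cell} (η|∂_{ik}ψ|² + (1+η⁻¹)D²|ψ|²)(X) ρ_A(x_{ik} - u_k) dX`. [folklore] -/
theorem energyIntegral_cutoffState_le_eta (hL : 0 < L) (hvm : Measurable v) (hq : ContDiff ℝ 1 q)
    (hq01 : ∀ t, 0 ≤ q t ∧ q t ≤ 1) (hpu : ∀ t, ∑' m : ℤ, ENNReal.ofReal (q (t - L * m) ^ 2) = 1)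
    {D : ℝ} (hD : ∀ t, |deriv q t| ≤ D) {A : Set ℝ} (hAm : MeasurableSet A) (hA : ∀ t, deriv q t ≠ 0 → t ∈ A)
    {η : ℝ} (hη : 0 < η) (Ψ : PeriodicTrialState N L) (u : Space) :
    ∫⁻ X, kineticDensity (fun X : Config N ↦ Ψ.ψ (X + fun _ ↦ u) * ((∏ p : Fin N × Fin 3, q (X p.1 p.2) : ℝ) : ℂ)) X +
        interaction v X * ((‖Ψ.ψ (X + fun _ ↦ u) * ((∏ p : Fin N × Fin 3, q (X p.1 p.2) : ℝ) : ℂ)‖₊ : ℝ≥0∞)) ^ 2 ≤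
      periodicEnergy v Ψ +
        ∑ i : Fin N, ∑ k : Fin 3, ∫⁻ X in cellN N L,
          (ENNReal.ofReal η * ((‖fderiv ℝ Ψ.ψ X (Pi.single i (EuclideanSpace.single k (1 : ℝ)))‖₊ : ℝ≥0∞)) ^ 2 +
              (1 + ENNReal.ofReal η⁻¹) * ENNReal.ofReal (D ^ 2) * ((‖Ψ.ψ X‖₊ : ℝ≥0∞)) ^ 2) *
            ∑' n : ℤ, A.indicator (1 : ℝ → ℝ≥0∞) (X i k - u k - L * n) := by
  have hΦ := contDiff_cutoffState hq Ψ.contDiff (fun _ ↦ u)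
  rw [lintegral_add_left (measurable_kineticDensity hΦ), periodicEnergy,
    lintegral_add_left (measurable_kineticDensity Ψ.contDiff), add_right_comm]
  exact add_le_add (lintegral_kineticDensity_cutoffState_le_eta hL hq hq01 hpu hD hAm hA hη Ψ u)
    (lintegral_interaction_cutoffState_le hL hvm hq.continuous (fun t ↦ (hq01 t).1) hpu Ψ u)


/-- **Localisation of periodic states into a Dirichlet box, with a Young parameter `η > 0` (Lemma A.1
of [BastiCenatiempoSchlein2021, App. A], smooth cut-off form, second-order-ready).** There is a universal
constant `C` such that for all `N`, `ℓ > 0`, `M ≥ 1`, `η > 0` and all measurable `v ≥ 0`, with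
`L = 2ℓM`, `E₀^D(N, L + 2ℓ) ≤ (1 + 4η/M) E₀^per(N, L) + C (1 + η⁻¹) N/(M ℓ²)`; with `η` small the
kinetic excess is negligible against the Lee–Huang–Yang term while the cut-off cost stays
`O(N/(ηMℓ²))` (for `η = 1` this is `exists_dirichlet_le_periodic`).
Proof: for a periodic trial state `Ψ` and a shift `u`, the Dirichlet function
`Φ_u(X) = ψ(X + u) ∏_{i,k} q(x_{ik})` (with the cut-off `q` of `exists_smooth_cutoff`) is normalised
and lives in `Λ_{L+2ℓ}^N`; its energy is `𝓔^per[Ψ]` plus ramp terms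
(`energyIntegral_cutoffState_le`), whose sum over the `M³` shifts `u ∈ (2ℓ{0,…,M-1})³` is at most
`4M²(T + 6ND²)`, `D = c/ℓ` (`sum_tsum_indicator_ramps_shift_le`); the best shift gives the claim
(the paper averages over all `u ∈ Λ_L` and integrates the cross term by parts instead, obtaining
`⟨Ψ, 𝓗Ψ⟩ + (C/(Lℓ))⟨Ψ, 𝒩Ψ⟩` without the factor `1 + 4/M` — (A.1)–(A.5)).
[cite: BastiCenatiempoSchlein2021, App. A, Lemma A.1 with (A.1)–(A.5)] -/
theorem exists_dirichlet_le_periodic_eta : ∃ C : ℝ, 0 ≤ C ∧ ∀ (N : ℕ) (ℓ : ℝ) (M : ℕ) (v : ℝ → ℝ≥0∞) (η : ℝ),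
    0 < ℓ → 0 < M → Measurable v → 0 < η →
    groundStateEnergy v N (2 * ℓ * M + 2 * ℓ) ≤
      (1 + 4 * ENNReal.ofReal η / (M : ℝ≥0∞)) * periodicGroundStateEnergy v N (2 * ℓ * M) +
        ENNReal.ofReal (C * (1 + η⁻¹) * N / (M * ℓ ^ 2)) := by
  classical
  obtain ⟨c, hc0, hcut⟩ := exists_smooth_cutoff
  refine ⟨12 * c ^ 2, by positivity, fun N ℓ M v η hℓ hM hvm hη ↦ ?_⟩
  set L : ℝ := 2 * ℓ * M with hLdef
  have hM1 : (1 : ℝ) ≤ M := by exact_mod_cast hM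
  have hℓL : 2 * ℓ ≤ L := by rw [hLdef]; nlinarith
  have hL : 0 < L := by linarith
  obtain ⟨q, hq, hq01, hsupp, hpu, hD, hA⟩ := hcut ℓ L hℓ hℓL
  set A : Set ℝ := Set.Icc 0 (2 * ℓ) ∪ Set.Icc L (L + 2 * ℓ) with hAdef
  have hAm : MeasurableSet A := measurableSet_Icc.union measurableSet_Icc
  set D : ℝ := c / ℓ with hDdef
  -- constants in `ℝ≥0∞`
  have hM0 : (M : ℝ≥0∞) ≠ 0 := Nat.cast_ne_zero.2 hM.ne'
  have hMtop : (M : ℝ≥0∞) ≠ ⊤ := ENNReal.natCast_ne_top M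
  set K : ℝ≥0∞ := ENNReal.ofReal (12 * c ^ 2 * (1 + η⁻¹) * N / (M * ℓ ^ 2)) with hKdef
  have hη' : (0 : ℝ) ≤ 1 + η⁻¹ := by positivity
  have hθ : (1 + ENNReal.ofReal η⁻¹) = ENNReal.ofReal (1 + η⁻¹) := by
    rw [ENNReal.ofReal_add zero_le_one (inv_nonneg.2 hη.le), ENNReal.ofReal_one]
  have hK : 12 * (N : ℝ≥0∞) * ((1 + ENNReal.ofReal η⁻¹) * ENNReal.ofReal (D ^ 2)) * (M : ℝ≥0∞)⁻¹ = K := by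
    rw [hKdef, hDdef, hθ, ← ENNReal.ofReal_natCast N, ← ENNReal.ofReal_natCast M,
      ← ENNReal.ofReal_inv_of_pos (by exact_mod_cast hM : (0 : ℝ) < M), ← ENNReal.ofReal_ofNat 12,
      ← ENNReal.ofReal_mul (by norm_num), ← ENNReal.ofReal_mul hη', ← ENNReal.ofReal_mul (by positivity),
      ← ENNReal.ofReal_mul (by positivity)]
    congr 1
    field_simp
  -- the bound for every periodic trial state
  suffices key : ∀ Ψ : PeriodicTrialState N L,
      groundStateEnergy v N (L + 2 * ℓ) ≤ (1 + 4 * ENNReal.ofReal η / (M : ℝ≥0∞)) * periodicEnergy v Ψ + K by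
    have h14 : (1 + 4 * ENNReal.ofReal η / (M : ℝ≥0∞)) ≠ 0 := by simp
    have h14' : (1 + 4 * ENNReal.ofReal η / (M : ℝ≥0∞)) ≠ ⊤ := by
      rw [ENNReal.add_ne_top]
      exact ⟨ENNReal.one_ne_top, ENNReal.div_ne_top (ENNReal.mul_ne_top (by simp) ENNReal.ofReal_ne_top) hM0⟩
    show groundStateEnergy v N (L + 2 * ℓ) ≤ (1 + 4 * ENNReal.ofReal η / (M : ℝ≥0∞)) * periodicGroundStateEnergy v N L + K
    rw [periodicGroundStateEnergy, ENNReal.mul_iInf_of_ne h14 h14', ENNReal.iInf_add]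
    exact le_iInf key
  intro Ψ
  -- the shifts and their error terms
  set u : (Fin 3 → Fin M) → Space := fun a ↦ latticeVec (2 * ℓ) fun m ↦ ((a m : ℕ) : ℤ) with hudef
  have hu : ∀ a k, u a k = 2 * ℓ * ((a k : ℕ) : ℝ) := fun a k ↦ by
    rw [hudef]; simp only [latticeVec_apply, Int.cast_natCast]
  set f : Fin N → Fin 3 → Config N → ℝ≥0∞ := fun i k X ↦
    ENNReal.ofReal η * ((‖fderiv ℝ Ψ.ψ X (Pi.single i (EuclideanSpace.single k (1 : ℝ)))‖₊ : ℝ≥0∞)) ^ 2 +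
      (1 + ENNReal.ofReal η⁻¹) * ENNReal.ofReal (D ^ 2) * ((‖Ψ.ψ X‖₊ : ℝ≥0∞)) ^ 2 with hfdef
  set ρ : (Fin 3 → Fin M) → Fin N → Fin 3 → Config N → ℝ≥0∞ := fun a i k X ↦
    ∑' n : ℤ, A.indicator (1 : ℝ → ℝ≥0∞) (X i k - u a k - L * n) with hρdef
  set Err : (Fin 3 → Fin M) → ℝ≥0∞ := fun a ↦ ∑ i : Fin N, ∑ k : Fin 3, ∫⁻ X in cellN N L, f i k X * ρ a i k X with hErr
  have hfm : ∀ i k, Measurable (f i k) := fun i k ↦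
    ((((Ψ.contDiff.continuous_fderiv one_ne_zero).clm_apply continuous_const).measurable.nnnorm.coe_nnreal_ennreal.pow_const _).const_mul _).add
      ((measurable_normSq Ψ.contDiff.continuous).const_mul _)
  have hρm : ∀ a i k, Measurable (ρ a i k) := fun a i k ↦
    Measurable.tsum fun n ↦ (measurable_one.indicator hAm).comp
      ((((by fun_prop : Measurable fun y : Space ↦ y k)).comp (measurable_config_apply i)).sub_const _ |>.sub_const _)
  -- Step 1: energy of each cut-off state
  have hstep1 : ∀ a, ∫⁻ X, kineticDensity (fun X : Config N ↦ Ψ.ψ (X + fun _ ↦ u a) *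
        ((∏ p : Fin N × Fin 3, q (X p.1 p.2) : ℝ) : ℂ)) X +
      interaction v X * ((‖Ψ.ψ (X + fun _ ↦ u a) * ((∏ p : Fin N × Fin 3, q (X p.1 p.2) : ℝ) : ℂ)‖₊ : ℝ≥0∞)) ^ 2 ≤
      periodicEnergy v Ψ + Err a := fun a ↦
    energyIntegral_cutoffState_le_eta hL hvm hq hq01 hpu hD hAm hA hη Ψ (u a)
  -- Step 2: the sum of the error terms over the shifts
  have hT : ∑ i : Fin N, ∑ k : Fin 3, ∫⁻ X in cellN N L, f i k X =
      ENNReal.ofReal η * (∫⁻ X in cellN N L, kineticDensity Ψ.ψ X) +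
        3 * N * ((1 + ENNReal.ofReal η⁻¹) * ENNReal.ofReal (D ^ 2)) := by
    have h1 : ∀ i k, ∫⁻ X in cellN N L, f i k X =
        ENNReal.ofReal η * (∫⁻ X in cellN N L, ((‖fderiv ℝ Ψ.ψ X (Pi.single i (EuclideanSpace.single k (1 : ℝ)))‖₊ : ℝ≥0∞)) ^ 2) +
          (1 + ENNReal.ofReal η⁻¹) * ENNReal.ofReal (D ^ 2) := by
      intro i k
      rw [hfdef]
      simp only []
      rw [lintegral_add_left (((((Ψ.contDiff.continuous_fderiv one_ne_zero).clm_apply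
          continuous_const).measurable.nnnorm.coe_nnreal_ennreal.pow_const _)).const_mul _),
        lintegral_const_mul _ (((Ψ.contDiff.continuous_fderiv one_ne_zero).clm_apply
          continuous_const).measurable.nnnorm.coe_nnreal_ennreal.pow_const _),
        lintegral_const_mul _ (measurable_normSq Ψ.contDiff.continuous), Ψ.norm_eq, mul_one]
    simp only [h1, Finset.sum_add_distrib, Finset.sum_const, Finset.card_univ, Fintype.card_fin, nsmul_eq_mul,
      ← Finset.mul_sum]
    congr 1
    · congr 1
      have h2 : ∀ i : Fin N, ∑ k : Fin 3, ∫⁻ X in cellN N L,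
          ((‖fderiv ℝ Ψ.ψ X (Pi.single i (EuclideanSpace.single k (1 : ℝ)))‖₊ : ℝ≥0∞)) ^ 2 =
          ∫⁻ X in cellN N L, ∑ k : Fin 3, ((‖fderiv ℝ Ψ.ψ X (Pi.single i (EuclideanSpace.single k (1 : ℝ)))‖₊ : ℝ≥0∞)) ^ 2 :=
        fun i ↦ (lintegral_finsetSum _ fun k _ ↦ ((Ψ.contDiff.continuous_fderiv one_ne_zero).clm_apply
          continuous_const).measurable.nnnorm.coe_nnreal_ennreal.pow_const _).symm
      simp only [h2]
      rw [← lintegral_finsetSum _ fun i _ ↦ Finset.measurable_sum _ fun k _ ↦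
        ((Ψ.contDiff.continuous_fderiv one_ne_zero).clm_apply continuous_const).measurable.nnnorm.coe_nnreal_ennreal.pow_const _]
      rfl
    · push_cast; ring
  have hstep2 : ∑ a : Fin 3 → Fin M, Err a ≤
      4 * (M : ℝ≥0∞) ^ 2 * (ENNReal.ofReal η * (∫⁻ X in cellN N L, kineticDensity Ψ.ψ X) +
        3 * N * ((1 + ENNReal.ofReal η⁻¹) * ENNReal.ofReal (D ^ 2))) := by
    rw [← hT, Finset.mul_sum]
    simp only [hErr]
    rw [Finset.sum_comm]
    refine Finset.sum_le_sum fun i _ ↦ ?_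
    rw [Finset.mul_sum, Finset.sum_comm]
    refine Finset.sum_le_sum fun k _ ↦ ?_
    have hm : ∀ a : Fin 3 → Fin M, Measurable fun X ↦ f i k X * ρ a i k X := fun a ↦ (hfm i k).mul (hρm a i k)
    rw [← lintegral_finsetSum _ fun a _ ↦ hm a]
    calc ∫⁻ X in cellN N L, ∑ a : Fin 3 → Fin M, f i k X * ρ a i k X
        = ∫⁻ X in cellN N L, f i k X * ∑ a : Fin 3 → Fin M, ρ a i k X := by
          refine lintegral_congr fun X ↦ ?_; rw [Finset.mul_sum]
      _ ≤ ∫⁻ X in cellN N L, f i k X * (4 * (M : ℝ≥0∞) ^ 2) := by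
          refine lintegral_mono fun X ↦ ?_
          gcongr
          have h := sum_tsum_indicator_ramps_shift_le hℓ hM hLdef k (X i k)
          simp only [hρdef, hu]
          exact h
      _ = 4 * (M : ℝ≥0∞) ^ 2 * ∫⁻ X in cellN N L, f i k X := by
          rw [lintegral_mul_const _ (hfm i k), mul_comm]
  -- Step 3: the best shift
  haveI : Nonempty (Fin M) := ⟨⟨0, hM⟩⟩
  obtain ⟨a₀, -, ha₀⟩ := Finset.exists_min_image Finset.univ Err Finset.univ_nonempty
  have hcard : (Fintype.card (Fin 3 → Fin M) : ℝ≥0∞) = (M : ℝ≥0∞) ^ 3 := by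
    rw [Fintype.card_fun, Fintype.card_fin, Fintype.card_fin]; push_cast; ring
  have hstep3 : (M : ℝ≥0∞) ^ 3 * Err a₀ ≤
      4 * (M : ℝ≥0∞) ^ 2 * (ENNReal.ofReal η * (∫⁻ X in cellN N L, kineticDensity Ψ.ψ X) +
        3 * N * ((1 + ENNReal.ofReal η⁻¹) * ENNReal.ofReal (D ^ 2))) := by
    refine le_trans ?_ hstep2
    rw [← hcard, ← nsmul_eq_mul, ← Finset.card_univ]
    exact Finset.card_nsmul_le_sum _ _ _ fun a _ ↦ ha₀ a (Finset.mem_univ a)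
  have hErr : Err a₀ ≤ (M : ℝ≥0∞)⁻¹ * (4 * (ENNReal.ofReal η * (∫⁻ X in cellN N L, kineticDensity Ψ.ψ X) +
      3 * N * ((1 + ENNReal.ofReal η⁻¹) * ENNReal.ofReal (D ^ 2)))) := by
    have hM2 : ((M : ℝ≥0∞) ^ 2) ≠ 0 := pow_ne_zero _ hM0
    have hM2' : ((M : ℝ≥0∞) ^ 2) ≠ ⊤ := ENNReal.pow_ne_top hMtop
    have hM3 : ((M : ℝ≥0∞) ^ 3) ≠ 0 := pow_ne_zero _ hM0
    have hM3' : ((M : ℝ≥0∞) ^ 3) ≠ ⊤ := ENNReal.pow_ne_top hMtop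
    have h1 : Err a₀ = ((M : ℝ≥0∞) ^ 3)⁻¹ * ((M : ℝ≥0∞) ^ 3 * Err a₀) := by
      rw [← mul_assoc, ENNReal.inv_mul_cancel hM3 hM3', one_mul]
    rw [h1]
    refine (mul_le_mul_right hstep3 _).trans (le_of_eq ?_)
    rw [pow_succ, ENNReal.mul_inv (Or.inl hM2) (Or.inl hM2')]
    calc ((M : ℝ≥0∞) ^ 2)⁻¹ * (M : ℝ≥0∞)⁻¹ *
          (4 * (M : ℝ≥0∞) ^ 2 * (ENNReal.ofReal η * (∫⁻ X in cellN N L, kineticDensity Ψ.ψ X) +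
            3 * N * ((1 + ENNReal.ofReal η⁻¹) * ENNReal.ofReal (D ^ 2))))
        = (M : ℝ≥0∞)⁻¹ * (4 * (ENNReal.ofReal η * (∫⁻ X in cellN N L, kineticDensity Ψ.ψ X) +
            3 * N * ((1 + ENNReal.ofReal η⁻¹) * ENNReal.ofReal (D ^ 2)))) *
            (((M : ℝ≥0∞) ^ 2)⁻¹ * (M : ℝ≥0∞) ^ 2) := by ring
      _ = _ := by rw [ENNReal.inv_mul_cancel hM2 hM2', mul_one]
  -- Step 4: the Dirichlet state of the best shift
  have hΦ := contDiff_cutoffState hq Ψ.contDiff (fun _ ↦ u a₀)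
  have hΦs : ∀ X, Ψ.ψ (X + fun _ ↦ u a₀) * ((∏ p : Fin N × Fin 3, q (X p.1 p.2) : ℝ) : ℂ) ≠ 0 →
      ∀ i, X i ∈ box (L + 2 * ℓ) := fun X hX i ↦ mem_box_of_cutoffState_ne_zero hsupp Ψ.ψ _ X hX i
  have hΦp : ∀ (π : Equiv.Perm (Fin N)) (X : Config N),
      Ψ.ψ ((X ∘ π) + fun _ ↦ u a₀) * ((∏ p : Fin N × Fin 3, q ((X ∘ π) p.1 p.2) : ℝ) : ℂ) =
        Ψ.ψ (X + fun _ ↦ u a₀) * ((∏ p : Fin N × Fin 3, q (X p.1 p.2) : ℝ) : ℂ) :=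
    fun π X ↦ cutoffState_comp_perm Ψ.symm (u a₀) π X
  have hΦn := lintegral_ennnorm_cutoffState_sq hL hq.continuous (fun t ↦ (hq01 t).1) hpu Ψ (u a₀)
  have hE := groundStateEnergy_le_of_raw v hΦ hΦs hΦp hΦn
  -- Step 5: conclude
  have hTle : (∫⁻ X in cellN N L, kineticDensity Ψ.ψ X) ≤ periodicEnergy v Ψ := by
    rw [periodicEnergy, lintegral_add_left (measurable_kineticDensity Ψ.contDiff)]
    exact le_self_add
  calc groundStateEnergy v N (L + 2 * ℓ) ≤ _ := hE
    _ ≤ periodicEnergy v Ψ + Err a₀ := hstep1 a₀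
    _ ≤ periodicEnergy v Ψ + (M : ℝ≥0∞)⁻¹ * (4 * (ENNReal.ofReal η * (∫⁻ X in cellN N L, kineticDensity Ψ.ψ X) +
        3 * N * ((1 + ENNReal.ofReal η⁻¹) * ENNReal.ofReal (D ^ 2)))) := add_le_add_right hErr _
    _ ≤ periodicEnergy v Ψ + (M : ℝ≥0∞)⁻¹ * (4 * (ENNReal.ofReal η * periodicEnergy v Ψ +
        3 * N * ((1 + ENNReal.ofReal η⁻¹) * ENNReal.ofReal (D ^ 2)))) := by
        gcongr
    _ = (1 + 4 * ENNReal.ofReal η / (M : ℝ≥0∞)) * periodicEnergy v Ψ +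
        12 * (N : ℝ≥0∞) * ((1 + ENNReal.ofReal η⁻¹) * ENNReal.ofReal (D ^ 2)) * (M : ℝ≥0∞)⁻¹ := by
        rw [ENNReal.div_eq_inv_mul]; ring
    _ = (1 + 4 * ENNReal.ofReal η / (M : ℝ≥0∞)) * periodicEnergy v Ψ + K := by rw [hK]

end Eta

/-! ## Assembly: Theorem 1.1 from periodic Lee–Huang–Yang blocks

[BastiCenatiempoSchlein2021, §1, "Proof of Theorem 1.1"] (arXiv p. 5): Prop. 1.2 (localisation +
replication, App. A) turns a torus bound at density `ρ̃` on the box `L = ρ̃^{-γ}` into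
`e(ρ) ≤ 4π𝔞ρ̃²(1 + (128/(15√π))√(ρ̃𝔞³)) + Cρ̃^{5/2}ρ̃^{α} + Cρ̃²ρ̃^{2γ-2} + …`, and the choices
`ρ̃ = ρ(1 + Cρ^{α})`-type density shift (1.8), `α = 3/5`, `γ = 11/10` make every error
`O(ρ^{5/2+1/10})`. Here the same bookkeeping is carried out for the tree's objects, with the
canonical periodic input as a hypothesis. -/
section Assembly

/-! ### Bookkeeping for the proof of Theorem 1.1 from periodic Lee–Huang–Yang blocks -/

/-- `ρ² ρ^{3/5} = ρ^{5/2 + 1/10}`. [folklore] -/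
theorem sq_mul_rpow_three_fifths {ρ : ℝ} (hρ : 0 < ρ) : ρ ^ 2 * ρ ^ ((3 : ℝ) / 5) = ρ ^ ((5 : ℝ) / 2 + 1 / 10) := by
  rw [← Real.rpow_natCast, ← Real.rpow_add hρ]; norm_num

/-- `ρ · ρ^{8/5} = ρ^{5/2+1/10}`. [folklore] -/
theorem mul_rpow_eight_fifths {ρ : ℝ} (hρ : 0 < ρ) : ρ * ρ ^ ((8 : ℝ) / 5) = ρ ^ ((5 : ℝ) / 2 + 1 / 10) := by
  conv_lhs => rw [← Real.rpow_one ρ]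
  rw [← Real.rpow_mul hρ.le, ← Real.rpow_add hρ]; norm_num

/-- **The main term at the adjusted density.** With `x = ρ^{3/5} ≤ 1/8`, `ρ ≤ 1` and `ρ̃ = ρ(1 + 8x)`:
`(ρ/ρ̃)(4πaρ̃²(1 + c₀√(ρ̃a³)) + Kρ̃^{13/5}) ≤ 4πρ²a(1 + c₀√(ρa³)) + (32πa(1 + 2c₀√(a³)) + 4K)ρ^{13/5}`
(the density shift of [BastiCenatiempoSchlein2021, (1.8)] costs `O(ρ^{2+3/5})`). [cite: BastiCenatiempoSchlein2021, Proof of Thm. 1.1, (1.6)–(1.8)] -/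
theorem lhy_mainTerm_adjusted_le {a c₀ K ρ : ℝ} (ha : 0 ≤ a) (hc₀ : 0 ≤ c₀) (hK : 0 ≤ K) (hρ : 0 < ρ)
    (hρ1 : ρ ≤ 1) (hx : ρ ^ ((3 : ℝ) / 5) ≤ 1 / 8) :
    (ρ / (ρ * (1 + 8 * ρ ^ ((3 : ℝ) / 5)))) *
        (4 * Real.pi * a * (ρ * (1 + 8 * ρ ^ ((3 : ℝ) / 5))) ^ 2 *
            (1 + c₀ * Real.sqrt (ρ * (1 + 8 * ρ ^ ((3 : ℝ) / 5)) * a ^ 3)) +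
          K * (ρ * (1 + 8 * ρ ^ ((3 : ℝ) / 5))) ^ ((5 : ℝ) / 2 + 1 / 10)) ≤
      4 * Real.pi * ρ ^ 2 * a * (1 + c₀ * Real.sqrt (ρ * a ^ 3)) +
        (32 * Real.pi * a * (1 + 2 * c₀ * Real.sqrt (a ^ 3)) + 4 * K) * ρ ^ ((5 : ℝ) / 2 + 1 / 10) := by
  set x : ℝ := ρ ^ ((3 : ℝ) / 5) with hxdef
  have hx0 : 0 < x := Real.rpow_pos_of_pos hρ _
  have h18 : 0 < 1 + 8 * x := by positivity
  set s : ℝ := Real.sqrt (ρ * a ^ 3) with hs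
  have hs0 : 0 ≤ s := Real.sqrt_nonneg _
  have hs1 : s ≤ Real.sqrt (a ^ 3) := by
    rw [hs]; exact Real.sqrt_le_sqrt (by nlinarith [pow_nonneg ha 3])
  -- `√(ρ̃a³) ≤ s(1 + 4x)`
  have hsqrt : Real.sqrt (ρ * (1 + 8 * x) * a ^ 3) ≤ s * (1 + 4 * x) := by
    rw [show ρ * (1 + 8 * x) * a ^ 3 = (1 + 8 * x) * (ρ * a ^ 3) by ring, Real.sqrt_mul h18.le, ← hs, mul_comm]
    gcongr
    rw [Real.sqrt_le_left (by positivity)]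
    nlinarith
  -- the density prefactor
  have hpre : ρ / (ρ * (1 + 8 * x)) = 1 / (1 + 8 * x) := by
    field_simp
  rw [hpre]
  -- first summand
  have h1 : 1 / (1 + 8 * x) * (4 * Real.pi * a * (ρ * (1 + 8 * x)) ^ 2 * (1 + c₀ * Real.sqrt (ρ * (1 + 8 * x) * a ^ 3))) ≤
      4 * Real.pi * ρ ^ 2 * a * (1 + c₀ * s) + 32 * Real.pi * a * (1 + 2 * c₀ * Real.sqrt (a ^ 3)) * (ρ ^ 2 * x) := by
    have hA : 1 / (1 + 8 * x) * (4 * Real.pi * a * (ρ * (1 + 8 * x)) ^ 2 * (1 + c₀ * Real.sqrt (ρ * (1 + 8 * x) * a ^ 3))) =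
        4 * Real.pi * a * ρ ^ 2 * (1 + 8 * x) * (1 + c₀ * Real.sqrt (ρ * (1 + 8 * x) * a ^ 3)) := by
      field_simp
    rw [hA]
    calc 4 * Real.pi * a * ρ ^ 2 * (1 + 8 * x) * (1 + c₀ * Real.sqrt (ρ * (1 + 8 * x) * a ^ 3))
        ≤ 4 * Real.pi * a * ρ ^ 2 * (1 + 8 * x) * (1 + c₀ * (s * (1 + 4 * x))) := by gcongr
      _ = 4 * Real.pi * ρ ^ 2 * a * (1 + c₀ * s) + 4 * Real.pi * a * (ρ ^ 2 * x) * (8 + c₀ * s * (12 + 32 * x)) := by ring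
      _ ≤ 4 * Real.pi * ρ ^ 2 * a * (1 + c₀ * s) + 4 * Real.pi * a * (ρ ^ 2 * x) * (8 + c₀ * Real.sqrt (a ^ 3) * 16) := by
          gcongr
          · nlinarith
      _ = _ := by ring
  -- second summand
  have h2 : 1 / (1 + 8 * x) * (K * (ρ * (1 + 8 * x)) ^ ((5 : ℝ) / 2 + 1 / 10)) ≤ 4 * K * ρ ^ ((5 : ℝ) / 2 + 1 / 10) := by
    have hsplit : (ρ * (1 + 8 * x)) ^ ((5 : ℝ) / 2 + 1 / 10) = (ρ * (1 + 8 * x)) * (ρ * (1 + 8 * x)) ^ ((8 : ℝ) / 5) := by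
      rw [show ((5 : ℝ) / 2 + 1 / 10) = 1 + (8 : ℝ) / 5 by norm_num, Real.rpow_add (by positivity), Real.rpow_one]
    have hpow : (ρ * (1 + 8 * x)) ^ ((8 : ℝ) / 5) ≤ 4 * ρ ^ ((8 : ℝ) / 5) := by
      rw [Real.mul_rpow hρ.le h18.le, mul_comm]
      gcongr
      calc (1 + 8 * x) ^ ((8 : ℝ) / 5) ≤ (2 : ℝ) ^ ((8 : ℝ) / 5) :=
            Real.rpow_le_rpow h18.le (by linarith) (by norm_num)
        _ ≤ (2 : ℝ) ^ ((2 : ℕ) : ℝ) := Real.rpow_le_rpow_of_exponent_le (by norm_num) (by norm_num)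
        _ = 4 := by rw [Real.rpow_natCast]; norm_num
    rw [hsplit]
    calc 1 / (1 + 8 * x) * (K * (ρ * (1 + 8 * x) * (ρ * (1 + 8 * x)) ^ ((8 : ℝ) / 5)))
        = K * ρ * (ρ * (1 + 8 * x)) ^ ((8 : ℝ) / 5) := by field_simp
      _ ≤ K * ρ * (4 * ρ ^ ((8 : ℝ) / 5)) := by gcongr
      _ = 4 * K * (ρ * ρ ^ ((8 : ℝ) / 5)) := by ring
      _ = 4 * K * ρ ^ ((5 : ℝ) / 2 + 1 / 10) := by rw [mul_rpow_eight_fifths hρ]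
  rw [mul_add]
  refine (add_le_add h1 h2).trans (le_of_eq ?_)
  rw [sq_mul_rpow_three_fifths hρ]
  ring


/-- `(1 + 2x)³ < 1 + 8x` for `0 < x ≤ 1/8`. [folklore] -/
theorem one_add_two_mul_pow_three_lt {x : ℝ} (hx0 : 0 < x) (hx : x ≤ 1 / 8) : (1 + 2 * x) ^ 3 < 1 + 8 * x := by
  nlinarith [mul_pos hx0 hx0, mul_pos (mul_pos hx0 hx0) hx0]

/-- **The padded density condition.** If `2ℓ ≤ Lx`, `R' + 1 ≤ Lx`, `0 < x ≤ 1/8` and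
`ρ(1+8x)L³ ≤ N₀`, then `ρ(L + 2ℓ + R' + 1)³ < N₀` (since `(1 + 2x)³ < 1 + 8x`). [folklore] -/
theorem padded_density_lt {Lp ℓ R' x ρ : ℝ} {N₀ : ℕ} (hLp : 0 < Lp) (hρ : 0 < ρ) (hx0 : 0 < x) (hx : x ≤ 1 / 8)
    (h1 : 2 * ℓ ≤ Lp * x) (h2 : R' + 1 ≤ Lp * x) (hℓ : 0 ≤ ℓ) (hR' : 0 ≤ R')
    (hN : ρ * (1 + 8 * x) * Lp ^ 3 ≤ N₀) : ρ * (Lp + 2 * ℓ + R' + 1) ^ 3 < N₀ := by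
  have hd : Lp + 2 * ℓ + R' + 1 ≤ Lp * (1 + 2 * x) := by
    have : Lp * (1 + 2 * x) = Lp + Lp * x + Lp * x := by ring
    linarith
  have hd0 : 0 ≤ Lp + 2 * ℓ + R' + 1 := by positivity
  calc ρ * (Lp + 2 * ℓ + R' + 1) ^ 3 ≤ ρ * (Lp * (1 + 2 * x)) ^ 3 := by gcongr
    _ = ρ * Lp ^ 3 * (1 + 2 * x) ^ 3 := by ring
    _ < ρ * Lp ^ 3 * (1 + 8 * x) :=
        mul_lt_mul_of_pos_left (one_add_two_mul_pow_three_lt hx0 hx) (by positivity)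
    _ = ρ * (1 + 8 * x) * Lp ^ 3 := by ring
    _ ≤ N₀ := hN

set_option maxHeartbeats 800000 in
/-- **Theorem 1.1 from periodic Lee–Huang–Yang blocks (the assembly "Proof of Theorem 1.1" of
[BastiCenatiempoSchlein2021, §1], canonical form).** Suppose that for every admissible potential
there are `K, ρ₁ > 0` such that for all `0 < ρ̃ < ρ₁` some number `N₀ ≥ ρ̃ L³` of bosons on the
torus of side `L = ρ̃^{-11/10}` has periodic ground-state energy
`E₀^per(N₀, L) ≤ (4π𝔞ρ̃²(1 + (128/(15√π))√(ρ̃𝔞³)) + Kρ̃^{5/2+1/10}) L³` (a canonical version of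
Prop. 1.3 with `γ = 11/10`, the paper's final choice). Then `BastiCenatiempoSchlein2021_upperBound`
holds: given `ρ`, take `ρ̃ = ρ(1 + 8ρ^{3/5})` (the density shift (1.8)), cut the torus state off
into the Dirichlet box `Λ_{L(1+1/M)}`, `M = ⌈ρ^{-3/5}⌉` (`exists_dirichlet_le_periodic`, Lemma A.1),
and replicate (`limsup_energyDensity_le_of_block`, Lemma A.2/(A.13)); the density shift, the
kinetic excess `4/M` and the cut-off cost `C N₀ M/L²` are all `O(ρ^{5/2+1/10})`, as in the paper's
balance `α = 1/(2γ)`, `γ = 11/10`. (The printed Prop. 1.3 is grand-canonical and is combined with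
Lemma A.4 instead; that route needs the convexity of `e(ρ)`.)
[cite: BastiCenatiempoSchlein2021, Thm. 1.1, Proof of Thm. 1.1 (1.6)–(1.8), Props. 1.2–1.3] -/
theorem BastiCenatiempoSchlein2021_upperBound_of_periodicLHYBlocks
    (hblocks : ∀ (v : ℝ → ℝ≥0∞) (R : ℝ), Measurable v → (∀ r, R < r → v r = 0) →
      (∫⁻ x : Space, v ‖x‖ ^ 3) ≠ ⊤ → scatteringLength v ≤ ENNReal.ofReal R →
      ∃ K ρ₁ : ℝ, 0 < K ∧ 0 < ρ₁ ∧ ∀ ρt : ℝ, 0 < ρt → ρt < ρ₁ →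
        ∃ N₀ : ℕ, ρt * (ρt ^ (-(11 : ℝ) / 10)) ^ 3 ≤ N₀ ∧
          periodicGroundStateEnergy v N₀ (ρt ^ (-(11 : ℝ) / 10)) ≤
            ENNReal.ofReal ((4 * Real.pi * (scatteringLength v).toReal * ρt ^ 2 *
                (1 + lhyConstant * Real.sqrt (ρt * (scatteringLength v).toReal ^ 3)) +
              K * ρt ^ ((5 : ℝ) / 2 + 1 / 10)) * (ρt ^ (-(11 : ℝ) / 10)) ^ 3)) :
    BastiCenatiempoSchlein2021_upperBound := by
  intro v R hmeas hsupp hL3 hRa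
  -- the range, made non-negative
  set R' : ℝ := max R 0 with hR'def
  have hR'0 : 0 ≤ R' := le_max_right _ _
  have hv' : ∀ r, R' < r → v r = 0 := fun r hr ↦ hsupp r (lt_of_le_of_lt (le_max_left _ _) hr)
  obtain ⟨K, ρ₁, hK, hρ₁, hH⟩ := hblocks v R hmeas hsupp hL3 hRa
  obtain ⟨Cl, hCl, hloc⟩ := exists_dirichlet_le_periodic
  set a : ℝ := (scatteringLength v).toReal with ha
  have ha0 : 0 ≤ a := ENNReal.toReal_nonneg
  have hc₀ := lhyConstant_pos
  -- constants
  set T₀ : ℝ := 4 * Real.pi * a * (1 + lhyConstant * Real.sqrt (a ^ 3)) with hT₀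
  set C₁ : ℝ := 32 * Real.pi * a * (1 + 2 * lhyConstant * Real.sqrt (a ^ 3)) + 4 * K with hC₁
  have hT₀0 : 0 ≤ T₀ := by positivity
  have hC₁0 : 0 < C₁ := by positivity
  set C : ℝ := C₁ + 4 * (T₀ + C₁) + 40 * Cl with hC
  -- thresholds
  set ρ₀ : ℝ := min (min (1 / 2) ((1 / 8 : ℝ) ^ ((5 : ℝ) / 3))) (min (ρ₁ / 2) ((2 * (R' + 1)) ^ (-(5 : ℝ) / 2))) with hρ₀
  have hρ₀pos : 0 < ρ₀ := by positivity
  refine ⟨C, ρ₀, by positivity, hρ₀pos, fun ρ hρ hρρ₀ ↦ ?_⟩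
  simp only []
  have hρhalf : ρ ≤ 1 / 2 := hρρ₀.le.trans ((min_le_left _ _).trans (min_le_left _ _))
  have hρ1 : ρ ≤ 1 := by linarith
  have hρ8 : ρ ≤ (1 / 8 : ℝ) ^ ((5 : ℝ) / 3) := hρρ₀.le.trans ((min_le_left _ _).trans (min_le_right _ _))
  have hρρ₁ : ρ < ρ₁ / 2 := lt_of_lt_of_le hρρ₀ ((min_le_right _ _).trans (min_le_left _ _))
  have hρR : ρ ≤ (2 * (R' + 1)) ^ (-(5 : ℝ) / 2) := hρρ₀.le.trans ((min_le_right _ _).trans (min_le_right _ _))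
  -- `x = ρ^{3/5} ≤ 1/8`
  set x : ℝ := ρ ^ ((3 : ℝ) / 5) with hxdef
  have hx0 : 0 < x := Real.rpow_pos_of_pos hρ _
  have hx : x ≤ 1 / 8 := by
    calc x ≤ ((1 / 8 : ℝ) ^ ((5 : ℝ) / 3)) ^ ((3 : ℝ) / 5) := Real.rpow_le_rpow hρ.le hρ8 (by norm_num)
      _ = 1 / 8 := by rw [← Real.rpow_mul (by norm_num)]; norm_num
  have hx1 : x ≤ 1 := by linarith
  -- `2(R'+1) ρ^{2/5} ≤ 1`
  have hRρ : 2 * (R' + 1) * ρ ^ ((2 : ℝ) / 5) ≤ 1 := by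
    have h1 : ρ ^ ((2 : ℝ) / 5) ≤ ((2 * (R' + 1)) ^ (-(5 : ℝ) / 2)) ^ ((2 : ℝ) / 5) :=
      Real.rpow_le_rpow hρ.le hρR (by norm_num)
    rw [← Real.rpow_mul (by positivity), show (-(5 : ℝ) / 2 * (2 / 5)) = -1 by norm_num, Real.rpow_neg_one] at h1
    calc 2 * (R' + 1) * ρ ^ ((2 : ℝ) / 5) ≤ 2 * (R' + 1) * (2 * (R' + 1))⁻¹ := by gcongr
      _ = 1 := mul_inv_cancel₀ (by positivity)
  -- the adjusted density and the block
  set ρt : ℝ := ρ * (1 + 8 * x) with hρtdef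
  have hρt0 : 0 < ρt := by positivity
  have hρt2 : ρt ≤ 2 * ρ := by rw [hρtdef]; nlinarith
  have hρt1 : ρt ≤ 1 := by linarith
  have hρtρ₁ : ρt < ρ₁ := by linarith
  obtain ⟨N₀, hN₀ge, hEper⟩ := hH ρt hρt0 hρtρ₁
  set Lp : ℝ := ρt ^ (-(11 : ℝ) / 10) with hLpdef
  have hLp0 : 0 < Lp := Real.rpow_pos_of_pos hρt0 _
  have hLpinv : Lp⁻¹ ≤ 2 * ρ := by
    -- `Lp ≥ ρt^{-1} ≥ (2ρ)^{-1}`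
    have h1 : ρt⁻¹ ≤ Lp := by
      rw [hLpdef, ← Real.rpow_neg_one]
      exact Real.rpow_le_rpow_of_exponent_ge hρt0 hρt1 (by norm_num)
    calc Lp⁻¹ ≤ (ρt⁻¹)⁻¹ := by gcongr
      _ = ρt := inv_inv _
      _ ≤ 2 * ρ := hρt2
  have hLpinv2 : (Lp ^ 2)⁻¹ ≤ 2 ^ ((11 : ℝ) / 5) * ρ ^ ((11 : ℝ) / 5) := by
    -- `Lp = ρt^{-11/10} ≥ (2ρ)^{-11/10}`
    have h1 : (2 * ρ) ^ (-(11 : ℝ) / 10) ≤ Lp := by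
      rw [hLpdef]
      exact Real.rpow_le_rpow_of_nonpos hρt0 hρt2 (by norm_num)
    have h2 : (Lp ^ 2)⁻¹ ≤ (((2 * ρ) ^ (-(11 : ℝ) / 10)) ^ 2)⁻¹ := by
      gcongr
    refine h2.trans (le_of_eq ?_)
    rw [← Real.rpow_natCast, ← Real.rpow_mul (by positivity), ← Real.rpow_neg (by positivity),
      Real.mul_rpow (by norm_num) hρ.le]
    norm_num
  have hN₀pos' : (0 : ℝ) < N₀ := lt_of_lt_of_le (by positivity) hN₀ge
  have hN₀pos : 0 < N₀ := Nat.cast_pos.1 hN₀pos'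
  -- the cut-off parameters
  set M : ℕ := ⌈ρ ^ (-(3 : ℝ) / 5)⌉₊ with hMdef
  have hxinv : ρ ^ (-(3 : ℝ) / 5) = x⁻¹ := by rw [hxdef, ← Real.rpow_neg hρ.le]; norm_num
  have hMge : x⁻¹ ≤ M := by rw [hMdef, ← hxinv]; exact Nat.le_ceil _
  have hx_inv1 : 1 ≤ x⁻¹ := one_le_inv_iff₀.2 ⟨hx0, hx1⟩
  have hM1 : (1 : ℝ) ≤ M := hx_inv1.trans hMge
  have hM : 0 < M := by exact_mod_cast (show (0 : ℝ) < M by linarith)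
  have hMr : (0 : ℝ) < M := by exact_mod_cast hM
  have hMle : (M : ℝ) ≤ 2 * x⁻¹ := by
    have := Nat.ceil_lt_add_one (Real.rpow_nonneg hρ.le (-(3 : ℝ) / 5))
    rw [← hMdef, hxinv] at this
    linarith
  have hMinv : (M : ℝ)⁻¹ ≤ x := by
    rw [inv_le_comm₀ hMr hx0]; exact hMge
  set ℓ : ℝ := Lp / (2 * M) with hℓdef
  have hℓ0 : 0 < ℓ := by positivity
  have h2ℓM : 2 * ℓ * M = Lp := by rw [hℓdef]; field_simp
  -- Lemma A.1 and Lemma A.2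
  have hlocN := hloc N₀ ℓ M v hℓ0 hM hmeas
  rw [h2ℓM] at hlocN
  have hρd : ρ * (Lp + 2 * ℓ + R' + 1) ^ 3 < N₀ := by
    have h1 : 2 * ℓ ≤ Lp * x := by
      rw [hℓdef]
      calc 2 * (Lp / (2 * M)) = Lp * (M : ℝ)⁻¹ := by field_simp
        _ ≤ Lp * x := by gcongr
    have hLpge : (2 * ρ)⁻¹ ≤ Lp := (inv_le_comm₀ hLp0 (by positivity)).1 hLpinv
    have h2 : R' + 1 ≤ Lp * x := by
      -- `(R'+1)·2ρ = 2(R'+1)ρ^{2/5}·ρ^{3/5} ≤ x`, so `R' + 1 ≤ x/(2ρ) ≤ Lp x`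
      have h9 : ρ = ρ ^ ((2 : ℝ) / 5) * ρ ^ ((3 : ℝ) / 5) := by
        rw [← Real.rpow_add hρ]; norm_num
      have h4 : (R' + 1) * (2 * ρ) ≤ x := by
        calc (R' + 1) * (2 * ρ) = (2 * (R' + 1) * ρ ^ ((2 : ℝ) / 5)) * ρ ^ ((3 : ℝ) / 5) := by
              conv_lhs => rw [h9]
              ring
          _ ≤ 1 * ρ ^ ((3 : ℝ) / 5) := by gcongr
          _ = x := by rw [one_mul, hxdef]
      have h5 : R' + 1 ≤ x * (2 * ρ)⁻¹ := by
        rw [← div_eq_mul_inv, le_div_iff₀ (by positivity)]; exact h4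
      exact h5.trans (by nlinarith [mul_le_mul_of_nonneg_left hLpge hx0.le])
    have hN : ρ * (1 + 8 * x) * Lp ^ 3 ≤ N₀ := by rw [← hρtdef]; exact hN₀ge
    exact padded_density_lt hLp0 hρ hx0 hx h1 h2 hℓ0.le hR'0 hN
  have hblock := limsup_energyDensity_le_of_block hv' hmeas hR'0 hN₀pos (L₀ := Lp + 2 * ℓ) (by positivity) hρ
    (d := Lp + 2 * ℓ + R' + 1) (by linarith) hρd
  -- the main real bound
  set B : ℝ := 4 * Real.pi * a * ρt ^ 2 * (1 + lhyConstant * Real.sqrt (ρt * a ^ 3)) +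
    K * ρt ^ ((5 : ℝ) / 2 + 1 / 10) with hBdef
  have hB0 : 0 ≤ B := by positivity
  set MT : ℝ := 4 * Real.pi * ρ ^ 2 * a * (1 + lhyConstant * Real.sqrt (ρ * a ^ 3)) with hMT
  have hmain : ρ / ρt * B ≤ MT + C₁ * ρ ^ ((5 : ℝ) / 2 + 1 / 10) :=
    lhy_mainTerm_adjusted_le (c₀ := lhyConstant) (K := K) ha0 hc₀.le hK.le hρ hρ1 hx
  have hMT0 : 0 ≤ MT := by positivity
  have hMTle : MT ≤ T₀ * ρ ^ 2 := by
    rw [hMT, hT₀]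
    have : Real.sqrt (ρ * a ^ 3) ≤ Real.sqrt (a ^ 3) := Real.sqrt_le_sqrt (by nlinarith [pow_nonneg ha0 3])
    calc 4 * Real.pi * ρ ^ 2 * a * (1 + lhyConstant * Real.sqrt (ρ * a ^ 3))
        ≤ 4 * Real.pi * ρ ^ 2 * a * (1 + lhyConstant * Real.sqrt (a ^ 3)) := by gcongr
      _ = _ := by ring
  have hρ26 : ρ ^ ((5 : ℝ) / 2 + 1 / 10) = ρ ^ 2 * x := by rw [hxdef, sq_mul_rpow_three_fifths hρ]
  have hρ26' : 0 < ρ ^ ((5 : ℝ) / 2 + 1 / 10) := Real.rpow_pos_of_pos hρ _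
  have hρ26le : ρ ^ ((5 : ℝ) / 2 + 1 / 10) ≤ ρ ^ 2 := by
    rw [hρ26]; exact mul_le_of_le_one_right (sq_nonneg _) hx1
  -- (a) the block term
  have hterm1 : ρ / N₀ * ((1 + 4 / (M : ℝ)) * (B * Lp ^ 3)) ≤ MT + (C₁ + 4 * (T₀ + C₁)) * ρ ^ ((5 : ℝ) / 2 + 1 / 10) := by
    have h1 : ρ / N₀ * (B * Lp ^ 3) ≤ ρ / ρt * B := by
      have hfrac : Lp ^ 3 / N₀ ≤ 1 / ρt := by
        rw [div_le_div_iff₀ hN₀pos' hρt0, one_mul]; linarith [hN₀ge]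
      calc ρ / N₀ * (B * Lp ^ 3) = ρ * B * (Lp ^ 3 / N₀) := by ring
        _ ≤ ρ * B * (1 / ρt) := by gcongr
        _ = ρ / ρt * B := by ring
    have h3 : 4 / (M : ℝ) ≤ 4 * x := by rw [div_eq_mul_inv]; gcongr
    calc ρ / N₀ * ((1 + 4 / (M : ℝ)) * (B * Lp ^ 3)) = (1 + 4 / (M : ℝ)) * (ρ / N₀ * (B * Lp ^ 3)) := by ring
      _ ≤ (1 + 4 * x) * (MT + C₁ * ρ ^ ((5 : ℝ) / 2 + 1 / 10)) := by gcongr; exact h1.trans hmain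
      _ = MT + C₁ * ρ ^ ((5 : ℝ) / 2 + 1 / 10) + 4 * x * (MT + C₁ * ρ ^ ((5 : ℝ) / 2 + 1 / 10)) := by ring
      _ ≤ MT + C₁ * ρ ^ ((5 : ℝ) / 2 + 1 / 10) + 4 * x * (T₀ * ρ ^ 2 + C₁ * ρ ^ 2) := by gcongr
      _ = MT + (C₁ + 4 * (T₀ + C₁)) * ρ ^ ((5 : ℝ) / 2 + 1 / 10) := by rw [hρ26]; ring
  -- (b) the cut-off term
  have hterm2 : ρ / N₀ * (Cl * N₀ / (M * ℓ ^ 2)) ≤ 40 * Cl * ρ ^ ((5 : ℝ) / 2 + 1 / 10) := by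
    have h1 : ρ / N₀ * (Cl * N₀ / (M * ℓ ^ 2)) = 4 * ρ * Cl * M * (Lp ^ 2)⁻¹ := by
      rw [hℓdef]; field_simp; ring
    rw [h1]
    have h22 : (2 : ℝ) ^ ((11 : ℝ) / 5) ≤ 5 := by
      calc (2 : ℝ) ^ ((11 : ℝ) / 5) = ((2 : ℝ) ^ (11 : ℕ)) ^ ((5 : ℕ) : ℝ)⁻¹ := by
            rw [← Real.rpow_natCast, ← Real.rpow_mul (by norm_num)]; norm_num
        _ ≤ ((5 : ℝ) ^ (5 : ℕ)) ^ ((5 : ℕ) : ℝ)⁻¹ :=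
            Real.rpow_le_rpow (by norm_num) (by norm_num) (by norm_num)
        _ = 5 := Real.pow_rpow_inv_natCast (by norm_num) (by norm_num)
    have hcomb : ρ * x⁻¹ * ρ ^ ((11 : ℝ) / 5) = ρ ^ ((5 : ℝ) / 2 + 1 / 10) := by
      have hx' : x⁻¹ = ρ ^ (-((3 : ℝ) / 5)) := by rw [hxdef, Real.rpow_neg hρ.le]
      rw [hx']
      conv_lhs => rw [show ρ * ρ ^ (-((3 : ℝ) / 5)) * ρ ^ ((11 : ℝ) / 5) =
        ρ ^ (1 : ℝ) * ρ ^ (-((3 : ℝ) / 5)) * ρ ^ ((11 : ℝ) / 5) by rw [Real.rpow_one]]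
      rw [← Real.rpow_add hρ, ← Real.rpow_add hρ]
      norm_num
    calc 4 * ρ * Cl * M * (Lp ^ 2)⁻¹ ≤ 4 * ρ * Cl * (2 * x⁻¹) * (2 ^ ((11 : ℝ) / 5) * ρ ^ ((11 : ℝ) / 5)) := by gcongr
      _ ≤ 4 * ρ * Cl * (2 * x⁻¹) * (5 * ρ ^ ((11 : ℝ) / 5)) := by gcongr
      _ = 40 * Cl * (ρ * x⁻¹ * ρ ^ ((11 : ℝ) / 5)) := by ring
      _ = 40 * Cl * ρ ^ ((5 : ℝ) / 2 + 1 / 10) := by rw [hcomb]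
  -- assemble in `ℝ≥0∞`
  have h14 : (1 + 4 / (M : ℝ≥0∞)) = ENNReal.ofReal (1 + 4 / (M : ℝ)) := by
    rw [ENNReal.ofReal_add zero_le_one (by positivity), ENNReal.ofReal_one,
      ENNReal.ofReal_div_of_pos hMr, ENNReal.ofReal_ofNat, ENNReal.ofReal_natCast]
  calc limsup (fun N : ℕ ↦ groundStateEnergy v N (sideLength ρ N) / ENNReal.ofReal (sideLength ρ N ^ 3)) atTop
      ≤ ENNReal.ofReal (ρ / N₀) * groundStateEnergy v N₀ (Lp + 2 * ℓ) := hblock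
    _ ≤ ENNReal.ofReal (ρ / N₀) * ((1 + 4 / (M : ℝ≥0∞)) * periodicGroundStateEnergy v N₀ Lp +
        ENNReal.ofReal (Cl * N₀ / (M * ℓ ^ 2))) := by gcongr
    _ ≤ ENNReal.ofReal (ρ / N₀) * ((1 + 4 / (M : ℝ≥0∞)) * ENNReal.ofReal (B * Lp ^ 3) +
        ENNReal.ofReal (Cl * N₀ / (M * ℓ ^ 2))) := by gcongr
    _ = ENNReal.ofReal (ρ / N₀ * ((1 + 4 / (M : ℝ)) * (B * Lp ^ 3)) + ρ / N₀ * (Cl * N₀ / (M * ℓ ^ 2))) := by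
        rw [h14, ← ENNReal.ofReal_mul (by positivity), ← ENNReal.ofReal_add (by positivity) (by positivity),
          ← ENNReal.ofReal_mul (by positivity), mul_add]
    _ ≤ ENNReal.ofReal (MT + C * ρ ^ ((5 : ℝ) / 2 + 1 / 10)) := by
        refine ENNReal.ofReal_le_ofReal ?_
        calc _ ≤ (MT + (C₁ + 4 * (T₀ + C₁)) * ρ ^ ((5 : ℝ) / 2 + 1 / 10)) + 40 * Cl * ρ ^ ((5 : ℝ) / 2 + 1 / 10) :=
              add_le_add hterm1 hterm2
          _ = MT + C * ρ ^ ((5 : ℝ) / 2 + 1 / 10) := by rw [hC]; ring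

end Assembly

end Literature.MathematicalPhysics.QuantumManyBody.BoseGas

end
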